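import Literature.Analysis.Fourier.PaleyWienerHalfPlane
import Literature.Analysis.Fourier.SchwarzIntegral
import Literature.Analysis.Fourier.HilbertTransformDecay
import Literature.Analysis.Fourier.SqrtDampingFactor
import Literature.Analysis.Fourier.BoundarySpectrumSymmetry
import Literature.Analysis.Fourier.AdaptedMultiplierWeight
import Literature.Analysis.Fourier.FractalUncertaintyWeightedStep
import Literature.Analysis.Fourier.FractalUncertaintyPrincipleProofs
import Literature.Analysis.Fourier.FractalUncertaintyReduction
import Literature.Analysis.Fourier.SmoothWindowKernel
import Mathlib.Analysis.SpecialFunctions.Integrals.Basic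
import Mathlib.Analysis.SpecialFunctions.Exponential
import Mathlib.MeasureTheory.Integral.IntegralEqImproper
import Mathlib.MeasureTheory.Group.LIntegral
import HarnessLib

/-!
# BD18 Theorem 4 (fractal uncertainty principle for `δ`-regular sets): the discharge

Topic `Literature/Analysis/Fourier`. J. Bourgain, S. Dyatlov, *Spectral gaps without the pressure
condition*, Ann. of Math. 187 (2018) 825–867 (= arXiv:1612.09040), Theorem 4: for `0 ≤ δ < 1`,
`C_R ≥ 1` there are `β > 0`, `C` such that for all `N ≥ 1` and all `X ⊂ [-1,1]`, `Y ⊂ [-N,N]`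
which are `δ`-regular with constant `C_R` on scales `N⁻¹` to `1`, resp. `1` to `N`,
`‖1_X 𝓕⁻ 1_Y‖_{L² → L²} ≤ C N^{-β}` — the named fact `bourgainDyatlov2018_thm4` of
`FractalUncertaintyPrinciple.lean`. This file proves it: `bourgainDyatlov2018_thm4_holds` (Part 6).

The proof follows the paper (§§2–3) with ONE deviation: the adapted multiplier of Lemma 3.1 is
not obtained from the Beurling–Malliavin multiplier theorem but by an explicit holomorphic
construction on the upper half-plane (after L. Jin, R. Zhang, *Fractal uncertainty principle with
explicit exponent*, arXiv:1710.00250, Theorem 12 and Lemma 13), Parts 1–4 below, which use the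
half-plane Paley–Wiener theorem (`PaleyWienerHalfPlane.lean`), Schwarz integrals
(`SchwarzIntegral.lean`), the decay of truncated Hilbert transforms (`HilbertTransformDecay.lean`),
the damping factor `exp(-a(1-iz)^{1/2})` (`SqrtDampingFactor.lean`) and the spectral symmetry of
the boundary values (`BoundarySpectrumSymmetry.lean`). The other pieces are in the tree:
§2.2, §3.4 and the reduction of Theorem 4 to Proposition 3.1 (`bourgainDyatlov2018_thm4_of_prop31`,
`FractalUncertaintyReduction.lean`), Lemma 3.2 (`bourgainDyatlov2018_lemma_3_2`,
`FractalUncertaintyHarmonicBound.lean`) and the weighted form of Lemma 3.3 (`weighted_step`,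
`FractalUncertaintyWeightedStep.lean`). The parts of this file (all six were developed as separate
files and are merged here only so that the discharge lands in one piece):

1. bounds for the conjugate Poisson integral of a corrected sawtooth phase;
2. the effective multiplier theorem (`effective_multiplier`, after Jin–Zhang Theorem 12);
3. the adapted weight with Lipschitz Hilbert transform (`exists_adaptedWeight_hilbert`, Jin–Zhang
   Lemma 13);
4. BD18 Lemma 3.1 without Beurling–Malliavin (`bd18_lemma_3_1`);
5. BD18 Proposition 3.1 from Lemma 3.1 (`bd18_prop31_of_lemma31`, the paper's §3.3 with `L²`
   weights in place of `H^{-10}` norms);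
6. `bd18_prop31` and the discharge `bourgainDyatlov2018_thm4_holds`.

No definitions and no new named facts are introduced.
-/

/-!
## Part 1. Bounds for the conjugate Poisson integral of a corrected sawtooth phase

Topic `Literature/Analysis/Fourier`. The real-variable heart of the explicit multiplier
construction of Jin–Zhang (arXiv:1710.00250, proof of Theorem 12, estimates (e:j2), (e:j3),
(e:j1-bd-1), (e:j1-bd-2), (e:mbd-1), (e:mbd-2)), transposed from the Hilbert transform to the
modified conjugate Poisson integral

  `Q_y[s](x) = π⁻¹ ∫ s(t) ((x-t)/((x-t)²+y²) + t/(1+t²)) dt`,  `y > 0`,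

of the bounded phase `s = s₀ - π⌊s₀/π⌋ - π/2 ∈ [-π/2, π/2)`, where `s₀` is continuous, increasing
and `L`-Lipschitz:

* `setIntegral_far_abs_conjPoissonKernel_le` — the kernel has `L¹` norm
  `≤ 15 + log(1+y²) + 4 log(3|x|+3)` on `{|x-t| ≥ 1/2}` (logarithmic in `x` and `y`);
* `conjPoissonIntegral_shiftedSawtooth_ge` — the ONE-SIDED bound
  `Q_y[s](x) ≥ -(L/π + 1/4 + (15 + log(1+y²) + 4 log(3|x|+3))/2)` for all `x` and `y > 0`
  (the jumps of `⌊s₀/π⌋` only help: `-(k(t)-k(x))(x-t) ≥ 0`);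
* `abs_conjPoissonIntegral_shiftedSawtooth_le` — the two-sided bound where `⌊s₀/π⌋` is constant on
  `(x - 1/2, x + 1/2)`.

All statements are folklore real analysis; no definitions are introduced.
-/

namespace Literature.Analysis.Fourier

open _root_.MeasureTheory Set Filter Metric
open scoped Real Topology

/-! ### Elementary integrals -/

section Elementary

/-- `∫_{[0, R]} t/(1+t²) dt = log(1+R²)/2`. [folklore] -/
theorem integral_Icc_self_div_one_add_sq (R : ℝ) :
    ∫ t in (0 : ℝ)..R, t / (1 + t ^ 2) = Real.log (1 + R ^ 2) / 2 := by
  have hderiv : ∀ t ∈ uIcc (0 : ℝ) R,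
      HasDerivAt (fun t : ℝ => Real.log (1 + t ^ 2) / 2) (t / (1 + t ^ 2)) t := by
    intro t _
    have hD : 1 + t ^ 2 ≠ 0 := by positivity
    have h1 : HasDerivAt (fun t : ℝ => 1 + t ^ 2) (2 * t) t := by
      simpa using (hasDerivAt_pow 2 t).const_add 1
    refine ((h1.log hD).div_const 2).congr_deriv ?_
    field_simp
  rw [intervalIntegral.integral_eq_sub_of_hasDerivAt hderiv
    ((Continuous.div continuous_id (by fun_prop) fun t => by positivity).intervalIntegrable _ _)]
  simp

/-- `∫_{[-R, 0]} (-t)/(1+t²) dt = log(1+R²)/2`. [folklore] -/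
theorem integral_Icc_neg_self_div_one_add_sq (R : ℝ) :
    ∫ t in (-R : ℝ)..0, -t / (1 + t ^ 2) = Real.log (1 + R ^ 2) / 2 := by
  have hderiv : ∀ t ∈ uIcc (-R : ℝ) 0,
      HasDerivAt (fun t : ℝ => -(Real.log (1 + t ^ 2) / 2)) (-t / (1 + t ^ 2)) t := by
    intro t _
    have hD : 1 + t ^ 2 ≠ 0 := by positivity
    have h1 : HasDerivAt (fun t : ℝ => 1 + t ^ 2) (2 * t) t := by
      simpa using (hasDerivAt_pow 2 t).const_add 1
    refine ((h1.log hD).div_const 2).neg.congr_deriv ?_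
    field_simp
  rw [intervalIntegral.integral_eq_sub_of_hasDerivAt hderiv
    ((Continuous.div (by fun_prop) (by fun_prop) fun t => by positivity).intervalIntegrable _ _)]
  simp

/-- `∫_{[-R, R]} |t|/(1+t²) dt = log(1+R²)`. [folklore] -/
theorem integral_abs_div_one_add_sq {R : ℝ} (hR : 0 ≤ R) :
    ∫ t in (-R : ℝ)..R, |t| / (1 + t ^ 2) = Real.log (1 + R ^ 2) := by
  have hc : Continuous fun t : ℝ => |t| / (1 + t ^ 2) :=
    Continuous.div (by fun_prop) (by fun_prop) fun t => by positivity
  rw [← intervalIntegral.integral_add_adjacent_intervals (b := 0) (hc.intervalIntegrable _ _)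
    (hc.intervalIntegrable _ _)]
  have h1 : ∫ t in (-R : ℝ)..0, |t| / (1 + t ^ 2) = ∫ t in (-R : ℝ)..0, -t / (1 + t ^ 2) := by
    refine intervalIntegral.integral_congr fun t ht => ?_
    rw [uIcc_of_le (by linarith)] at ht
    rw [abs_of_nonpos ht.2]
  have h2 : ∫ t in (0 : ℝ)..R, |t| / (1 + t ^ 2) = ∫ t in (0 : ℝ)..R, t / (1 + t ^ 2) := by
    refine intervalIntegral.integral_congr fun t ht => ?_
    rw [uIcc_of_le hR] at ht
    rw [abs_of_nonneg ht.1]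
  rw [h1, h2, integral_Icc_neg_self_div_one_add_sq R, integral_Icc_self_div_one_add_sq R]
  ring

/-- `log(1+R²) ≤ 2 log(1+R)` for `R ≥ 0`. [folklore] -/
theorem log_one_add_sq_le {R : ℝ} (hR : 0 ≤ R) : Real.log (1 + R ^ 2) ≤ 2 * Real.log (1 + R) := by
  rw [← Real.log_rpow (by linarith), Real.rpow_two]
  exact Real.log_le_log (by positivity) (by nlinarith)

end Elementary

/-! ### The far part of the conjugate Poisson kernel -/

section FarKernel

/-- Part (i), small height: for `0 < y ≤ 1` and `|u| ≥ 1/2`,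
`|u| |1-y²| /((u²+y²)(u²+1)) ≤ 2/(1+u²)`. [folklore] -/
theorem kernel_diff_height_le_small {u y : ℝ} (hy : 0 < y) (hy1 : y ≤ 1) (hu : 1 / 2 ≤ |u|) :
    |u| * |1 - y ^ 2| / ((u ^ 2 + y ^ 2) * (u ^ 2 + 1)) ≤ 2 / (1 + u ^ 2) := by
  have hu0 : 0 < |u| := by linarith
  have hy2 : y ^ 2 ≤ 1 := by nlinarith
  have h1 : |1 - y ^ 2| ≤ 1 := by rw [abs_of_nonneg (by linarith)]; nlinarith
  have hD : 0 < (u ^ 2 + y ^ 2) * (u ^ 2 + 1) := by positivity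
  rw [div_le_div_iff₀ hD (by positivity)]
  have hu2 : u ^ 2 = |u| ^ 2 := (sq_abs u).symm
  have h3 : |u| * |1 - y ^ 2| ≤ |u| := mul_le_of_le_one_right (abs_nonneg _) h1
  have h4 : |u| * (1 + u ^ 2) ≤ 2 * (u ^ 2 * (u ^ 2 + 1)) := by
    rw [hu2]
    have ha : 0 ≤ 2 * |u| ^ 2 - |u| := by nlinarith [abs_nonneg u]
    nlinarith [mul_nonneg ha (by positivity : (0 : ℝ) ≤ 1 + |u| ^ 2)]
  have h5 : u ^ 2 * (u ^ 2 + 1) ≤ (u ^ 2 + y ^ 2) * (u ^ 2 + 1) := by nlinarith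
  nlinarith [mul_le_mul_of_nonneg_right h3 (by positivity : (0:ℝ) ≤ 1 + u ^ 2)]

/-- Part (ii), far field: for `|t| ≥ 2|x| + 2`,
`|(x-t)/((x-t)²+1) + t/(1+t²)| ≤ 7|x|/t²`. [folklore] -/
theorem kernel_diff_center_far_le {x t : ℝ} (ht : 2 * |x| + 2 ≤ |t|) :
    |(x - t) / ((x - t) ^ 2 + 1) + t / (1 + t ^ 2)| ≤ 7 * |x| / t ^ 2 := by
  have ht0 : 2 ≤ |t| := by linarith [abs_nonneg x]
  have htpos : 0 < |t| := by linarith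
  have htne : t ≠ 0 := abs_pos.1 htpos
  have ht2 : 0 < t ^ 2 := by positivity
  have hD1 : 0 < (x - t) ^ 2 + 1 := by positivity
  have hD2 : 0 < 1 + t ^ 2 := by positivity
  have heq : (x - t) / ((x - t) ^ 2 + 1) + t / (1 + t ^ 2) =
      x * (-t ^ 2 + t * x + 1) / (((x - t) ^ 2 + 1) * (1 + t ^ 2)) := by
    field_simp; ring
  rw [heq, abs_div, abs_of_pos (mul_pos hD1 hD2), div_le_div_iff₀ (mul_pos hD1 hD2) ht2]
  have hxt : |x| ≤ |t| / 2 := by linarith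
  -- numerator
  have hnum : |x * (-t ^ 2 + t * x + 1)| ≤ |x| * (7 / 4 * t ^ 2) := by
    rw [abs_mul]
    refine mul_le_mul_of_nonneg_left ?_ (abs_nonneg _)
    have h1 : |t * x| ≤ t ^ 2 / 2 := by
      rw [abs_mul]
      have : |t| * |x| ≤ |t| * (|t| / 2) := mul_le_mul_of_nonneg_left hxt (abs_nonneg _)
      rw [← sq_abs t]; nlinarith
    have h2 : (1 : ℝ) ≤ t ^ 2 / 4 := by rw [← sq_abs t]; nlinarith
    calc |-t ^ 2 + t * x + 1| ≤ |-t ^ 2| + |t * x| + |1| := abs_add_three _ _ _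
      _ = t ^ 2 + |t * x| + 1 := by rw [abs_neg, abs_of_nonneg ht2.le, abs_one]
      _ ≤ 7 / 4 * t ^ 2 := by linarith
  -- denominator
  have hden : t ^ 2 / 4 * t ^ 2 ≤ ((x - t) ^ 2 + 1) * (1 + t ^ 2) := by
    have h1 : t ^ 2 / 4 ≤ (x - t) ^ 2 := by
      have h2 : |t| / 2 ≤ |x - t| := by
        have := abs_sub_abs_le_abs_sub t x
        rw [abs_sub_comm] at this; linarith
      have h3 := pow_le_pow_left₀ (by positivity) h2 2
      rw [sq_abs] at h3
      nlinarith [sq_abs t]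
    nlinarith
  calc |x * (-t ^ 2 + t * x + 1)| * t ^ 2 ≤ |x| * (7 / 4 * t ^ 2) * t ^ 2 :=
        mul_le_mul_of_nonneg_right hnum ht2.le
    _ = 7 * |x| * (t ^ 2 / 4 * t ^ 2) := by ring
    _ ≤ 7 * |x| * (((x - t) ^ 2 + 1) * (1 + t ^ 2)) :=
        mul_le_mul_of_nonneg_left hden (by positivity)

end FarKernel

section FarKernelIntegral

/-- **Part (ii) integrated**: `t ↦ (x-t)/((x-t)²+1) + t/(1+t²)` is integrable on `ℝ` with
`∫ |·| ≤ 7 + 4 log(3|x|+3)`. [folklore] -/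
theorem integral_abs_kernel_diff_center_le (x : ℝ) :
    Integrable (fun t : ℝ => (x - t) / ((x - t) ^ 2 + 1) + t / (1 + t ^ 2)) ∧
      ∫ t, |(x - t) / ((x - t) ^ 2 + 1) + t / (1 + t ^ 2)| ≤ 7 + 4 * Real.log (3 * |x| + 3) := by
  set K₂ : ℝ → ℝ := fun t => (x - t) / ((x - t) ^ 2 + 1) + t / (1 + t ^ 2) with hK₂
  set R : ℝ := 2 * |x| + 2 with hR
  have hR2 : 2 ≤ R := by rw [hR]; linarith [abs_nonneg x]
  have hRpos : 0 < R := by linarith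
  have hc : Continuous K₂ := by
    refine (Continuous.div (by fun_prop) (by fun_prop) fun t => ?_).add
      (Continuous.div (by fun_prop) (by fun_prop) fun t => ?_) <;> positivity
  -- near field: integrable on `[-R, R]`
  have hnear : IntegrableOn K₂ (Icc (-R) R) := hc.integrableOn_Icc
  -- far field: bounded by `7|x|/t²`
  obtain ⟨htailI, htail⟩ := Literature.Analysis.InverseSpectral.integral_tail_div_sq hRpos (7 * |x|)
  have hfar_pt : ∀ t ∈ {t : ℝ | R ≤ |t|}, |K₂ t| ≤ 7 * |x| / t ^ 2 := fun t ht =>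
    kernel_diff_center_far_le (by rw [hR] at ht; exact ht)
  have hfar : IntegrableOn K₂ {t : ℝ | R ≤ |t|} := by
    refine Integrable.mono' htailI hc.aestronglyMeasurable.restrict ?_
    exact (ae_restrict_iff' (measurableSet_le measurable_const continuous_abs.measurable)).2 (ae_of_all _ fun t ht => by
      rw [Real.norm_eq_abs]; exact hfar_pt t ht)
  have hcover : Icc (-R) R ∪ {t : ℝ | R ≤ |t|} = univ := by
    ext t
    simp only [mem_union, mem_Icc, mem_setOf_eq, mem_univ, iff_true]
    by_cases h : |t| ≤ R
    · exact Or.inl (abs_le.1 h)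
    · exact Or.inr (le_of_lt (lt_of_not_ge h))
  have hint : Integrable K₂ := by
    rw [← integrableOn_univ, ← hcover]
    exact hnear.union hfar
  refine ⟨hint, ?_⟩
  -- split the integral of `|K₂|` at `|t| = R`
  have hsub : ∫ t, |K₂ t| ≤ (∫ t in Icc (-R) R, |K₂ t|) + ∫ t in {t : ℝ | R ≤ |t|}, |K₂ t| := by
    rw [← integral_add_compl measurableSet_Icc hint.abs]
    refine add_le_add le_rfl ?_
    refine setIntegral_mono_set hint.abs.integrableOn (ae_of_all _ fun t => abs_nonneg (K₂ t))
      (LE.le.eventuallyLE (show (Icc (-R) R)ᶜ ≤ {t : ℝ | R ≤ |t|} from fun t ht => ?_))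
    simp only [mem_compl_iff, mem_Icc, not_and_or, not_le] at ht
    show R ≤ |t|
    rcases ht with h | h
    · rw [abs_of_neg (by linarith)]; linarith
    · rw [abs_of_pos (by linarith)]; linarith
  -- near field bound: `|K₂| ≤ |x-t|/((x-t)²+1) + |t|/(1+t²)`
  have hnear_le : ∫ t in Icc (-R) R, |K₂ t| ≤ Real.log (1 + (3 * |x| + 2) ^ 2) + Real.log (1 + R ^ 2) := by
    have hc1 : Continuous fun t : ℝ => |x - t| / ((x - t) ^ 2 + 1) :=
      Continuous.div (by fun_prop) (by fun_prop) fun t => by positivity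
    have hc2 : Continuous fun t : ℝ => |t| / (1 + t ^ 2) :=
      Continuous.div (by fun_prop) (by fun_prop) fun t => by positivity
    have h1 : ∫ t in Icc (-R) R, |K₂ t| ≤ ∫ t in Icc (-R) R, (|x - t| / ((x - t) ^ 2 + 1) + |t| / (1 + t ^ 2)) := by
      refine setIntegral_mono_on hint.norm.integrableOn (hc1.add hc2).integrableOn_Icc measurableSet_Icc
        (fun t _ => ?_)
      rw [hK₂]
      calc |(x - t) / ((x - t) ^ 2 + 1) + t / (1 + t ^ 2)|
          ≤ |(x - t) / ((x - t) ^ 2 + 1)| + |t / (1 + t ^ 2)| := abs_add_le _ _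
        _ = |x - t| / ((x - t) ^ 2 + 1) + |t| / (1 + t ^ 2) := by
            rw [abs_div, abs_div, abs_of_pos (by positivity : (0:ℝ) < (x - t) ^ 2 + 1),
              abs_of_pos (by positivity : (0:ℝ) < 1 + t ^ 2)]
    refine h1.trans ?_
    rw [integral_Icc_eq_integral_Ioc, ← intervalIntegral.integral_of_le (by linarith),
      intervalIntegral.integral_add (hc1.intervalIntegrable _ _) (hc2.intervalIntegrable _ _),
      integral_abs_div_one_add_sq hRpos.le]
    gcongr
    -- `∫_{-R}^{R} |x-t|/((x-t)²+1) dt = ∫_{x-R}^{x+R} |u|/(u²+1) du ≤ ∫_{-(3|x|+2)}^{3|x|+2}`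
    have hsub' : ∫ t in (-R)..R, |x - t| / ((x - t) ^ 2 + 1) = ∫ u in (x - R)..(x - -R), |u| / (u ^ 2 + 1) :=
      intervalIntegral.integral_comp_sub_left (fun u => |u| / (u ^ 2 + 1)) x
    rw [hsub']
    have hc3 : Continuous fun u : ℝ => |u| / (u ^ 2 + 1) :=
      Continuous.div (by fun_prop) (by fun_prop) fun t => by positivity
    calc ∫ u in (x - R)..(x - -R), |u| / (u ^ 2 + 1)
        ≤ ∫ u in (-(3 * |x| + 2))..(3 * |x| + 2), |u| / (u ^ 2 + 1) := by
          refine intervalIntegral.integral_mono_interval ?_ ?_ ?_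
            (ae_of_all _ fun u => by positivity) (hc3.intervalIntegrable _ _)
          · rw [hR]; linarith [neg_abs_le x]
          · rw [hR]; linarith
          · rw [hR]; linarith [le_abs_self x]
      _ = Real.log (1 + (3 * |x| + 2) ^ 2) := by
          have := integral_abs_div_one_add_sq (R := 3 * |x| + 2) (by positivity)
          rw [← this]
          refine intervalIntegral.integral_congr fun u _ => ?_
          rw [add_comm (u ^ 2) 1]
  -- far field bound
  have hfar_le : ∫ t in {t : ℝ | R ≤ |t|}, |K₂ t| ≤ 7 := by
    calc ∫ t in {t : ℝ | R ≤ |t|}, |K₂ t| ≤ ∫ t in {t : ℝ | R ≤ |t|}, 7 * |x| / t ^ 2 :=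
          setIntegral_mono_on hint.norm.integrableOn htailI (measurableSet_le measurable_const continuous_abs.measurable) hfar_pt
      _ = 2 * (7 * |x|) / R := htail
      _ ≤ 7 := by
          rw [div_le_iff₀ hRpos, hR]
          nlinarith [abs_nonneg x]
  -- logs
  have hlog1 : Real.log (1 + (3 * |x| + 2) ^ 2) ≤ 2 * Real.log (3 * |x| + 3) := by
    have := log_one_add_sq_le (R := 3 * |x| + 2) (by positivity)
    rw [show 1 + (3 * |x| + 2) = 3 * |x| + 3 by ring] at this
    exact this
  have hlog2 : Real.log (1 + R ^ 2) ≤ 2 * Real.log (3 * |x| + 3) := by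
    have h1 := log_one_add_sq_le (R := R) hRpos.le
    have h2 : Real.log (1 + R) ≤ Real.log (3 * |x| + 3) :=
      Real.log_le_log (by linarith) (by rw [hR]; linarith [abs_nonneg x])
    linarith
  linarith

/-- **Part (i) integrated**: for `y > 0`, on `{|x-t| ≥ 1/2}`,
`∫ |(x-t)/((x-t)²+y²) - (x-t)/((x-t)²+1)| ≤ 2π + log(1+y²) + 1`. [folklore] -/
theorem setIntegral_abs_kernel_diff_height_le (x : ℝ) {y : ℝ} (hy : 0 < y) :
    IntegrableOn (fun t : ℝ => (x - t) / ((x - t) ^ 2 + y ^ 2) - (x - t) / ((x - t) ^ 2 + 1))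
        {t : ℝ | 1 / 2 ≤ |x - t|} ∧
      ∫ t in {t : ℝ | 1 / 2 ≤ |x - t|}, |(x - t) / ((x - t) ^ 2 + y ^ 2) - (x - t) / ((x - t) ^ 2 + 1)| ≤
        2 * π + Real.log (1 + y ^ 2) + 1 := by
  set K₁ : ℝ → ℝ := fun t => (x - t) / ((x - t) ^ 2 + y ^ 2) - (x - t) / ((x - t) ^ 2 + 1) with hK₁
  set F : Set ℝ := {t : ℝ | 1 / 2 ≤ |x - t|} with hF
  have hFm : MeasurableSet F := measurableSet_le measurable_const (by fun_prop)
  have hc : Continuous K₁ := by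
    refine (Continuous.div (by fun_prop) (by fun_prop) fun t => ?_).sub
      (Continuous.div (by fun_prop) (by fun_prop) fun t => ?_) <;> positivity
  have hK₁eq : ∀ t, K₁ t = (x - t) * (1 - y ^ 2) / (((x - t) ^ 2 + y ^ 2) * ((x - t) ^ 2 + 1)) := by
    intro t
    have h1 : (x - t) ^ 2 + y ^ 2 ≠ 0 := by positivity
    have h2 : (x - t) ^ 2 + 1 ≠ 0 := by positivity
    rw [hK₁]; field_simp; ring
  have habs : ∀ t, |K₁ t| = |x - t| * |1 - y ^ 2| / (((x - t) ^ 2 + y ^ 2) * ((x - t) ^ 2 + 1)) := by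
    intro t
    rw [hK₁eq, abs_div, abs_mul, abs_of_pos (by positivity : (0:ℝ) < ((x - t) ^ 2 + y ^ 2) * ((x - t) ^ 2 + 1))]
  have hlog0 : 0 ≤ Real.log (1 + y ^ 2) := Real.log_nonneg (by nlinarith)
  rcases le_or_gt y 1 with hy1 | hy1
  · -- small height: `|K₁| ≤ 2/(1+(x-t)²)` on `F`
    have hP : Integrable fun t : ℝ => 2 / (1 + (x - t) ^ 2) := by
      have := (integrable_inv_one_add_sq.comp_sub_left x).const_mul 2
      refine this.congr (ae_of_all _ fun t => ?_)
      simp only [div_eq_mul_inv]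
    have hbd : ∀ t ∈ F, |K₁ t| ≤ 2 / (1 + (x - t) ^ 2) := by
      intro t ht
      rw [habs]
      exact kernel_diff_height_le_small hy hy1 ht
    have hint : IntegrableOn K₁ F := by
      refine Integrable.mono' hP.integrableOn hc.aestronglyMeasurable.restrict ?_
      exact (ae_restrict_iff' hFm).2 (ae_of_all _ fun t ht => by rw [Real.norm_eq_abs]; exact hbd t ht)
    refine ⟨hint, ?_⟩
    calc ∫ t in F, |K₁ t| ≤ ∫ t in F, 2 / (1 + (x - t) ^ 2) :=
          setIntegral_mono_on hint.norm hP.integrableOn hFm hbd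
      _ ≤ ∫ t, 2 / (1 + (x - t) ^ 2) := setIntegral_le_integral hP (ae_of_all _ fun t => by positivity)
      _ = 2 * π := by
          have h1 : ∫ t, 2 / (1 + (x - t) ^ 2) = ∫ u, 2 / (1 + u ^ 2) :=
            integral_sub_left_eq_self (fun u => 2 / (1 + u ^ 2)) volume x
          rw [h1]
          have h2 : (fun u : ℝ => 2 / (1 + u ^ 2)) = fun u => 2 * (1 + u ^ 2)⁻¹ := by
            funext u; rw [div_eq_mul_inv]
          rw [h2, integral_const_mul, integral_univ_inv_one_add_sq]
      _ ≤ 2 * π + Real.log (1 + y ^ 2) + 1 := by linarith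
  · -- large height: integrate over all of `ℝ`, splitting at `|x - t| = y`
    have hy0 : 0 ≤ y := hy.le
    have hy21 : 0 ≤ y ^ 2 - 1 := by nlinarith
    have habs' : ∀ t, |K₁ t| = |x - t| * (y ^ 2 - 1) / (((x - t) ^ 2 + y ^ 2) * ((x - t) ^ 2 + 1)) := by
      intro t; rw [habs, abs_of_nonpos (by nlinarith : 1 - y ^ 2 ≤ 0), neg_sub]
    -- pointwise bounds
    have hnear_bd : ∀ t, |K₁ t| ≤ |x - t| / ((x - t) ^ 2 + 1) := by
      intro t
      rw [habs', mul_div_assoc, div_eq_mul_one_div |x - t|]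
      refine mul_le_mul_of_nonneg_left ?_ (abs_nonneg _)
      rw [div_le_div_iff₀ (by positivity) (by positivity)]
      nlinarith [sq_nonneg (x - t)]
    have hfar_bd : ∀ t, y ≤ |x - t| → |K₁ t| ≤ (y / 2) / (x - t) ^ 2 := by
      intro t ht
      have hu0 : 0 < |x - t| := hy.trans_le ht
      have hune : x - t ≠ 0 := abs_pos.1 hu0
      rw [habs', div_le_div_iff₀ (by positivity) (by positivity)]
      have h1 : (x - t) ^ 2 = |x - t| ^ 2 := (sq_abs _).symm
      -- `|u|(y²-1)·u² ≤ (y/2)(u²+y²)(u²+1)` since `u²+y² ≥ 2|u|y` and `y² - 1 ≤ ... `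
      have h2 : 2 * |x - t| * y ≤ (x - t) ^ 2 + y ^ 2 := by rw [h1]; nlinarith [sq_nonneg (|x - t| - y)]
      have h3 : |x - t| * (y ^ 2 - 1) * (x - t) ^ 2 ≤ |x - t| * y ^ 2 * ((x - t) ^ 2 + 1) := by
        have : 0 ≤ |x - t| := abs_nonneg _
        nlinarith [sq_nonneg (x - t)]
      calc |x - t| * (y ^ 2 - 1) * (x - t) ^ 2 ≤ |x - t| * y ^ 2 * ((x - t) ^ 2 + 1) := h3
        _ = (y / 2) * (2 * |x - t| * y) * ((x - t) ^ 2 + 1) := by ring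
        _ ≤ (y / 2) * ((x - t) ^ 2 + y ^ 2) * ((x - t) ^ 2 + 1) := by gcongr
        _ = y / 2 * (((x - t) ^ 2 + y ^ 2) * ((x - t) ^ 2 + 1)) := by ring
    -- integrability on `ℝ`
    obtain ⟨htailI, htail⟩ := Literature.Analysis.InverseSpectral.integral_tail_div_sq_shift hy (y / 2) x
    have hcN : Continuous fun t : ℝ => |x - t| / ((x - t) ^ 2 + 1) :=
      Continuous.div (by fun_prop) (by fun_prop) fun t => by positivity
    have hint1 : IntegrableOn K₁ (Icc (x - y) (x + y)) := hc.integrableOn_Icc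
    have hint2 : IntegrableOn K₁ {t : ℝ | y ≤ |t - x|} := by
      refine Integrable.mono' htailI hc.aestronglyMeasurable.restrict ?_
      refine (ae_restrict_iff' (measurableSet_le measurable_const (by fun_prop))).2
        (ae_of_all _ fun t ht => ?_)
      rw [Real.norm_eq_abs]
      have ht' : y ≤ |x - t| := by rw [abs_sub_comm]; exact ht
      exact hfar_bd t ht'
    have hcover : Icc (x - y) (x + y) ∪ {t : ℝ | y ≤ |t - x|} = univ := by
      ext t
      simp only [mem_union, mem_Icc, mem_setOf_eq, mem_univ, iff_true]
      by_cases h : |t - x| ≤ y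
      · left; constructor <;> linarith [(abs_le.1 h).1, (abs_le.1 h).2]
      · exact Or.inr (le_of_lt (lt_of_not_ge h))
    have hint : Integrable K₁ := by
      rw [← integrableOn_univ, ← hcover]; exact hint1.union hint2
    refine ⟨hint.integrableOn, ?_⟩
    calc ∫ t in F, |K₁ t| ≤ ∫ t, |K₁ t| := setIntegral_le_integral hint.norm (ae_of_all _ fun t => abs_nonneg _)
      _ ≤ (∫ t in Icc (x - y) (x + y), |K₁ t|) + ∫ t in {t : ℝ | y ≤ |t - x|}, |K₁ t| := by
          rw [← integral_add_compl measurableSet_Icc hint.abs]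
          refine add_le_add le_rfl ?_
          refine setIntegral_mono_set hint.abs.integrableOn (ae_of_all _ fun t => abs_nonneg (K₁ t))
            (LE.le.eventuallyLE (show (Icc (x - y) (x + y))ᶜ ≤ {t : ℝ | y ≤ |t - x|} from fun t ht => ?_))
          simp only [mem_compl_iff, mem_Icc, not_and_or, not_le] at ht
          show y ≤ |t - x|
          rcases ht with h | h
          · rw [abs_of_neg (by linarith)]; linarith
          · rw [abs_of_pos (by linarith)]; linarith
      _ ≤ Real.log (1 + y ^ 2) + 1 := by
          gcongr
          · -- near: `∫_{x-y}^{x+y} |x-t|/((x-t)²+1) dt = log(1+y²)`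
            calc ∫ t in Icc (x - y) (x + y), |K₁ t| ≤ ∫ t in Icc (x - y) (x + y), |x - t| / ((x - t) ^ 2 + 1) :=
                  setIntegral_mono_on hint.norm.integrableOn hcN.integrableOn_Icc measurableSet_Icc
                    (fun t _ => hnear_bd t)
              _ = Real.log (1 + y ^ 2) := by
                  rw [integral_Icc_eq_integral_Ioc, ← intervalIntegral.integral_of_le (by linarith)]
                  have hsub' : ∫ t in (x - y)..(x + y), |x - t| / ((x - t) ^ 2 + 1) =
                      ∫ u in (x - (x + y))..(x - (x - y)), |u| / (u ^ 2 + 1) :=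
                    intervalIntegral.integral_comp_sub_left (fun u => |u| / (u ^ 2 + 1)) x
                  rw [hsub', show x - (x + y) = -y by ring, show x - (x - y) = y by ring]
                  have := integral_abs_div_one_add_sq hy0
                  rw [← this]
                  refine intervalIntegral.integral_congr fun u _ => ?_
                  rw [add_comm (u ^ 2) 1]
          · calc ∫ t in {t : ℝ | y ≤ |t - x|}, |K₁ t| ≤ ∫ t in {t : ℝ | y ≤ |t - x|}, (y / 2) / (x - t) ^ 2 := by
                  refine setIntegral_mono_on hint.norm.integrableOn htailI
                    (measurableSet_le measurable_const (by fun_prop)) (fun t ht => ?_)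
                  exact hfar_bd t (by rw [abs_sub_comm]; exact ht)
              _ = 2 * (y / 2) / y := htail
              _ = 1 := by field_simp
      _ ≤ 2 * π + Real.log (1 + y ^ 2) + 1 := by linarith [Real.pi_pos]

/-- **The far part of the modified conjugate Poisson kernel has logarithmic `L¹` norm**: for
`y > 0`, `∫_{|x-t| ≥ 1/2} |(x-t)/((x-t)²+y²) + t/(1+t²)| dt ≤ 15 + log(1+y²) + 4 log(3|x|+3)`.
(Jin–Zhang, (e:j3), uniformly in the height.) [folklore] -/
theorem setIntegral_far_abs_conjPoissonKernel_le (x : ℝ) {y : ℝ} (hy : 0 < y) :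
    IntegrableOn (fun t : ℝ => (x - t) / ((x - t) ^ 2 + y ^ 2) + t / (1 + t ^ 2)) {t : ℝ | 1 / 2 ≤ |x - t|} ∧
      ∫ t in {t : ℝ | 1 / 2 ≤ |x - t|}, |(x - t) / ((x - t) ^ 2 + y ^ 2) + t / (1 + t ^ 2)| ≤
        15 + Real.log (1 + y ^ 2) + 4 * Real.log (3 * |x| + 3) := by
  set F : Set ℝ := {t : ℝ | 1 / 2 ≤ |x - t|} with hF
  have hFm : MeasurableSet F := measurableSet_le measurable_const (by fun_prop)
  obtain ⟨hI1, hB1⟩ := setIntegral_abs_kernel_diff_height_le x hy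
  obtain ⟨hI2, hB2⟩ := integral_abs_kernel_diff_center_le x
  have hsum : ∀ t, (x - t) / ((x - t) ^ 2 + y ^ 2) + t / (1 + t ^ 2) =
      ((x - t) / ((x - t) ^ 2 + y ^ 2) - (x - t) / ((x - t) ^ 2 + 1)) +
        ((x - t) / ((x - t) ^ 2 + 1) + t / (1 + t ^ 2)) := fun t => by ring
  have hint : IntegrableOn (fun t : ℝ => (x - t) / ((x - t) ^ 2 + y ^ 2) + t / (1 + t ^ 2)) F := by
    have := hI1.add hI2.integrableOn
    refine this.congr (ae_of_all _ fun t => (hsum t).symm)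
  refine ⟨hint, ?_⟩
  calc ∫ t in F, |(x - t) / ((x - t) ^ 2 + y ^ 2) + t / (1 + t ^ 2)|
      ≤ ∫ t in F, (|(x - t) / ((x - t) ^ 2 + y ^ 2) - (x - t) / ((x - t) ^ 2 + 1)| +
          |(x - t) / ((x - t) ^ 2 + 1) + t / (1 + t ^ 2)|) := by
        refine setIntegral_mono_on hint.norm (hI1.norm.add hI2.norm.integrableOn) hFm (fun t _ => ?_)
        rw [hsum t]
        exact abs_add_le _ _
    _ = (∫ t in F, |(x - t) / ((x - t) ^ 2 + y ^ 2) - (x - t) / ((x - t) ^ 2 + 1)|) +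
          ∫ t in F, |(x - t) / ((x - t) ^ 2 + 1) + t / (1 + t ^ 2)| :=
        integral_add hI1.norm hI2.norm.integrableOn
    _ ≤ (2 * π + Real.log (1 + y ^ 2) + 1) + (7 + 4 * Real.log (3 * |x| + 3)) := by
        gcongr
        exact (setIntegral_le_integral hI2.norm (ae_of_all _ fun t => abs_nonneg _)).trans hB2
    _ ≤ 15 + Real.log (1 + y ^ 2) + 4 * Real.log (3 * |x| + 3) := by
        have : (2 : ℝ) * π ≤ 7 := by linarith [Real.pi_lt_d2]
        linarith

end FarKernelIntegral

/-! ### The corrected sawtooth phase -/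

section Sawtooth

variable {s₀ s : ℝ → ℝ} {L : ℝ}

/-- The corrected phase takes values in `[-π/2, π/2)`. [folklore] -/
theorem shiftedSawtooth_mem (hs : ∀ x, s x = s₀ x - π * (⌊s₀ x / π⌋ : ℝ) - π / 2) (x : ℝ) :
    -(π / 2) ≤ s x ∧ s x < π / 2 := by
  have hπ := Real.pi_pos
  have h1 : (⌊s₀ x / π⌋ : ℝ) ≤ s₀ x / π := Int.floor_le _
  have h2 : s₀ x / π < ⌊s₀ x / π⌋ + 1 := Int.lt_floor_add_one _
  rw [le_div_iff₀ hπ] at h1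
  rw [div_lt_iff₀ hπ] at h2
  rw [hs x]
  constructor <;> nlinarith

/-- `|s| ≤ π/2`. [folklore] -/
theorem abs_shiftedSawtooth_le (hs : ∀ x, s x = s₀ x - π * (⌊s₀ x / π⌋ : ℝ) - π / 2) (x : ℝ) :
    |s x| ≤ π / 2 :=
  abs_le.2 ⟨(shiftedSawtooth_mem hs x).1, (shiftedSawtooth_mem hs x).2.le⟩

/-- The corrected phase is measurable when `s₀` is continuous. [folklore] -/
theorem measurable_shiftedSawtooth (hs₀c : Continuous s₀)
    (hs : ∀ x, s x = s₀ x - π * (⌊s₀ x / π⌋ : ℝ) - π / 2) : Measurable s := by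
  have hfun : s = fun x => s₀ x - π * (⌊s₀ x / π⌋ : ℝ) - π / 2 := funext hs
  rw [hfun]
  have hk : Measurable fun x => ((⌊s₀ x / π⌋ : ℤ) : ℝ) := by
    have h1 : Measurable fun x => ⌊s₀ x / π⌋ := Int.measurable_floor.comp (hs₀c.measurable.div_const π)
    exact (measurable_from_top (f := fun z : ℤ => (z : ℝ))).comp h1
  exact (hs₀c.measurable.sub (hk.const_mul π)).sub measurable_const

/-- The integer part `⌊s₀/π⌋` is monotone. [folklore] -/
theorem floor_phase_mono (hmono : Monotone s₀) {a b : ℝ} (hab : a ≤ b) :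
    ⌊s₀ a / π⌋ ≤ ⌊s₀ b / π⌋ :=
  Int.floor_mono (div_le_div_of_nonneg_right (hmono hab) Real.pi_pos.le)

/-- The corrected phase is continuous at almost every point (the jumps of the monotone integer
part form a countable set). [folklore] -/
theorem ae_continuousAt_shiftedSawtooth (hs₀c : Continuous s₀) (hmono : Monotone s₀)
    (hs : ∀ x, s x = s₀ x - π * (⌊s₀ x / π⌋ : ℝ) - π / 2) :
    ∀ᵐ x : ℝ, ContinuousAt s x := by
  set kf : ℝ → ℝ := fun x => ((⌊s₀ x / π⌋ : ℤ) : ℝ) with hkf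
  have hkmono : Monotone kf := fun a b hab => by
    simp only [hkf]; exact_mod_cast floor_phase_mono hmono hab
  have hcount : Set.Countable {x | ¬ContinuousAt kf x} := hkmono.countable_not_continuousAt
  have hnull : volume {x | ¬ContinuousAt kf x} = 0 := hcount.measure_zero volume
  have hae : ∀ᵐ x : ℝ, ContinuousAt kf x := by
    rw [ae_iff]
    simpa using hnull
  filter_upwards [hae] with x hx
  have hfun : s = fun x => s₀ x - π * kf x - π / 2 := funext fun x => by rw [hs x]
  rw [hfun]
  exact ((hs₀c.continuousAt).sub (hx.const_mul π)).sub continuousAt_const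

/-- The odd kernel integrates to zero over the symmetric window:
`∫_{(x-1/2, x+1/2)} (x-t)/((x-t)²+y²) dt = 0`. [folklore] -/
theorem setIntegral_window_odd_kernel (x : ℝ) {y : ℝ} (hy : 0 < y) :
    ∫ t in Ioo (x - 1 / 2) (x + 1 / 2), (x - t) / ((x - t) ^ 2 + y ^ 2) = 0 := by
  rw [← integral_Ioc_eq_integral_Ioo, ← intervalIntegral.integral_of_le (by linarith)]
  have hderiv : ∀ t ∈ uIcc (x - 1 / 2) (x + 1 / 2),
      HasDerivAt (fun t : ℝ => -(Real.log ((x - t) ^ 2 + y ^ 2) / 2)) ((x - t) / ((x - t) ^ 2 + y ^ 2)) t := by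
    intro t _
    have hD : (x - t) ^ 2 + y ^ 2 ≠ 0 := by positivity
    have h1 : HasDerivAt (fun t : ℝ => (x - t) ^ 2 + y ^ 2) (2 * (x - t) * (-1)) t := by
      have := ((hasDerivAt_id t).const_sub x).pow 2
      simpa using this.add_const (y ^ 2)
    refine ((h1.log hD).div_const 2).neg.congr_deriv ?_
    field_simp
  rw [intervalIntegral.integral_eq_sub_of_hasDerivAt hderiv
    ((continuous_poissonKernel'_odd x hy).intervalIntegrable _ _)]
  have : (x - (x + 1 / 2)) ^ 2 = (x - (x - 1 / 2)) ^ 2 := by ring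
  rw [this]
  ring
where
  /-- continuity of the odd kernel (local helper) -/
  continuous_poissonKernel'_odd (x : ℝ) {y : ℝ} (hy : 0 < y) :
      Continuous fun t : ℝ => (x - t) / ((x - t) ^ 2 + y ^ 2) :=
    Continuous.div (by fun_prop) (by fun_prop) fun t => by positivity

/-- The window `(x - 1/2, x + 1/2)` has complement `{1/2 ≤ |x - t|}`. [folklore] -/
theorem compl_window (x : ℝ) : (Ioo (x - 1 / 2) (x + 1 / 2))ᶜ = {t : ℝ | 1 / 2 ≤ |x - t|} := by
  ext t
  simp only [mem_compl_iff, mem_Ioo, not_and_or, not_lt, mem_setOf_eq]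
  constructor
  · rintro (h | h)
    · rw [abs_of_nonneg (by linarith)]; linarith
    · rw [abs_of_nonpos (by linarith)]; linarith
  · intro h
    by_contra hc
    push Not at hc
    have : |x - t| < 1 / 2 := abs_lt.2 ⟨by linarith [hc.2], by linarith [hc.1]⟩
    linarith

/-- **The near window, one-sided**: for `s = s₀ - π⌊s₀/π⌋ - π/2` with `s₀` increasing and
`L`-Lipschitz, `∫_{(x-1/2,x+1/2)} (s(t) - s(x)) (x-t)/((x-t)²+y²) dt ≥ -L`: the Lipschitz part is
`≥ -L` pointwise and the jump part `-π(k(t)-k(x))(x-t)/((x-t)²+y²)` is `≥ 0` pointwise.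
(Jin–Zhang, (e:j1-bd-2).) [folklore] -/
theorem setIntegral_window_shiftedSawtooth_ge (hs₀c : Continuous s₀) (hmono : Monotone s₀)
    (hLip : ∀ a b, |s₀ a - s₀ b| ≤ L * |a - b|) (hL : 0 ≤ L)
    (hs : ∀ x, s x = s₀ x - π * (⌊s₀ x / π⌋ : ℝ) - π / 2) (x : ℝ) {y : ℝ} (hy : 0 < y) :
    IntegrableOn (fun t => (s t - s x) * ((x - t) / ((x - t) ^ 2 + y ^ 2))) (Ioo (x - 1 / 2) (x + 1 / 2)) ∧
      -L ≤ ∫ t in Ioo (x - 1 / 2) (x + 1 / 2), (s t - s x) * ((x - t) / ((x - t) ^ 2 + y ^ 2)) := by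
  have hsm : Measurable s := measurable_shiftedSawtooth hs₀c hs
  have hkc : Continuous fun t : ℝ => (x - t) / ((x - t) ^ 2 + y ^ 2) :=
    Continuous.div (by fun_prop) (by fun_prop) fun t => by positivity
  -- pointwise lower bound `≥ -L`
  have hpt : ∀ t, -L ≤ (s t - s x) * ((x - t) / ((x - t) ^ 2 + y ^ 2)) := by
    intro t
    have hD : 0 < (x - t) ^ 2 + y ^ 2 := by positivity
    rw [hs t, hs x]
    have hsplit : (s₀ t - π * (⌊s₀ t / π⌋ : ℝ) - π / 2 - (s₀ x - π * (⌊s₀ x / π⌋ : ℝ) - π / 2)) *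
        ((x - t) / ((x - t) ^ 2 + y ^ 2)) =
        (s₀ t - s₀ x) * (x - t) / ((x - t) ^ 2 + y ^ 2) +
          π * (-(((⌊s₀ t / π⌋ : ℝ) - ⌊s₀ x / π⌋) * (x - t))) / ((x - t) ^ 2 + y ^ 2) := by
      field_simp; ring
    rw [hsplit]
    -- Lipschitz part
    have h1 : -L ≤ (s₀ t - s₀ x) * (x - t) / ((x - t) ^ 2 + y ^ 2) := by
      rw [le_div_iff₀ hD]
      have h2 : |(s₀ t - s₀ x) * (x - t)| ≤ L * (x - t) ^ 2 := by
        rw [abs_mul]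
        calc |s₀ t - s₀ x| * |x - t| ≤ L * |t - x| * |x - t| :=
              mul_le_mul_of_nonneg_right (hLip t x) (abs_nonneg _)
          _ = L * (x - t) ^ 2 := by rw [abs_sub_comm t x, mul_assoc, ← sq, sq_abs]
      have h3 := neg_abs_le ((s₀ t - s₀ x) * (x - t))
      nlinarith [sq_nonneg y]
    -- jump part: `-(k t - k x)(x - t) ≥ 0` by monotonicity
    have h4 : 0 ≤ -(((⌊s₀ t / π⌋ : ℝ) - ⌊s₀ x / π⌋) * (x - t)) := by
      rcases le_total t x with htx | htx
      · have hk : (⌊s₀ t / π⌋ : ℝ) ≤ ⌊s₀ x / π⌋ := by exact_mod_cast floor_phase_mono hmono htx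
        nlinarith
      · have hk : (⌊s₀ x / π⌋ : ℝ) ≤ ⌊s₀ t / π⌋ := by exact_mod_cast floor_phase_mono hmono htx
        nlinarith
    have h5 : 0 ≤ π * (-(((⌊s₀ t / π⌋ : ℝ) - ⌊s₀ x / π⌋) * (x - t))) / ((x - t) ^ 2 + y ^ 2) := by
      have := Real.pi_pos; positivity
    linarith
  -- integrability: bounded (`|s| ≤ π/2`, `|kernel| ≤ 1/(2y)`) measurable on a finite window
  have hbd : ∀ t, |(s t - s x) * ((x - t) / ((x - t) ^ 2 + y ^ 2))| ≤ π * (1 / (2 * y)) := by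
    intro t
    rw [abs_mul]
    have h1 : |s t - s x| ≤ π := by
      have := abs_shiftedSawtooth_le hs t; have := abs_shiftedSawtooth_le hs x
      calc |s t - s x| ≤ |s t| + |s x| := abs_sub _ _
        _ ≤ π := by linarith
    have h2 : |(x - t) / ((x - t) ^ 2 + y ^ 2)| ≤ 1 / (2 * y) := by
      rw [abs_div, abs_of_pos (by positivity : (0:ℝ) < (x - t) ^ 2 + y ^ 2),
        div_le_div_iff₀ (by positivity) (by positivity)]
      have : (x - t) ^ 2 = |x - t| ^ 2 := (sq_abs _).symm
      nlinarith [sq_nonneg (|x - t| - y), abs_nonneg (x - t)]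
    exact mul_le_mul h1 h2 (abs_nonneg _) Real.pi_pos.le
  have hint : IntegrableOn (fun t => (s t - s x) * ((x - t) / ((x - t) ^ 2 + y ^ 2)))
      (Ioo (x - 1 / 2) (x + 1 / 2)) := by
    refine Measure.integrableOn_of_bounded (M := π * (1 / (2 * y))) measure_Ioo_lt_top.ne
      ((hsm.sub measurable_const).mul hkc.measurable).aestronglyMeasurable ?_
    exact ae_of_all _ fun t => by rw [Real.norm_eq_abs]; exact hbd t
  refine ⟨hint, ?_⟩
  have hconst : ∫ _ in Ioo (x - 1 / 2) (x + 1 / 2), (-L : ℝ) = -L := by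
    rw [setIntegral_const, Real.volume_real_Ioo, max_eq_left (by linarith), smul_eq_mul]
    ring
  rw [← hconst]
  exact setIntegral_mono_on (integrableOn_const measure_Ioo_lt_top.ne) hint measurableSet_Ioo
    (fun t _ => hpt t)

/-- **The near window, two-sided**: if moreover `⌊s₀/π⌋` is constant on `(x-1/2, x+1/2)` then
`|∫_{(x-1/2,x+1/2)} (s(t) - s(x)) (x-t)/((x-t)²+y²) dt| ≤ L`. (Jin–Zhang, (e:j1-bd-1).)
[folklore] -/
theorem abs_setIntegral_window_shiftedSawtooth_le
    (hLip : ∀ a b, |s₀ a - s₀ b| ≤ L * |a - b|) (hL : 0 ≤ L)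
    (hs : ∀ x, s x = s₀ x - π * (⌊s₀ x / π⌋ : ℝ) - π / 2) (x : ℝ) {y : ℝ} (hy : 0 < y)
    (hconst : ∀ t ∈ Ioo (x - 1 / 2) (x + 1 / 2), ⌊s₀ t / π⌋ = ⌊s₀ x / π⌋) :
    |∫ t in Ioo (x - 1 / 2) (x + 1 / 2), (s t - s x) * ((x - t) / ((x - t) ^ 2 + y ^ 2))| ≤ L := by
  have hpt : ∀ t ∈ Ioo (x - 1 / 2) (x + 1 / 2),
      ‖(s t - s x) * ((x - t) / ((x - t) ^ 2 + y ^ 2))‖ ≤ L := by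
    intro t ht
    have hD : 0 < (x - t) ^ 2 + y ^ 2 := by positivity
    rw [Real.norm_eq_abs, hs t, hs x, hconst t ht]
    have : s₀ t - π * (⌊s₀ x / π⌋ : ℝ) - π / 2 - (s₀ x - π * (⌊s₀ x / π⌋ : ℝ) - π / 2) = s₀ t - s₀ x := by ring
    rw [this, abs_mul, abs_div, abs_of_pos hD]
    calc |s₀ t - s₀ x| * (|x - t| / ((x - t) ^ 2 + y ^ 2)) ≤ L * |t - x| * (|x - t| / ((x - t) ^ 2 + y ^ 2)) :=
          mul_le_mul_of_nonneg_right (hLip t x) (by positivity)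
      _ = L * ((x - t) ^ 2 / ((x - t) ^ 2 + y ^ 2)) := by
          rw [abs_sub_comm t x, mul_assoc, mul_div_assoc', ← sq, sq_abs]
      _ ≤ L * 1 := by
          refine mul_le_mul_of_nonneg_left ?_ hL
          rw [div_le_one hD]; nlinarith
      _ = L := mul_one L
  have h := norm_setIntegral_le_of_norm_le_const (measure_Ioo_lt_top (μ := volume) (a := x - 1 / 2) (b := x + 1 / 2)) hpt
  rw [Real.norm_eq_abs, Real.volume_real_Ioo, max_eq_left (by linarith)] at h
  calc _ ≤ L * (x + 1 / 2 - (x - 1 / 2)) := h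
    _ = L := by ring

/-- **Decomposition of the conjugate Poisson integral of the phase**: window part (with `s(x)`
subtracted for free, the odd kernel having integral zero), the modification term on the window,
and the far part. [folklore] -/
theorem conjPoissonIntegral_shiftedSawtooth_decomp (hs₀c : Continuous s₀)
    (hs : ∀ x, s x = s₀ x - π * (⌊s₀ x / π⌋ : ℝ) - π / 2) (x : ℝ) {y : ℝ} (hy : 0 < y) :
    ∫ t, s t * ((x - t) / ((x - t) ^ 2 + y ^ 2) + t / (1 + t ^ 2)) =
      (∫ t in Ioo (x - 1 / 2) (x + 1 / 2), (s t - s x) * ((x - t) / ((x - t) ^ 2 + y ^ 2))) +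
        (∫ t in Ioo (x - 1 / 2) (x + 1 / 2), s t * (t / (1 + t ^ 2))) +
        ∫ t in {t : ℝ | 1 / 2 ≤ |x - t|}, s t * ((x - t) / ((x - t) ^ 2 + y ^ 2) + t / (1 + t ^ 2)) := by
  have hsm : Measurable s := measurable_shiftedSawtooth hs₀c hs
  have hsb : ∀ t, |s t| ≤ π / 2 := abs_shiftedSawtooth_le hs
  have hK : Integrable fun t => s t * ((x - t) / ((x - t) ^ 2 + y ^ 2) + t / (1 + t ^ 2)) :=
    integrable_mul_conjPoissonKernel hsm.aestronglyMeasurable hsb x hy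
  set N : Set ℝ := Ioo (x - 1 / 2) (x + 1 / 2) with hN
  rw [← integral_add_compl measurableSet_Ioo hK, compl_window x]
  congr 1
  -- on the window split the kernel
  have hk1 : Continuous fun t : ℝ => (x - t) / ((x - t) ^ 2 + y ^ 2) :=
    Continuous.div (by fun_prop) (by fun_prop) fun t => by positivity
  have hk2 : Continuous fun t : ℝ => t / (1 + t ^ 2) :=
    Continuous.div (by fun_prop) (by fun_prop) fun t => by positivity
  have hbdd : ∀ (g : ℝ → ℝ), Continuous g → (∃ B, ∀ t, |g t| ≤ B) →
      IntegrableOn (fun t => s t * g t) N := by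
    intro g hg ⟨B, hB⟩
    have hB0 : 0 ≤ B := (abs_nonneg _).trans (hB 0)
    refine Measure.integrableOn_of_bounded (M := π / 2 * B) measure_Ioo_lt_top.ne
      (hsm.mul hg.measurable).aestronglyMeasurable (ae_of_all _ fun t => ?_)
    rw [Real.norm_eq_abs, abs_mul]
    exact mul_le_mul (hsb t) (hB t) (abs_nonneg _) (by positivity)
  have hB1 : ∃ B, ∀ t, |(x - t) / ((x - t) ^ 2 + y ^ 2)| ≤ B := by
    refine ⟨1 / (2 * y), fun t => ?_⟩
    rw [abs_div, abs_of_pos (by positivity : (0:ℝ) < (x - t) ^ 2 + y ^ 2),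
      div_le_div_iff₀ (by positivity) (by positivity)]
    have : (x - t) ^ 2 = |x - t| ^ 2 := (sq_abs _).symm
    nlinarith [sq_nonneg (|x - t| - y), abs_nonneg (x - t)]
  have hB2 : ∃ B, ∀ t : ℝ, |t / (1 + t ^ 2)| ≤ B := by
    refine ⟨1 / 2, fun t => ?_⟩
    rw [abs_div, abs_of_pos (by positivity : (0:ℝ) < 1 + t ^ 2), div_le_div_iff₀ (by positivity) (by positivity)]
    have : t ^ 2 = |t| ^ 2 := (sq_abs _).symm
    nlinarith [sq_nonneg (|t| - 1), abs_nonneg t]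
  have hI1 := hbdd _ hk1 hB1
  have hI2 := hbdd _ hk2 hB2
  have hsplit : ∫ t in N, s t * ((x - t) / ((x - t) ^ 2 + y ^ 2) + t / (1 + t ^ 2)) =
      (∫ t in N, s t * ((x - t) / ((x - t) ^ 2 + y ^ 2))) + ∫ t in N, s t * (t / (1 + t ^ 2)) := by
    rw [← integral_add hI1 hI2]
    exact integral_congr_ae (ae_of_all _ fun t => by ring)
  rw [hsplit]
  congr 1
  -- subtract `s x ∫_N (odd kernel) = 0`
  have hI3 : IntegrableOn (fun t => s x * ((x - t) / ((x - t) ^ 2 + y ^ 2))) N := hk1.integrableOn_Icc.mono_set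
    Ioo_subset_Icc_self |>.const_mul (s x)
  have h1 : ∫ t in N, (s t - s x) * ((x - t) / ((x - t) ^ 2 + y ^ 2)) =
      (∫ t in N, s t * ((x - t) / ((x - t) ^ 2 + y ^ 2))) - ∫ t in N, s x * ((x - t) / ((x - t) ^ 2 + y ^ 2)) := by
    rw [← integral_sub hI1 hI3]
    exact integral_congr_ae (ae_of_all _ fun t => by ring)
  rw [h1, integral_const_mul, hN, setIntegral_window_odd_kernel x hy, mul_zero, sub_zero]

/-- **One-sided bound for the conjugate Poisson integral of the corrected phase** (Jin–Zhang,
(e:mbd-2), at height `y > 0`): for `s = s₀ - π⌊s₀/π⌋ - π/2`, `s₀` continuous increasing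
`L`-Lipschitz, and all `x`, `y > 0`,
`π⁻¹ ∫ s(t) ((x-t)/((x-t)²+y²) + t/(1+t²)) dt ≥ -(L/π + 1/4 + (15 + log(1+y²) + 4 log(3|x|+3))/2)`.
[folklore] -/
theorem conjPoissonIntegral_shiftedSawtooth_ge (hs₀c : Continuous s₀) (hmono : Monotone s₀)
    (hLip : ∀ a b, |s₀ a - s₀ b| ≤ L * |a - b|) (hL : 0 ≤ L)
    (hs : ∀ x, s x = s₀ x - π * (⌊s₀ x / π⌋ : ℝ) - π / 2) (x : ℝ) {y : ℝ} (hy : 0 < y) :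
    -(L / π + 1 / 4 + (15 + Real.log (1 + y ^ 2) + 4 * Real.log (3 * |x| + 3)) / 2) ≤
      π⁻¹ * ∫ t, s t * ((x - t) / ((x - t) ^ 2 + y ^ 2) + t / (1 + t ^ 2)) := by
  have hπ := Real.pi_pos
  have hsm : Measurable s := measurable_shiftedSawtooth hs₀c hs
  have hsb : ∀ t, |s t| ≤ π / 2 := abs_shiftedSawtooth_le hs
  rw [conjPoissonIntegral_shiftedSawtooth_decomp hs₀c hs x hy]
  obtain ⟨-, hW⟩ := setIntegral_window_shiftedSawtooth_ge hs₀c hmono hLip hL hs x hy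
  -- the modification term on the window
  have hM : |∫ t in Ioo (x - 1 / 2) (x + 1 / 2), s t * (t / (1 + t ^ 2))| ≤ π / 4 := by
    have hpt : ∀ t ∈ Ioo (x - 1 / 2) (x + 1 / 2), ‖s t * (t / (1 + t ^ 2))‖ ≤ π / 2 * (1 / 2) := by
      intro t _
      rw [Real.norm_eq_abs, abs_mul]
      refine mul_le_mul (hsb t) ?_ (abs_nonneg _) (by positivity)
      rw [abs_div, abs_of_pos (by positivity : (0:ℝ) < 1 + t ^ 2), div_le_div_iff₀ (by positivity) (by positivity)]
      have : t ^ 2 = |t| ^ 2 := (sq_abs _).symm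
      nlinarith [sq_nonneg (|t| - 1), abs_nonneg t]
    have h := norm_setIntegral_le_of_norm_le_const (measure_Ioo_lt_top (μ := volume) (a := x - 1 / 2) (b := x + 1 / 2)) hpt
    rw [Real.norm_eq_abs, Real.volume_real_Ioo, max_eq_left (by linarith)] at h
    calc _ ≤ π / 2 * (1 / 2) * (x + 1 / 2 - (x - 1 / 2)) := h
      _ = π / 4 := by ring
  -- the far part
  obtain ⟨hFI, hFB⟩ := setIntegral_far_abs_conjPoissonKernel_le x hy
  have hF : |∫ t in {t : ℝ | 1 / 2 ≤ |x - t|}, s t * ((x - t) / ((x - t) ^ 2 + y ^ 2) + t / (1 + t ^ 2))| ≤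
      π / 2 * (15 + Real.log (1 + y ^ 2) + 4 * Real.log (3 * |x| + 3)) := by
    have hK : Integrable fun t => s t * ((x - t) / ((x - t) ^ 2 + y ^ 2) + t / (1 + t ^ 2)) :=
      integrable_mul_conjPoissonKernel hsm.aestronglyMeasurable hsb x hy
    calc |∫ t in {t : ℝ | 1 / 2 ≤ |x - t|}, s t * ((x - t) / ((x - t) ^ 2 + y ^ 2) + t / (1 + t ^ 2))|
        ≤ ∫ t in {t : ℝ | 1 / 2 ≤ |x - t|}, |s t * ((x - t) / ((x - t) ^ 2 + y ^ 2) + t / (1 + t ^ 2))| :=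
          abs_integral_le_integral_abs
      _ ≤ ∫ t in {t : ℝ | 1 / 2 ≤ |x - t|}, π / 2 * |(x - t) / ((x - t) ^ 2 + y ^ 2) + t / (1 + t ^ 2)| := by
          refine setIntegral_mono_on hK.abs.integrableOn (hFI.abs.const_mul _)
            (measurableSet_le measurable_const (by fun_prop)) (fun t _ => ?_)
          rw [abs_mul]
          exact mul_le_mul_of_nonneg_right (hsb t) (abs_nonneg _)
      _ = π / 2 * ∫ t in {t : ℝ | 1 / 2 ≤ |x - t|}, |(x - t) / ((x - t) ^ 2 + y ^ 2) + t / (1 + t ^ 2)| :=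
          integral_const_mul _ _
      _ ≤ π / 2 * (15 + Real.log (1 + y ^ 2) + 4 * Real.log (3 * |x| + 3)) :=
          mul_le_mul_of_nonneg_left hFB (by positivity)
  have hM' := neg_abs_le (∫ t in Ioo (x - 1 / 2) (x + 1 / 2), s t * (t / (1 + t ^ 2)))
  have hF' := neg_abs_le (∫ t in {t : ℝ | 1 / 2 ≤ |x - t|}, s t * ((x - t) / ((x - t) ^ 2 + y ^ 2) + t / (1 + t ^ 2)))
  rw [show -(L / π + 1 / 4 + (15 + Real.log (1 + y ^ 2) + 4 * Real.log (3 * |x| + 3)) / 2) =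
    π⁻¹ * (-L - π / 4 - π / 2 * (15 + Real.log (1 + y ^ 2) + 4 * Real.log (3 * |x| + 3))) by
    field_simp; ring]
  exact mul_le_mul_of_nonneg_left (by linarith) (by positivity)

/-- **Two-sided bound where the integer part is locally constant** (Jin–Zhang, (e:mbd-1), at
height `y > 0`): if `⌊s₀/π⌋` is constant on `(x-1/2, x+1/2)` then
`|π⁻¹ ∫ s(t) ((x-t)/((x-t)²+y²) + t/(1+t²)) dt| ≤ L/π + 1/4 + (15 + log(1+y²) + 4 log(3|x|+3))/2`.
[folklore] -/
theorem abs_conjPoissonIntegral_shiftedSawtooth_le (hs₀c : Continuous s₀)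
    (hLip : ∀ a b, |s₀ a - s₀ b| ≤ L * |a - b|) (hL : 0 ≤ L)
    (hs : ∀ x, s x = s₀ x - π * (⌊s₀ x / π⌋ : ℝ) - π / 2) (x : ℝ) {y : ℝ} (hy : 0 < y)
    (hconst : ∀ t ∈ Ioo (x - 1 / 2) (x + 1 / 2), ⌊s₀ t / π⌋ = ⌊s₀ x / π⌋) :
    |π⁻¹ * ∫ t, s t * ((x - t) / ((x - t) ^ 2 + y ^ 2) + t / (1 + t ^ 2))| ≤
      L / π + 1 / 4 + (15 + Real.log (1 + y ^ 2) + 4 * Real.log (3 * |x| + 3)) / 2 := by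
  have hπ := Real.pi_pos
  have hsm : Measurable s := measurable_shiftedSawtooth hs₀c hs
  have hsb : ∀ t, |s t| ≤ π / 2 := abs_shiftedSawtooth_le hs
  rw [conjPoissonIntegral_shiftedSawtooth_decomp hs₀c hs x hy, abs_mul, abs_of_pos (inv_pos.2 hπ)]
  have hW := abs_setIntegral_window_shiftedSawtooth_le hLip hL hs x hy hconst
  have hM : |∫ t in Ioo (x - 1 / 2) (x + 1 / 2), s t * (t / (1 + t ^ 2))| ≤ π / 4 := by
    have hpt : ∀ t ∈ Ioo (x - 1 / 2) (x + 1 / 2), ‖s t * (t / (1 + t ^ 2))‖ ≤ π / 2 * (1 / 2) := by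
      intro t _
      rw [Real.norm_eq_abs, abs_mul]
      refine mul_le_mul (hsb t) ?_ (abs_nonneg _) (by positivity)
      rw [abs_div, abs_of_pos (by positivity : (0:ℝ) < 1 + t ^ 2), div_le_div_iff₀ (by positivity) (by positivity)]
      have : t ^ 2 = |t| ^ 2 := (sq_abs _).symm
      nlinarith [sq_nonneg (|t| - 1), abs_nonneg t]
    have h := norm_setIntegral_le_of_norm_le_const (measure_Ioo_lt_top (μ := volume) (a := x - 1 / 2) (b := x + 1 / 2)) hpt
    rw [Real.norm_eq_abs, Real.volume_real_Ioo, max_eq_left (by linarith)] at h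
    calc _ ≤ π / 2 * (1 / 2) * (x + 1 / 2 - (x - 1 / 2)) := h
      _ = π / 4 := by ring
  obtain ⟨hFI, hFB⟩ := setIntegral_far_abs_conjPoissonKernel_le x hy
  have hF : |∫ t in {t : ℝ | 1 / 2 ≤ |x - t|}, s t * ((x - t) / ((x - t) ^ 2 + y ^ 2) + t / (1 + t ^ 2))| ≤
      π / 2 * (15 + Real.log (1 + y ^ 2) + 4 * Real.log (3 * |x| + 3)) := by
    have hK : Integrable fun t => s t * ((x - t) / ((x - t) ^ 2 + y ^ 2) + t / (1 + t ^ 2)) :=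
      integrable_mul_conjPoissonKernel hsm.aestronglyMeasurable hsb x hy
    calc |∫ t in {t : ℝ | 1 / 2 ≤ |x - t|}, s t * ((x - t) / ((x - t) ^ 2 + y ^ 2) + t / (1 + t ^ 2))|
        ≤ ∫ t in {t : ℝ | 1 / 2 ≤ |x - t|}, |s t * ((x - t) / ((x - t) ^ 2 + y ^ 2) + t / (1 + t ^ 2))| :=
          abs_integral_le_integral_abs
      _ ≤ ∫ t in {t : ℝ | 1 / 2 ≤ |x - t|}, π / 2 * |(x - t) / ((x - t) ^ 2 + y ^ 2) + t / (1 + t ^ 2)| := by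
          refine setIntegral_mono_on hK.abs.integrableOn (hFI.abs.const_mul _)
            (measurableSet_le measurable_const (by fun_prop)) (fun t _ => ?_)
          rw [abs_mul]
          exact mul_le_mul_of_nonneg_right (hsb t) (abs_nonneg _)
      _ = π / 2 * ∫ t in {t : ℝ | 1 / 2 ≤ |x - t|}, |(x - t) / ((x - t) ^ 2 + y ^ 2) + t / (1 + t ^ 2)| :=
          integral_const_mul _ _
      _ ≤ π / 2 * (15 + Real.log (1 + y ^ 2) + 4 * Real.log (3 * |x| + 3)) :=
          mul_le_mul_of_nonneg_left hFB (by positivity)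
  rw [show L / π + 1 / 4 + (15 + Real.log (1 + y ^ 2) + 4 * Real.log (3 * |x| + 3)) / 2 =
    π⁻¹ * (L + π / 4 + π / 2 * (15 + Real.log (1 + y ^ 2) + 4 * Real.log (3 * |x| + 3))) by
    field_simp]
  refine mul_le_mul_of_nonneg_left ?_ (by positivity)
  exact (abs_add_three _ _ _).trans (by linarith)

end Sawtooth

end Literature.Analysis.Fourier

/-!
## Part 2. An effective multiplier theorem without Beurling–Malliavin (after Jin–Zhang, Theorem 12)

Topic `Literature/Analysis/Fourier`. L. Jin, R. Zhang, *Fractal uncertainty principle with explicit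
exponent*, Math. Ann. 376 (2020) = arXiv:1710.00250, §3, Theorem 12: a weight `ω = e^{-Ω}` whose
logarithm has a LIPSCHITZ (modified) HILBERT TRANSFORM, `‖(ℋΩ)'‖_∞ ≲ σ`, is majorised by the
modulus of the Fourier transform of an `L²` function supported in an interval of length `O(σ)`,
with an explicit lower bound near the origin. This is "the first step of the seventh proof of the
Beurling–Malliavin theorem" (Mashreghi–Nazarov–Havin 2006) and suffices for the Bourgain–Dyatlov
fractal uncertainty principle, where the adapted weight has this property uniformly in the upper
scale (`AdaptedWeightHilbert.lean`).

We give a self-contained EXPLICIT version avoiding Hardy spaces, outer functions and the inversion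
of the Hilbert transform: for `Ω ∈ C²_c(ℝ)`, `Ω ≥ 0`, with `sup |(ℋΩ)'| ≤ K₀`, put `a = πσ`,
`c = πσ/(2(K₀+1))`, let `β = b_E - c ℋΩ` (`b_E` the boundary phase of the damping factor
`E(z) = exp(-a(1-iz)^{1/2})`, `SqrtDampingFactor.lean`), `s₀(x) = 2πσx - β(x)` (increasing,
`3πσ`-Lipschitz), `s = s₀ - π⌊s₀/π⌋ - π/2`, and

  `G(z) = E(z) · exp(-c 𝒮Ω(z)) · exp(i 𝒮s(z))`,  `Im z > 0`,

with `𝒮` the Schwarz integral (`SchwarzIntegral.lean`). Then `|G| = |E| e^{-cP[Ω]} e^{-Q[s]}`, the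
conjugate Poisson integral of the corrected sawtooth `s` is bounded below logarithmically
(`ConjugatePoissonBounds.lean`), so `G` has a polynomial majorant and the half-plane Paley–Wiener
theorem (`PaleyWienerHalfPlane.lean`) produces a spectral function `φ ⊂ [0, ∞)` and a boundary
function `g`; along the boundary the phases converge and `g = -e^{4πiσx} ḡ` a.e., which halves
the spectrum to `[0, 2σ]` (`BoundarySpectrumSymmetry.lean`), and `ψ(x) = φ(σ - x)` is the multiplier:

* `effective_multiplier` — for `0 < σ ≤ 1/40`, `K₀ ≥ 0` and `K₁` there are `c, C, c' > 0` such
  that every such `Ω` with `Ω ≤ K₁` on `[-2, 2]` admits `ψ ∈ L¹ ∩ L²`, `ψ = 0` off `[-σ, σ]`,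
  `|ψ̂(ξ)| ≤ C (3|ξ|+3)² e^{-(πσ/2)⟨ξ⟩^{1/2}} e^{-cΩ(ξ)}` for all `ξ`, and `∫_{[-1,1]} |ψ̂|² ≥ c'`.

[cite: JinZhang2017, Theorem 12] (statement adapted: Lipschitz Hilbert transform of `Ω` instead of
the weight `ω^{c}`; polynomial prefactor instead of `1`; the constants are not the printed ones).
No definitions are introduced.
-/

namespace Literature.Analysis.Fourier

open _root_.MeasureTheory Set Filter Metric _root_.Complex
open scoped FourierTransform Real Topology ComplexConjugate

/-! ### Small lemmas -/

section Lemmas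

/-- A limit of nonnegative reals (inside `ℂ`) is a nonnegative real. [folklore] -/
theorem eq_ofReal_of_tendsto_ofReal {r : ℕ → ℝ} (hr : ∀ k, 0 ≤ r k) {w : ℂ}
    (h : Tendsto (fun k => ((r k : ℝ) : ℂ)) atTop (𝓝 w)) : w = ((w.re : ℝ) : ℂ) ∧ 0 ≤ w.re := by
  have him : Tendsto (fun k => (((r k : ℝ) : ℂ)).im) atTop (𝓝 w.im) := (Complex.continuous_im.tendsto w).comp h
  have hre : Tendsto (fun k => (((r k : ℝ) : ℂ)).re) atTop (𝓝 w.re) := (Complex.continuous_re.tendsto w).comp h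
  simp only [ofReal_im] at him
  simp only [ofReal_re] at hre
  have h0 : w.im = 0 := (tendsto_nhds_unique him tendsto_const_nhds)
  refine ⟨?_, ge_of_tendsto' hre fun k => hr k⟩
  apply Complex.ext <;> simp [h0]

/-- The phase algebra: if `θ = 2πσx - πk - π/2` with `k ∈ ℤ` then
`M e^{iθ} = -e^{2πi(2σ)x} · conj (M e^{iθ})` for real `M`. [folklore] -/
theorem phase_symmetry_identity (M σ x : ℝ) (k : ℤ) :
    ((M : ℂ) * cexp (((2 * π * σ * x - π * k - π / 2 : ℝ) : ℂ) * I)) =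
      -(cexp (((2 * π * (2 * σ) * x : ℝ) : ℂ) * I) *
        conj ((M : ℂ) * cexp (((2 * π * σ * x - π * k - π / 2 : ℝ) : ℂ) * I))) := by
  set θ : ℝ := 2 * π * σ * x - π * k - π / 2 with hθ
  rw [map_mul, Complex.conj_ofReal, ← Complex.exp_conj, map_mul, Complex.conj_ofReal, Complex.conj_I,
    mul_neg, Complex.exp_neg]
  have hne : cexp ((θ : ℂ) * I) ≠ 0 := Complex.exp_ne_zero _
  -- `e^{2πi(2σ)x} = e^{iθ} · e^{iθ} · e^{2πik} · e^{iπ}` and `e^{2πik} = 1`, `e^{iπ} = -1`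
  have hkey : cexp (((2 * π * (2 * σ) * x : ℝ) : ℂ) * I) =
      cexp ((θ : ℂ) * I) * cexp ((θ : ℂ) * I) * (cexp (k * (2 * π * I)) * cexp (π * I)) := by
    rw [← Complex.exp_add, ← Complex.exp_add, ← Complex.exp_add]
    congr 1
    rw [hθ]; push_cast; ring
  rw [hkey, Complex.exp_int_mul_two_pi_mul_I, Complex.exp_pi_mul_I]
  field_simp

/-- `log 2 ≤ 1` and `log 6 ≤ 2`. [folklore] -/
theorem log_two_le_one_and_log_six_le_two : Real.log 2 ≤ 1 ∧ Real.log 6 ≤ 2 := by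
  constructor
  · have := Real.log_two_lt_d9; linarith
  · rw [Real.log_le_iff_le_exp (by norm_num)]
    have h1 : (2.7 : ℝ) < Real.exp 1 := by have := Real.exp_one_gt_d9; linarith
    have h2 : Real.exp 2 = Real.exp 1 * Real.exp 1 := by rw [← Real.exp_add]; norm_num
    rw [h2]; nlinarith [Real.exp_pos 1]

/-- **Local constancy of the integer part.** If `s₀` is monotone and `s₀(2) - s₀(-2) < π` then
`⌊s₀/π⌋` is constant either on `[0, 2]` or on `[-2, 0]`. [folklore] -/
theorem floor_const_on_one_side {s₀ : ℝ → ℝ} (hmono : Monotone s₀) (hvar : s₀ 2 - s₀ (-2) < π) :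
    (∀ t ∈ Icc (0 : ℝ) 2, ⌊s₀ t / π⌋ = ⌊s₀ 0 / π⌋) ∨ (∀ t ∈ Icc (-2 : ℝ) 0, ⌊s₀ t / π⌋ = ⌊s₀ 0 / π⌋) := by
  have hπ := Real.pi_pos
  have hk : ∀ {a b : ℝ}, a ≤ b → ⌊s₀ a / π⌋ ≤ ⌊s₀ b / π⌋ := fun hab =>
    Int.floor_mono (div_le_div_of_nonneg_right (hmono hab) hπ.le)
  -- total variation of the floor is at most one
  have htot : ⌊s₀ 2 / π⌋ ≤ ⌊s₀ (-2) / π⌋ + 1 := by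
    have h1 : s₀ 2 / π < s₀ (-2) / π + 1 := by
      rw [div_add_one hπ.ne', div_lt_div_iff_of_pos_right hπ]; linarith
    have h2 : (⌊s₀ 2 / π⌋ : ℝ) ≤ s₀ 2 / π := Int.floor_le _
    have h3 : s₀ (-2) / π < ⌊s₀ (-2) / π⌋ + 1 := Int.lt_floor_add_one _
    have : (⌊s₀ 2 / π⌋ : ℝ) < ⌊s₀ (-2) / π⌋ + 1 + 1 := by linarith
    exact_mod_cast Int.le_of_lt_add_one (by exact_mod_cast this : ⌊s₀ 2 / π⌋ < ⌊s₀ (-2) / π⌋ + 1 + 1)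
  by_cases hA : ⌊s₀ 2 / π⌋ = ⌊s₀ 0 / π⌋
  · left
    intro t ht
    exact le_antisymm (hA ▸ hk ht.2) (hk ht.1)
  · right
    have hlt : ⌊s₀ 0 / π⌋ < ⌊s₀ 2 / π⌋ := lt_of_le_of_ne (hk (by norm_num)) (Ne.symm hA)
    have heq : ⌊s₀ (-2) / π⌋ = ⌊s₀ 0 / π⌋ := by
      have := hk (show (-2 : ℝ) ≤ 0 by norm_num)
      omega
    intro t ht
    exact le_antisymm (hk ht.2) (heq ▸ hk ht.1)

end Lemmas

/-! ### The theorem -/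

section Main

set_option maxHeartbeats 1600000 in
/-- **Effective multiplier theorem** (after Jin–Zhang, arXiv:1710.00250, Theorem 12, explicit
holomorphic version). Let `0 < σ ≤ 1/40`, `K₀ ≥ 0`, `K₁ ∈ ℝ`. There are `c, C, c' > 0` (depending only on
`σ, K₀, K₁`) such that for every `Ω ∈ C²(ℝ)` with compact support, `Ω ≥ 0`, `Ω ≤ K₁` on `[-2,2]`,
whose modified Hilbert transform satisfies `sup |(ℋΩ)'| ≤ K₀` (in the form delivered by
`hasDerivAt_hilbert`), there is `ψ ∈ L¹ ∩ L²(ℝ)` with `ψ(x) = 0` for `|x| > σ`,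
`|ψ̂(ξ)| ≤ C (3|ξ|+3)² exp(-(πσ/2)(1+ξ²)^{1/4}) exp(-c Ω(ξ))` for every `ξ`, and
`∫_{[-1,1]} |ψ̂|² ≥ c'`. [cite: JinZhang2017, Theorem 12] -/
theorem effective_multiplier (σ K₀ K₁ : ℝ) (hσ0 : 0 < σ) (hσ1 : σ ≤ 1 / 40) (hK₀ : 0 ≤ K₀) :
    ∃ c Cup clow : ℝ, 0 < c ∧ 0 < Cup ∧ 0 < clow ∧ ∀ Ω : ℝ → ℝ, ContDiff ℝ 2 Ω → HasCompactSupport Ω →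
      (∀ ξ, 0 ≤ Ω ξ) → (∀ ξ, |ξ| ≤ 2 → Ω ξ ≤ K₁) →
      (∀ x, |π⁻¹ * ((∫ u in Ioo (-1 : ℝ) 1, (deriv Ω (x - u) - deriv Ω x) / u) +
          ∫ u in {u : ℝ | 1 ≤ |u|}, deriv Ω (x - u) / u)| ≤ K₀) →
      ∃ ψ : ℝ → ℂ, Integrable ψ ∧ MemLp ψ 2 volume ∧ (∀ x, σ < |x| → ψ x = 0) ∧
        (∀ ξ, ‖𝓕 ψ ξ‖ ≤ Cup * (3 * |ξ| + 3) ^ 2 * Real.exp (-(π * σ / 2) * (1 + ξ ^ 2) ^ (1 / 4 : ℝ)) *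
          Real.exp (-(c * Ω ξ))) ∧
        clow ≤ ∫ ξ in Icc (-1 : ℝ) 1, ‖𝓕 ψ ξ‖ ^ 2 := by
  have hπ := Real.pi_pos
  have hπ3 := Real.pi_gt_three
  obtain ⟨hlog2, hlog6⟩ := log_two_le_one_and_log_six_le_two
  -- constants
  set a : ℝ := π * σ with ha
  have ha0 : 0 < a := by positivity
  set c : ℝ := π * σ / (2 * (K₀ + 1)) with hc
  have hc0 : 0 < c := by positivity
  have hcK : c * K₀ ≤ π * σ / 2 := by
    rw [hc, div_mul_eq_mul_div, div_le_div_iff₀ (by positivity) (by positivity)]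
    nlinarith [mul_pos hπ hσ0]
  set L : ℝ := 3 * π * σ with hL
  have hL0 : 0 ≤ L := by positivity
  have hLπ : L / π = 3 * σ := by rw [hL]; field_simp
  set m : ℝ := Real.exp (-(2 * a + c * K₁ + 13)) with hm
  have hm0 : 0 < m := Real.exp_pos _
  refine ⟨c, Real.exp 9, 1 / 2 * m ^ 2, hc0, Real.exp_pos 9, by positivity, ?_⟩
  intro Ω hΩC hΩs hΩ0 hΩK₁ hHK
  -- (Ω1) basic facts about `Ω`
  have hΩc : Continuous Ω := hΩC.continuous
  obtain ⟨BΩ, hBΩ'⟩ := hΩs.exists_bound_of_continuous hΩc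
  have hBΩ : ∀ t, |Ω t| ≤ BΩ := fun t => by simpa [Real.norm_eq_abs] using hBΩ' t
  have hΩm : AEStronglyMeasurable Ω volume := hΩc.aestronglyMeasurable
  -- (Ω2) the modified Hilbert transform `HΩ` and its Lipschitz bound
  set HΩ : ℝ → ℝ := fun x => π⁻¹ * ((∫ u in Ioo (-1 : ℝ) 1, (Ω (x - u) - Ω x) / u) +
    (∫ u in {u : ℝ | 1 ≤ |u|}, Ω (x - u) / u) + ∫ t : ℝ, Ω t * (t / (1 + t ^ 2))) with hHΩ
  have hHderiv : ∀ x, HasDerivAt HΩ (π⁻¹ * ((∫ u in Ioo (-1 : ℝ) 1, (deriv Ω (x - u) - deriv Ω x) / u) +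
      ∫ u in {u : ℝ | 1 ≤ |u|}, deriv Ω (x - u) / u)) x := fun x => hasDerivAt_hilbert hΩC hΩs x
  have hHcont : Continuous HΩ := continuous_iff_continuousAt.2 fun x => (hHderiv x).continuousAt
  have hHLip : ∀ x₁ x₂, |HΩ x₁ - HΩ x₂| ≤ K₀ * |x₁ - x₂| := by
    intro x₁ x₂
    have := Convex.norm_image_sub_le_of_norm_deriv_le (f := HΩ) (s := univ)
      (fun x _ => (hHderiv x).differentiableAt) (fun x _ => by
        rw [(hHderiv x).deriv, Real.norm_eq_abs]; exact hHK x) convex_univ (mem_univ x₂) (mem_univ x₁)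
    simpa [Real.norm_eq_abs] using this
  -- (Ω3) the phase of the damping factor
  set bE : ℝ → ℝ := fun x => -a * ((1 - I * (x : ℂ)) ^ (2⁻¹ : ℂ)).im with hbE
  have hbELip : ∀ x₁ x₂, |bE x₁ - bE x₂| ≤ a / 2 * |x₁ - x₂| := fun x₁ x₂ =>
    abs_sqrtDamping_phase_sub_le ha0.le x₁ x₂
  have hbEc : Continuous bE := continuous_sqrtDamping_phase a
  -- (Ω4) the corrected sawtooth phase
  set β : ℝ → ℝ := fun x => bE x - c * HΩ x with hβ
  have hβLip : ∀ x₁ x₂, |β x₁ - β x₂| ≤ π * σ * |x₁ - x₂| := by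
    intro x₁ x₂
    have h1 := hbELip x₁ x₂
    have h2 := hHLip x₁ x₂
    have h3 : |c * HΩ x₁ - c * HΩ x₂| ≤ π * σ / 2 * |x₁ - x₂| := by
      rw [← mul_sub, abs_mul, abs_of_pos hc0]
      calc c * |HΩ x₁ - HΩ x₂| ≤ c * (K₀ * |x₁ - x₂|) := mul_le_mul_of_nonneg_left h2 hc0.le
        _ = (c * K₀) * |x₁ - x₂| := by ring
        _ ≤ π * σ / 2 * |x₁ - x₂| := mul_le_mul_of_nonneg_right hcK (abs_nonneg _)
    have heq : β x₁ - β x₂ = (bE x₁ - bE x₂) - (c * HΩ x₁ - c * HΩ x₂) := by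
      simp only [hβ]; ring
    calc |β x₁ - β x₂| = |(bE x₁ - bE x₂) - (c * HΩ x₁ - c * HΩ x₂)| := by rw [heq]
      _ ≤ |bE x₁ - bE x₂| + |c * HΩ x₁ - c * HΩ x₂| := abs_sub _ _
      _ ≤ a / 2 * |x₁ - x₂| + π * σ / 2 * |x₁ - x₂| := add_le_add h1 h3
      _ = π * σ * |x₁ - x₂| := by rw [ha]; ring
  have hβc : Continuous β := hbEc.sub (continuous_const.mul hHcont)
  set s₀ : ℝ → ℝ := fun x => 2 * π * σ * x - β x with hs₀
  have hs₀c : Continuous s₀ := (continuous_const.mul continuous_id).sub hβc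
  have hmono : Monotone s₀ := by
    intro x₁ x₂ hx
    have h := hβLip x₂ x₁
    rw [abs_of_nonneg (by linarith : 0 ≤ x₂ - x₁)] at h
    have h2 := le_abs_self (β x₂ - β x₁)
    show 2 * π * σ * x₁ - β x₁ ≤ 2 * π * σ * x₂ - β x₂
    nlinarith [mul_pos hπ hσ0]
  have hLip : ∀ x₁ x₂, |s₀ x₁ - s₀ x₂| ≤ L * |x₁ - x₂| := by
    intro x₁ x₂
    have h := hβLip x₁ x₂
    have heq : s₀ x₁ - s₀ x₂ = 2 * π * σ * (x₁ - x₂) - (β x₁ - β x₂) := by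
      simp only [hs₀]; ring
    calc |s₀ x₁ - s₀ x₂| = |2 * π * σ * (x₁ - x₂) - (β x₁ - β x₂)| := by rw [heq]
      _ ≤ |2 * π * σ * (x₁ - x₂)| + |β x₁ - β x₂| := abs_sub _ _
      _ ≤ 2 * π * σ * |x₁ - x₂| + π * σ * |x₁ - x₂| := by
          rw [abs_mul, abs_of_pos (by positivity : (0 : ℝ) < 2 * π * σ)]; linarith
      _ = L * |x₁ - x₂| := by rw [hL]; ring
  set s : ℝ → ℝ := fun x => s₀ x - π * (⌊s₀ x / π⌋ : ℝ) - π / 2 with hsdef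
  have hs : ∀ x, s x = s₀ x - π * (⌊s₀ x / π⌋ : ℝ) - π / 2 := fun x => rfl
  have hsm : Measurable s := measurable_shiftedSawtooth hs₀c hs
  have hsb : ∀ t, |s t| ≤ π / 2 := abs_shiftedSawtooth_le hs
  have hsam : AEStronglyMeasurable s volume := hsm.aestronglyMeasurable
  -- (G) the holomorphic function
  set E : ℂ → ℂ := fun z => cexp (-(a : ℂ) * (1 - I * z) ^ (2⁻¹ : ℂ)) with hE
  set SΩ : ℂ → ℂ := fun z => ((π : ℂ) * I)⁻¹ * (∫ t : ℝ, (Ω t : ℂ) * (1 / ((t : ℂ) - z) - t / (1 + (t : ℂ) ^ 2)))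
    with hSΩ
  set Ss : ℂ → ℂ := fun z => ((π : ℂ) * I)⁻¹ * (∫ t : ℝ, (s t : ℂ) * (1 / ((t : ℂ) - z) - t / (1 + (t : ℂ) ^ 2)))
    with hSs
  set G : ℂ → ℂ := fun z => E z * cexp (-(c : ℂ) * SΩ z) * cexp (I * Ss z) with hG
  have hd : ∀ z : ℂ, 0 < z.im → DifferentiableAt ℂ G z := by
    intro z hz
    have h1 : DifferentiableAt ℂ E z := differentiableAt_sqrtDamping a (by linarith)
    have h2 : DifferentiableAt ℂ SΩ z := differentiableAt_schwarzIntegral hΩm hBΩ hz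
    have h3 : DifferentiableAt ℂ Ss z := differentiableAt_schwarzIntegral hsam hsb hz
    exact (h1.mul ((h2.const_mul _).cexp)).mul ((h3.const_mul _).cexp)
  -- the Poisson / conjugate Poisson integrals
  have hSΩeq : ∀ x : ℝ, ∀ {y : ℝ}, 0 < y → SΩ (x + y * I) =
      ((π⁻¹ * ∫ t : ℝ, Ω t * (y / ((x - t) ^ 2 + y ^ 2)) : ℝ) : ℂ) +
        ((π⁻¹ * ∫ t : ℝ, Ω t * ((x - t) / ((x - t) ^ 2 + y ^ 2) + t / (1 + t ^ 2)) : ℝ) : ℂ) * I :=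
    fun x y hy => schwarzIntegral_eq hΩm hBΩ x hy
  have hSseq : ∀ x : ℝ, ∀ {y : ℝ}, 0 < y → Ss (x + y * I) =
      ((π⁻¹ * ∫ t : ℝ, s t * (y / ((x - t) ^ 2 + y ^ 2)) : ℝ) : ℂ) +
        ((π⁻¹ * ∫ t : ℝ, s t * ((x - t) / ((x - t) ^ 2 + y ^ 2) + t / (1 + t ^ 2)) : ℝ) : ℂ) * I :=
    fun x y hy => schwarzIntegral_eq hsam hsb x hy
  -- modulus of the two exponential factors
  have hnorm1 : ∀ (P Q : ℝ), ‖cexp (-(c : ℂ) * ((P : ℂ) + (Q : ℂ) * I))‖ = Real.exp (-(c * P)) := by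
    intro P Q
    rw [Complex.norm_exp]
    congr 1
    simp only [neg_mul, neg_re, mul_re, ofReal_re, ofReal_im, add_re, add_im, mul_im, I_re, I_im]
    ring
  have hnorm2 : ∀ (P Q : ℝ), ‖cexp (I * ((P : ℂ) + (Q : ℂ) * I))‖ = Real.exp (-Q) := by
    intro P Q
    rw [Complex.norm_exp]
    congr 1
    simp only [mul_re, I_re, I_im, add_re, add_im, ofReal_re, ofReal_im, mul_im]
    ring
  -- lower bound for the conjugate Poisson integral of `s`
  have hQlow : ∀ (x : ℝ) {y : ℝ}, 0 < y →
      -(π⁻¹ * ∫ t : ℝ, s t * ((x - t) / ((x - t) ^ 2 + y ^ 2) + t / (1 + t ^ 2))) ≤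
        8 + Real.log (1 + y ^ 2) / 2 + 2 * Real.log (3 * |x| + 3) := by
    intro x y hy
    have h := conjPoissonIntegral_shiftedSawtooth_ge hs₀c hmono hLip hL0 hs x hy
    rw [hLπ] at h
    have : 3 * σ ≤ 3 / 40 := by linarith
    linarith
  -- (G3) the majorant
  set A : ℝ := Real.exp 8 * (18 * ((8 : ℕ).factorial : ℝ) / (a / 2) ^ 8) with hA
  have hb : ∀ x y : ℝ, 0 < y → ‖G (x + y * I)‖ ≤ A * (1 + y) ^ 1 / (1 + x ^ 2) := by
    intro x y hy
    have hzim : (0 : ℝ) ≤ ((x : ℂ) + y * I).im := by simp [hy.le]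
    -- the three factors
    have h1 : ‖E (x + y * I)‖ ≤ Real.exp (-(a / 2) * (1 + x ^ 2) ^ (1 / 4 : ℝ)) := by
      have h1' := norm_sqrtDamping_le ha0 hzim
      rw [hE]
      simpa using h1'
    have h2 : ‖cexp (-(c : ℂ) * SΩ (x + y * I))‖ ≤ 1 := by
      rw [hSΩeq x hy, hnorm1, Real.exp_le_one_iff, neg_nonpos]
      exact mul_nonneg hc0.le (le_poissonIntegral hΩm hBΩ (fun t => hΩ0 t) x hy)
    have h3 : ‖cexp (I * Ss (x + y * I))‖ ≤ Real.exp 8 * (1 + y) * (3 * |x| + 3) ^ 2 := by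
      rw [hSseq x hy, hnorm2]
      have h4 := hQlow x hy
      have h5 : Real.exp (-(π⁻¹ * ∫ t : ℝ, s t * ((x - t) / ((x - t) ^ 2 + y ^ 2) + t / (1 + t ^ 2)))) ≤
          Real.exp (8 + Real.log (1 + y ^ 2) / 2 + 2 * Real.log (3 * |x| + 3)) := Real.exp_le_exp.2 h4
      refine h5.trans ?_
      rw [Real.exp_add, Real.exp_add]
      have h6 : Real.exp (Real.log (1 + y ^ 2) / 2) ≤ 1 + y := by
        rw [show Real.log (1 + y ^ 2) / 2 = Real.log (Real.sqrt (1 + y ^ 2)) by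
          rw [Real.log_sqrt (by positivity)], Real.exp_log (Real.sqrt_pos.2 (by positivity))]
        rw [Real.sqrt_le_left (by linarith)]
        nlinarith
      have h7 : Real.exp (2 * Real.log (3 * |x| + 3)) = (3 * |x| + 3) ^ 2 := by
        rw [← Real.log_rpow (by positivity), Real.exp_log (by positivity), Real.rpow_two]
      rw [h7]
      have h8 : 0 ≤ (3 * |x| + 3) ^ 2 := sq_nonneg _
      exact mul_le_mul_of_nonneg_right (mul_le_mul_of_nonneg_left h6 (Real.exp_pos _).le) h8
    -- the algebra `exp(-(a/2) w) (3|x|+3)² ≤ 18 · 8!/(a/2)^8 /(1+x²)`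
    have hw : 0 < (1 + x ^ 2) ^ (1 / 4 : ℝ) := Real.rpow_pos_of_pos (by positivity) _
    have hw4 : ((1 + x ^ 2) ^ (1 / 4 : ℝ)) ^ 4 = 1 + x ^ 2 := by
      rw [← Real.rpow_natCast ((1 + x ^ 2) ^ (1 / 4 : ℝ)) 4, ← Real.rpow_mul (by positivity)]
      norm_num
    have h9 : Real.exp (-(a / 2) * (1 + x ^ 2) ^ (1 / 4 : ℝ)) ≤
        ((8 : ℕ).factorial : ℝ) / ((a / 2) ^ 8 * (1 + x ^ 2) ^ 2) := by
      have hfac : ∀ u : ℝ, 0 < u → Real.exp (-u) ≤ ((8 : ℕ).factorial : ℝ) / u ^ 8 := by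
        intro u hu
        have h := Real.pow_div_factorial_le_exp u hu.le 8
        rw [Real.exp_neg, inv_eq_one_div, div_le_div_iff₀ (Real.exp_pos u) (by positivity), one_mul]
        rw [div_le_iff₀ (by positivity)] at h
        linarith
      have := hfac ((a / 2) * (1 + x ^ 2) ^ (1 / 4 : ℝ)) (by positivity)
      rw [show -(a / 2) * (1 + x ^ 2) ^ (1 / 4 : ℝ) = -((a / 2) * (1 + x ^ 2) ^ (1 / 4 : ℝ)) by ring]
      refine this.trans (le_of_eq ?_)
      congr 1
      rw [mul_pow]
      congr 1
      have : ((1 + x ^ 2) ^ (1 / 4 : ℝ)) ^ 8 = (((1 + x ^ 2) ^ (1 / 4 : ℝ)) ^ 4) ^ 2 := by ring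
      rw [this, hw4]
    have h10 : (3 * |x| + 3) ^ 2 ≤ 18 * (1 + x ^ 2) := by
      have : x ^ 2 = |x| ^ 2 := (sq_abs x).symm
      nlinarith [abs_nonneg x, sq_nonneg (|x| - 1)]
    have hx2 : 0 < 1 + x ^ 2 := by positivity
    calc ‖G (x + y * I)‖ = ‖E (x + y * I)‖ * ‖cexp (-(c : ℂ) * SΩ (x + y * I))‖ * ‖cexp (I * Ss (x + y * I))‖ := by
          rw [hG]; simp only [norm_mul]
      _ ≤ Real.exp (-(a / 2) * (1 + x ^ 2) ^ (1 / 4 : ℝ)) * 1 * (Real.exp 8 * (1 + y) * (3 * |x| + 3) ^ 2) :=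
          mul_le_mul (mul_le_mul h1 h2 (norm_nonneg _) (Real.exp_pos _).le) h3 (norm_nonneg _)
            (by positivity)
      _ ≤ ((8 : ℕ).factorial : ℝ) / ((a / 2) ^ 8 * (1 + x ^ 2) ^ 2) * (Real.exp 8 * (1 + y) * (18 * (1 + x ^ 2))) := by
          rw [mul_one]
          refine mul_le_mul h9 ?_ (by positivity) (by positivity)
          exact mul_le_mul_of_nonneg_left h10 (by positivity)
      _ = A * (1 + y) ^ 1 / (1 + x ^ 2) := by
          rw [hA, pow_one]
          field_simp
  -- (PW) the spectral and boundary functions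
  obtain ⟨φ, g, hφc, hφ0, hφL2, hgL2, -, ⟨ns, hns, hae⟩, hpair, hrepr⟩ :=
    paleyWiener_halfPlane_boundaryValue hd hb
  set ys : ℕ → ℝ := fun k => 1 / ((ns k : ℝ) + 1) with hys
  have hys_pos : ∀ k, 0 < ys k := fun k => by rw [hys]; positivity
  have hys_le : ∀ k, ys k ≤ 1 := fun k => by
    rw [hys]; simp only
    rw [div_le_one (by positivity)]; linarith [(ns k).cast_nonneg (α := ℝ)]
  have hys_lim : Tendsto ys atTop (𝓝 0) := by
    have h1 : Tendsto (fun k => ((ns k : ℕ) : ℝ)) atTop atTop :=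
      tendsto_natCast_atTop_atTop.comp hns.tendsto_atTop
    have h2 : Tendsto (fun k => ((ns k : ℕ) : ℝ) + 1) atTop atTop := tendsto_atTop_add_const_right _ _ h1
    have h3 := h2.inv_tendsto_atTop
    rw [hys]
    refine Tendsto.congr (fun k => ?_) h3
    simp only [Pi.inv_apply, one_div]
  -- (B) boundary analysis at a.e. point
  have hcont_ae : ∀ᵐ x : ℝ, ContinuousAt s x := ae_continuousAt_shiftedSawtooth hs₀c hmono hs
  -- the modulus bound function
  set W : ℝ → ℝ := fun x => Real.exp 9 * (3 * |x| + 3) ^ 2 * ‖E x‖ * Real.exp (-(c * Ω x)) with hW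
  have hWc : Continuous W := by
    have hEc : Continuous fun x : ℝ => ‖E x‖ := by
      refine (continuous_iff_continuousAt.2 fun x => ?_).norm
      exact (continuousAt_sqrtDamping a (z := (x : ℂ)) (by simp)).comp Complex.continuous_ofReal.continuousAt
    simp only [hW]
    fun_prop
  -- which side is good
  have hvar : s₀ 2 - s₀ (-2) < π := by
    have h := hLip 2 (-2)
    rw [show (2 : ℝ) - -2 = 4 by norm_num, abs_of_pos (by norm_num : (0:ℝ) < 4)] at h
    have h2 := le_abs_self (s₀ 2 - s₀ (-2))
    have : L * 4 < π := by rw [hL]; nlinarith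
    linarith
  obtain hcase := floor_const_on_one_side hmono hvar
  -- the good interval `(p, q)`
  obtain ⟨p, q, hpq, hpqsub, hpq1, hgood⟩ : ∃ p q : ℝ, p < q ∧ Ioo p q ⊆ Icc (-1 : ℝ) 1 ∧ q - p = 1 / 2 ∧
      ∀ x ∈ Ioo p q, ∀ t ∈ Ioo (x - 1 / 2) (x + 1 / 2), ⌊s₀ t / π⌋ = ⌊s₀ x / π⌋ := by
    rcases hcase with hA' | hB'
    · refine ⟨1 / 2, 1, by norm_num, fun x hx => ⟨by linarith [hx.1], hx.2.le⟩, by norm_num, ?_⟩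
      intro x hx t ht
      rw [hA' t ⟨by linarith [hx.1, ht.1], by linarith [hx.2, ht.2]⟩, hA' x ⟨by linarith [hx.1], by linarith [hx.2]⟩]
    · refine ⟨-1, -1 / 2, by norm_num, fun x hx => ⟨hx.1.le, by linarith [hx.2]⟩, by norm_num, ?_⟩
      intro x hx t ht
      rw [hB' t ⟨by linarith [hx.1, ht.1], by linarith [hx.2, ht.2]⟩, hB' x ⟨by linarith [hx.1], by linarith [hx.2]⟩]
  -- the key a.e. statement
  have hkey : ∀ᵐ x : ℝ, ‖g x‖ ≤ W x ∧ g x = -(cexp (↑(2 * π * (2 * σ) * x) * I) * conj (g x)) ∧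
      (x ∈ Ioo p q → m ≤ ‖g x‖) := by
    filter_upwards [hae, hcont_ae] with x hGx hsx
    -- notation at the point `x`
    set PΩ : ℕ → ℝ := fun k => π⁻¹ * (∫ t : ℝ, Ω t * (ys k / ((x - t) ^ 2 + (ys k) ^ 2))) with hPΩ
    set QΩ : ℕ → ℝ := fun k => π⁻¹ * (∫ t : ℝ, Ω t * ((x - t) / ((x - t) ^ 2 + (ys k) ^ 2) + t / (1 + t ^ 2))) with hQΩ
    set Ps : ℕ → ℝ := fun k => π⁻¹ * (∫ t : ℝ, s t * (ys k / ((x - t) ^ 2 + (ys k) ^ 2))) with hPs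
    set Qs : ℕ → ℝ := fun k => π⁻¹ * (∫ t : ℝ, s t * ((x - t) / ((x - t) ^ 2 + (ys k) ^ 2) + t / (1 + t ^ 2))) with hQs
    set U : ℕ → ℂ := fun k => E (x + ys k * I) * cexp (-(c : ℂ) * ((PΩ k : ℂ) + (QΩ k : ℂ) * I)) *
      cexp (I * (Ps k : ℂ)) with hU
    have hfac : ∀ (P Q : ℝ), cexp (I * ((P : ℂ) + (Q : ℂ) * I)) = cexp (I * (P : ℂ)) * ((Real.exp (-Q) : ℝ) : ℂ) := by
      intro P Q
      rw [Complex.ofReal_exp, ← Complex.exp_add]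
      congr 1
      have hI : I * I = -1 := I_mul_I
      push_cast
      linear_combination (Q : ℂ) * hI
    have hGU : ∀ k, G (x + ys k * I) = U k * ((Real.exp (-(Qs k)) : ℝ) : ℂ) := by
      intro k
      rw [hG, hU]
      simp only
      rw [hSΩeq x (hys_pos k), hSseq x (hys_pos k), hfac]
      ring
    -- limits of the pieces
    have hlimE : Tendsto (fun k => E (x + ys k * I)) atTop (𝓝 (E x)) := by
      have h1 : ContinuousAt E (x : ℂ) := continuousAt_sqrtDamping a (by simp)
      have h2 : Tendsto (fun k => (x : ℂ) + ys k * I) atTop (𝓝 (x : ℂ)) := by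
        have := ((Complex.continuous_ofReal.tendsto 0).comp hys_lim).mul_const I
        have := this.const_add (x : ℂ)
        simpa using this
      exact h1.tendsto.comp h2
    have hlimPΩ : Tendsto PΩ atTop (𝓝 (Ω x)) :=
      tendsto_poissonIntegral_seq hΩm hBΩ hΩc.continuousAt hys_pos hys_lim
    have hlimQΩ : Tendsto QΩ atTop (𝓝 (HΩ x)) :=
      tendsto_conjPoissonIntegral_seq hΩC hΩs x hys_pos hys_lim
    have hlimPs : Tendsto Ps atTop (𝓝 (s x)) :=
      tendsto_poissonIntegral_seq hsam hsb hsx hys_pos hys_lim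
    set Ulim : ℂ := E x * cexp (-(c : ℂ) * ((Ω x : ℂ) + (HΩ x : ℂ) * I)) * cexp (I * (s x : ℂ)) with hUlim
    have hlimU : Tendsto U atTop (𝓝 Ulim) := by
      have h1 : Tendsto (fun k => cexp (-(c : ℂ) * ((PΩ k : ℂ) + (QΩ k : ℂ) * I))) atTop
          (𝓝 (cexp (-(c : ℂ) * ((Ω x : ℂ) + (HΩ x : ℂ) * I)))) := by
        refine (Complex.continuous_exp.tendsto _).comp ?_
        refine Tendsto.const_mul _ ?_
        exact ((Complex.continuous_ofReal.tendsto _).comp hlimPΩ).add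
          (((Complex.continuous_ofReal.tendsto _).comp hlimQΩ).mul_const I)
      have h2 : Tendsto (fun k => cexp (I * (Ps k : ℂ))) atTop (𝓝 (cexp (I * (s x : ℂ)))) :=
        (Complex.continuous_exp.tendsto _).comp (((Complex.continuous_ofReal.tendsto _).comp hlimPs).const_mul I)
      exact (hlimE.mul h1).mul h2
    have hUne : Ulim ≠ 0 := by
      rw [hUlim]; exact mul_ne_zero (mul_ne_zero (Complex.exp_ne_zero _) (Complex.exp_ne_zero _)) (Complex.exp_ne_zero _)
    -- the real factor converges to `g x / Ulim`, a nonnegative real `ρ`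
    have hUkne : ∀ k, U k ≠ 0 := fun k => by
      rw [hU]; exact mul_ne_zero (mul_ne_zero (Complex.exp_ne_zero _) (Complex.exp_ne_zero _)) (Complex.exp_ne_zero _)
    have hlimR : Tendsto (fun k => ((Real.exp (-(Qs k)) : ℝ) : ℂ)) atTop (𝓝 (g x / Ulim)) := by
      have h1 : ∀ k, ((Real.exp (-(Qs k)) : ℝ) : ℂ) = G (x + ys k * I) / U k := fun k => by
        rw [hGU k, mul_div_cancel_left₀ _ (hUkne k)]
      simp_rw [h1]
      exact hGx.div hlimU hUne
    obtain ⟨hρeq, hρ0⟩ := eq_ofReal_of_tendsto_ofReal (fun k => (Real.exp_pos _).le) hlimR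
    set ρ : ℝ := (g x / Ulim).re with hρ
    have hgx : g x = Ulim * (ρ : ℂ) := by
      rw [← hρeq]
      field_simp
    -- bounds on `ρ`
    have hRle : ∀ k, Real.exp (-(Qs k)) ≤ Real.exp 9 * (3 * |x| + 3) ^ 2 := by
      intro k
      have h4 := hQlow x (hys_pos k)
      have h5 : Real.log (1 + ys k ^ 2) ≤ 1 := by
        have : Real.log (1 + ys k ^ 2) ≤ Real.log 2 := Real.log_le_log (by positivity) (by nlinarith [hys_le k, hys_pos k])
        linarith
      have h7 : Real.exp (2 * Real.log (3 * |x| + 3)) = (3 * |x| + 3) ^ 2 := by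
        rw [← Real.log_rpow (by positivity), Real.exp_log (by positivity), Real.rpow_two]
      calc Real.exp (-(Qs k)) ≤ Real.exp (9 + 2 * Real.log (3 * |x| + 3)) := Real.exp_le_exp.2 (by
            rw [hQs]; linarith)
        _ = Real.exp 9 * (3 * |x| + 3) ^ 2 := by rw [Real.exp_add, h7]
    have hρle : ρ ≤ Real.exp 9 * (3 * |x| + 3) ^ 2 := by
      have h1 : Tendsto (fun k => (((Real.exp (-(Qs k)) : ℝ) : ℂ)).re) atTop (𝓝 ρ) :=
        (Complex.continuous_re.tendsto _).comp hlimR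
      simp only [ofReal_re] at h1
      exact le_of_tendsto' h1 hRle
    -- modulus of `Ulim`
    have hUnorm : ‖Ulim‖ = ‖E x‖ * Real.exp (-(c * Ω x)) := by
      rw [hUlim, norm_mul, norm_mul, hnorm1]
      have : ‖cexp (I * (s x : ℂ))‖ = 1 := by
        rw [mul_comm, Complex.norm_exp_ofReal_mul_I]
      rw [this, mul_one]
    refine ⟨?_, ?_, ?_⟩
    · -- (i) the modulus bound
      rw [hgx, norm_mul, Complex.norm_real, Real.norm_eq_abs, abs_of_nonneg hρ0, hUnorm, hW]
      simp only
      have : 0 ≤ ‖E x‖ * Real.exp (-(c * Ω x)) := by positivity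
      nlinarith [mul_le_mul_of_nonneg_left hρle this]
    · -- (ii) the phase symmetry
      have hEpolar := sqrtDamping_real_eq_norm_mul_exp a x
      have hUpolar : Ulim = ((‖E x‖ * Real.exp (-(c * Ω x)) : ℝ) : ℂ) *
          cexp (((2 * π * σ * x - π * (⌊s₀ x / π⌋ : ℤ) - π / 2 : ℝ) : ℂ) * I) := by
        have hEx : E x = (‖E x‖ : ℂ) * cexp (((-a * ((1 - I * (x : ℂ)) ^ (2⁻¹ : ℂ)).im : ℝ) : ℂ) * I) := hEpolar
        rw [hUlim]
        conv_lhs => rw [hEx]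
        have hsplit : -(c : ℂ) * ((Ω x : ℂ) + (HΩ x : ℂ) * I) = ((-(c * Ω x) : ℝ) : ℂ) + ((-(c * HΩ x) : ℝ) : ℂ) * I := by
          push_cast; ring
        rw [hsplit, Complex.exp_add, ← Complex.ofReal_exp]
        have hphase : ((-a * ((1 - I * (x : ℂ)) ^ (2⁻¹ : ℂ)).im : ℝ) : ℂ) * I + ((-(c * HΩ x) : ℝ) : ℂ) * I + I * (s x : ℂ) =
            ((2 * π * σ * x - π * (⌊s₀ x / π⌋ : ℤ) - π / 2 : ℝ) : ℂ) * I := by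
          have : (-a * ((1 - I * (x : ℂ)) ^ (2⁻¹ : ℂ)).im) + (-(c * HΩ x)) + s x =
              2 * π * σ * x - π * (⌊s₀ x / π⌋ : ℤ) - π / 2 := by
            rw [hs x]; simp only [hs₀, hβ, hbE]; ring
          rw [← this]; push_cast; ring
        calc (‖E x‖ : ℂ) * cexp (((-a * ((1 - I * (x : ℂ)) ^ (2⁻¹ : ℂ)).im : ℝ) : ℂ) * I) *
              (((Real.exp (-(c * Ω x)) : ℝ) : ℂ) * cexp (((-(c * HΩ x) : ℝ) : ℂ) * I)) * cexp (I * (s x : ℂ))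
            = ((‖E x‖ : ℂ) * ((Real.exp (-(c * Ω x)) : ℝ) : ℂ)) *
              (cexp (((-a * ((1 - I * (x : ℂ)) ^ (2⁻¹ : ℂ)).im : ℝ) : ℂ) * I) * cexp (((-(c * HΩ x) : ℝ) : ℂ) * I) *
                cexp (I * (s x : ℂ))) := by ring
          _ = ((‖E x‖ * Real.exp (-(c * Ω x)) : ℝ) : ℂ) *
              cexp (((2 * π * σ * x - π * (⌊s₀ x / π⌋ : ℤ) - π / 2 : ℝ) : ℂ) * I) := by
              rw [← Complex.exp_add, ← Complex.exp_add, hphase]; push_cast; ring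
      rw [hgx, hUpolar, mul_assoc, mul_comm (cexp _) (ρ : ℂ), ← mul_assoc, ← Complex.ofReal_mul]
      exact phase_symmetry_identity _ σ x _
    · -- (iii) the lower bound on the good interval
      intro hxgood
      have hx1 : |x| ≤ 1 := by
        have := hpqsub hxgood
        exact abs_le.2 ⟨this.1, this.2⟩
      have hconst : ∀ t ∈ Ioo (x - 1 / 2) (x + 1 / 2), ⌊s₀ t / π⌋ = ⌊s₀ x / π⌋ := hgood x hxgood
      have hRge : ∀ k, Real.exp (-13) ≤ Real.exp (-(Qs k)) := by
        intro k
        have h := abs_conjPoissonIntegral_shiftedSawtooth_le hs₀c hLip hL0 hs x (hys_pos k) hconst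
        rw [hLπ] at h
        have h5 : Real.log (1 + ys k ^ 2) ≤ 1 := by
          have : Real.log (1 + ys k ^ 2) ≤ Real.log 2 :=
            Real.log_le_log (by positivity) (by nlinarith [hys_le k, hys_pos k])
          linarith
        have h6 : Real.log (3 * |x| + 3) ≤ 2 :=
          (Real.log_le_log (by positivity) (by linarith)).trans hlog6
        have h7 := (abs_le.1 h).2
        rw [Real.exp_le_exp, hQs]
        have : 3 * σ ≤ 3 / 40 := by linarith
        linarith
      have hρge : Real.exp (-13) ≤ ρ := by
        have h1 : Tendsto (fun k => (((Real.exp (-(Qs k)) : ℝ) : ℂ)).re) atTop (𝓝 ρ) :=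
          (Complex.continuous_re.tendsto _).comp hlimR
        simp only [ofReal_re] at h1
        exact ge_of_tendsto' h1 hRge
      have hE1 : Real.exp (-(2 * a)) ≤ ‖E x‖ := norm_sqrtDamping_real_ge ha0.le hx1
      have hΩ1 : Real.exp (-(c * K₁)) ≤ Real.exp (-(c * Ω x)) := by
        rw [Real.exp_le_exp]
        have := hΩK₁ x (by linarith)
        nlinarith
      rw [hgx, norm_mul, Complex.norm_real, Real.norm_eq_abs, abs_of_nonneg hρ0, hUnorm, hm,
        show -(2 * a + c * K₁ + 13) = -(2 * a) + -(c * K₁) + -13 by ring, Real.exp_add, Real.exp_add]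
      have := Real.exp_pos (-(2 * a)); have := Real.exp_pos (-(c * K₁)); have := Real.exp_pos (-13 : ℝ)
      exact mul_le_mul (mul_le_mul hE1 hΩ1 (by positivity) (norm_nonneg _)) hρge (by positivity) (by positivity)
  -- (S) halve the spectrum
  have hgW : ∀ᵐ x : ℝ, ‖g x‖ ≤ W x := hkey.mono fun x hx => hx.1
  have hsym : ∀ᵐ x : ℝ, g x = -(cexp (↑(2 * π * (2 * σ) * x) * I) * conj (g x)) := hkey.mono fun x hx => hx.2.1
  have hgm : ∀ᵐ x : ℝ, x ∈ Ioo p q → m ≤ ‖g x‖ := hkey.mono fun x hx => hx.2.2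
  have hzero' : ∀ᵐ ζ : ℝ, 2 * σ < ζ → φ ζ = 0 :=
    ae_eq_zero_of_pairing_of_phase_symmetry hφL2 hpair hφ0 hsym
  -- (P) the multiplier
  obtain ⟨ψ, hψi, hψ2, hψsupp, hψW, hψlow⟩ :=
    exists_multiplier_of_boundary hφL2 hφ0 hzero' hrepr hWc hgW hpq hpqsub hm0.le hgm
  refine ⟨ψ, hψi, hψ2, hψsupp, fun ξ => (hψW ξ).trans ?_, ?_⟩
  · -- `W ξ ≤ e⁹ (3|ξ|+3)² exp(-(πσ/2)(1+ξ²)^{1/4}) exp(-cΩ ξ)`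
    rw [hW]
    simp only
    have h1 : ‖E ξ‖ ≤ Real.exp (-(a / 2) * (1 + ξ ^ 2) ^ (1 / 4 : ℝ)) := by
      have h1' := norm_sqrtDamping_le ha0 (z := (ξ : ℂ)) (by simp)
      rw [hE]
      simpa using h1'
    have h2 : 0 ≤ Real.exp 9 * (3 * |ξ| + 3) ^ 2 := by positivity
    have h3 : 0 ≤ Real.exp (-(c * Ω ξ)) := (Real.exp_pos _).le
    have h4 := mul_le_mul_of_nonneg_right (mul_le_mul_of_nonneg_left h1 h2) h3
    rw [ha] at h4
    exact h4
  · rw [hpq1] at hψlow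
    linarith

end Main

end Literature.Analysis.Fourier

/-!
## Part 3. The adapted weight has a Lipschitz Hilbert transform (Jin–Zhang, Lemma 13)

Topic `Literature/Analysis/Fourier`. L. Jin, R. Zhang, *Fractal uncertainty principle with explicit
exponent*, Math. Ann. 376 (2020) = arXiv:1710.00250, §4.1 (Lemma 13 and its proof): the weight
`Ω(ξ) = Σ_n Σ_{J ∈ 𝒥_n} χ_J(ξ)` adapted to a `δ`-regular set `Y ⊂ [-α₁, α₁]` (Bourgain–Dyatlov
2018, §3.1; here WITHOUT the `⟨ξ⟩^{1/2}` term, which the explicit multiplier construction replaces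
by a holomorphic factor) not only has bounded derivative, but the derivative of its (modified)
Hilbert transform is bounded by a constant `K₀ = K₀(δ, C_R)` INDEPENDENT of `α₁`:

  `sup_x |π⁻¹ (∫_{(-1,1)} (Ω'(x-u) - Ω'(x))/u du + ∫_{|u|≥1} Ω'(x-u)/u du)| ≤ K₀`

(this is `(ℋΩ)'` by `hasDerivAt_hilbert` of `SchwarzIntegral.lean`). The proof is the one printed
in Jin–Zhang: `Ω' = Σ_J χ'_J`, each `χ'_J` is localized at scale `ρ_n` with mean zero, so its
truncated Hilbert integral is `≲ (1 + ((x-ξ_J)/ρ_n)²)⁻¹` (`abs_hilbertPV_le_of_localized`); for the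
`≤ 5` generations `n` with `2^{n-2} < |x| < 2^{n+3}` the inner sum is `≤ 2π` by `1`-separation, and
for the other generations every term is `≤ 16 n^{-(1+δ)}` while `#𝒥_n ≤ 12 C_R² n^{δ(1+δ)/2}`,
which is summable because `(1+δ)(2-δ)/2 > 1`.

* `exists_adaptedWeight_hilbert` — the weight with all the properties used downstream:
  `Ω ∈ C²` with compact support, `0 ≤ Ω`, `Ω ≤ K₀` on `[-2, 2]`, the Hilbert bound above, and
  `θ(ξ)|ξ| ≤ 10 Ω(ξ) + 2` on `Y`, `θ(ξ) = log(10+|ξ|)^{-(1+δ)/2}`.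

No definitions, no new named facts; the cover bookkeeping is that of `AdaptedMultiplierWeight.lean`.
-/

namespace Literature.Analysis.Fourier

open _root_.MeasureTheory Set Filter Metric
open scoped Real Topology
open AdaptedWeight

section HilbertSum

variable {δ C_R α₁ : ℝ} {Y : Set ℝ}

/-- At most five generations are "near" a point: if `2^n < 4|x| < 32 · 2^n` for all `n ∈ W` then
`#W ≤ 5`. [folklore] -/
theorem card_near_generations_le_five (W : Finset ℕ) {x : ℝ}
    (hW : ∀ n ∈ W, (2 : ℝ) ^ n < 4 * |x| ∧ |x| < 8 * 2 ^ n) : W.card ≤ 5 := by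
  classical
  by_cases hWe : W = ∅
  · simp [hWe]
  have hne : W.Nonempty := Finset.nonempty_iff_ne_empty.2 hWe
  set n₀ := W.min' hne
  have hsub : W ⊆ Finset.Icc n₀ (n₀ + 4) := by
    intro n hn
    have h0 : n₀ ∈ W := Finset.min'_mem W hne
    have hle : n₀ ≤ n := Finset.min'_le W n hn
    obtain ⟨h1, -⟩ := hW n hn
    obtain ⟨-, h2⟩ := hW n₀ h0
    -- `2^n < 4|x| < 32 · 2^{n₀}`, so `n ≤ n₀ + 4`
    have h3 : (2 : ℝ) ^ n < 2 ^ (n₀ + 5) := by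
      have : (2 : ℝ) ^ (n₀ + 5) = 32 * 2 ^ n₀ := by ring
      rw [this]; linarith
    have h4 : n < n₀ + 5 := by
      by_contra h
      push Not at h
      have := pow_le_pow_right₀ (by norm_num : (1 : ℝ) ≤ 2) h
      linarith
    exact Finset.mem_Icc.2 ⟨hle, by omega⟩
  calc W.card ≤ (Finset.Icc n₀ (n₀ + 4)).card := Finset.card_le_card hsub
    _ = 5 := by rw [Nat.card_Icc]; omega

/-- **The generation sum** (Jin–Zhang, proof of Lemma 13): for the cover family `T` of a
`δ`-regular set and every `x`,
`Σ_{(n,j) ∈ T} (1 + ((x - ρ_n(j+1/2))/ρ_n)²)⁻¹ ≤ 10π + 192 C_R² Σ_n n^{-(1+δ)(2-δ)/2}`.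
[cite: JinZhang2017, §4.1, proof of Lemma 13] -/
theorem sum_inv_one_add_sq_cover_le (hY : IsRegularSet Y δ C_R 2 α₁) (hC : 1 ≤ C_R)
    (hδ0 : 0 < δ) (hδ1 : δ < 1) (T : Finset (ℕ × ℤ))
    (hT : ∀ p ∈ T, 1 ≤ p.1 ∧ (2 : ℝ) ^ p.1 ≤ α₁ ∧
      (Y ∩ {x | (2 : ℝ) ^ p.1 ≤ |x| ∧ |x| ≤ 2 ^ (p.1 + 1)} ∩
        Icc ((p.1 : ℝ) ^ (-(1 + δ) / 2) * 2 ^ p.1 * p.2)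
          ((p.1 : ℝ) ^ (-(1 + δ) / 2) * 2 ^ p.1 * (p.2 + 1))).Nonempty)
    {S : ℝ} (hS : ∀ F : Finset ℕ, (∀ n ∈ F, 1 ≤ n) →
      ∑ n ∈ F, (n : ℝ) ^ (-((1 + δ) * (2 - δ) / 2)) ≤ S)
    (x : ℝ) :
    ∑ p ∈ T, 1 / (1 + ((x - (p.1 : ℝ) ^ (-(1 + δ) / 2) * 2 ^ p.1 * (p.2 + 1 / 2)) /
        ((p.1 : ℝ) ^ (-(1 + δ) / 2) * 2 ^ p.1)) ^ 2) ≤ 5 * (2 * π) + 192 * C_R ^ 2 * S := by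
  classical
  set r : ℕ → ℝ := fun n => (n : ℝ) ^ (-(1 + δ) / 2) * 2 ^ n with hrdef
  set f : ℕ × ℤ → ℝ := fun p => 1 / (1 + ((x - r p.1 * (p.2 + 1 / 2)) / r p.1) ^ 2) with hfdef
  change ∑ p ∈ T, f p ≤ _
  have hT1 : ∀ p ∈ T, 1 ≤ p.1 := fun p hp => (hT p hp).1
  have hrpos : ∀ n, 1 ≤ n → 0 < r n := fun n hn => scale_pos hδ1.le hn
  have hf0 : ∀ p, 0 ≤ f p := fun p => by positivity
  set Ns := T.image Prod.fst with hNs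
  have hNs1 : ∀ n ∈ Ns, 1 ≤ n := by
    intro n hn; obtain ⟨p, hp, rfl⟩ := Finset.mem_image.1 hn; exact hT1 p hp
  -- fibrewise decomposition
  rw [← Finset.sum_fiberwise_of_maps_to (g := Prod.fst) (t := Ns)
    (fun p hp => Finset.mem_image_of_mem Prod.fst hp)]
  -- (a) every fibre sum is `≤ 2π` (separation)
  have hfib_sep : ∀ n ∈ Ns, ∑ p ∈ T.filter (fun p => p.1 = n), f p ≤ 2 * π := by
    intro n hn
    have hn1 := hNs1 n hn
    have hrn := hrpos n hn1
    have heq : ∀ p ∈ T.filter (fun p => p.1 = n),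
        f p = 1 / (1 + ((x - r n * (p.2 + 1 / 2)) / r n) ^ 2) := by
      intro p hp; rw [hfdef]; simp only; rw [(Finset.mem_filter.1 hp).2]
    rw [Finset.sum_congr rfl heq]
    refine sum_inv_one_add_sq_le_of_separated _ (fun p : ℕ × ℤ => (x - r n * (p.2 + 1 / 2)) / r n) ?_
    intro p hp q hq hpq
    have hp2 : p.2 ≠ q.2 := by
      intro h
      exact hpq (Prod.ext (((Finset.mem_filter.1 hp).2).trans ((Finset.mem_filter.1 hq).2).symm) h)
    have hdiff : (x - r n * (p.2 + 1 / 2)) / r n - (x - r n * (q.2 + 1 / 2)) / r n = (q.2 : ℝ) - p.2 := by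
      field_simp; ring
    rw [hdiff]
    have h1 : (1 : ℤ) ≤ |q.2 - p.2| := Int.one_le_abs (sub_ne_zero.2 (Ne.symm hp2))
    have h2 : ((1 : ℤ) : ℝ) ≤ ((|q.2 - p.2| : ℤ) : ℝ) := by exact_mod_cast h1
    rw [Int.cast_abs, Int.cast_sub, Int.cast_one] at h2
    exact h2
  -- (b) far fibres: each term `≤ 16 n^{-(1+δ)}`, and there are `≤ 12 C_R² n^{δ(1+δ)/2}` of them
  set W := Ns.filter fun n => (2 : ℝ) ^ n < 4 * |x| ∧ |x| < 8 * 2 ^ n with hW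
  have hWcard : W.card ≤ 5 :=
    card_near_generations_le_five W fun n hn => (Finset.mem_filter.1 hn).2
  have hfar_term : ∀ n ∈ Ns, n ∉ W → ∀ p ∈ T.filter (fun p => p.1 = n),
      f p ≤ 16 * (n : ℝ) ^ (-(1 + δ)) := by
    intro n hn hnW p hp
    have hn1 := hNs1 n hn
    have hn0 : (0 : ℝ) < n := by exact_mod_cast hn1
    have hrn := hrpos n hn1
    have hpT := (Finset.mem_filter.1 hp).1
    have hpn := (Finset.mem_filter.1 hp).2
    obtain ⟨x₀, ⟨-, hxA⟩, hxc⟩ := (hT p hpT).2.2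
    simp only [mem_setOf_eq] at hxA
    rw [hpn] at hxA hxc
    change r n * p.2 ≤ x₀ ∧ x₀ ≤ r n * (p.2 + 1) at hxc
    have hrle : r n ≤ 2 ^ n := scale_le_two_pow hδ0.le hn1
    -- the centre is within `r_n/2` of `x₀`
    have hc1 : |x₀ - r n * (p.2 + 1 / 2)| ≤ r n / 2 := by
      rw [abs_le]; constructor <;> nlinarith [hxc.1, hxc.2]
    -- `|x - c| ≥ 2^n / 4`
    have hfar : (2 : ℝ) ^ n / 4 ≤ |x - r n * (p.2 + 1 / 2)| := by
      have hnot : ¬((2 : ℝ) ^ n < 4 * |x| ∧ |x| < 8 * 2 ^ n) := by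
        intro h; exact hnW (Finset.mem_filter.2 ⟨hn, h⟩)
      rcases not_and_or.1 hnot with h | h
      · push Not at h
        -- `|x| ≤ 2^n/4`: `|x - c| ≥ |c| - |x| ≥ |x₀| - r/2 - 2^n/4`
        have h1 : |r n * (p.2 + 1 / 2)| ≥ |x₀| - r n / 2 := by
          have := abs_sub_abs_le_abs_sub x₀ (r n * (p.2 + 1 / 2)); linarith
        have h2 : |x - r n * (p.2 + 1 / 2)| ≥ |r n * (p.2 + 1 / 2)| - |x| := by
          have := abs_sub_abs_le_abs_sub (r n * (p.2 + 1 / 2)) x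
          rw [abs_sub_comm] at this; linarith
        linarith [hxA.1]
      · push Not at h
        -- `|x| ≥ 8 · 2^n`: `|x - c| ≥ |x| - |c| ≥ 8·2^n - |x₀| - r/2`
        have h1 : |r n * (p.2 + 1 / 2)| ≤ |x₀| + r n / 2 := by
          have := abs_sub_abs_le_abs_sub (r n * (p.2 + 1 / 2)) x₀
          rw [abs_sub_comm] at this; linarith
        have h2 : |x - r n * (p.2 + 1 / 2)| ≥ |x| - |r n * (p.2 + 1 / 2)| :=
          abs_sub_abs_le_abs_sub x _
        have h3 : (2 : ℝ) ^ (n + 1) = 2 * 2 ^ n := by ring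
        linarith [hxA.2]
    -- hence `((x-c)/r)² ≥ n^{1+δ}/16`
    have hratio : (2 : ℝ) ^ n / r n = (n : ℝ) ^ ((1 + δ) / 2) := by
      rw [hrdef]; simp only
      rw [show -(1 + δ) / 2 = -((1 + δ) / 2) by ring, Real.rpow_neg hn0.le]
      have : (0 : ℝ) < (n : ℝ) ^ ((1 + δ) / 2) := Real.rpow_pos_of_pos hn0 _
      field_simp
    have hsq : (n : ℝ) ^ (1 + δ) / 16 ≤ ((x - r n * (p.2 + 1 / 2)) / r n) ^ 2 := by
      have h1 : (2 : ℝ) ^ n / 4 / r n ≤ |x - r n * (p.2 + 1 / 2)| / r n :=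
        div_le_div_of_nonneg_right hfar hrn.le
      have h2 : (2 : ℝ) ^ n / 4 / r n = (n : ℝ) ^ ((1 + δ) / 2) / 4 := by
        rw [← hratio]; field_simp
      rw [h2] at h1
      have h3 : 0 ≤ (n : ℝ) ^ ((1 + δ) / 2) / 4 := by positivity
      have h4 := pow_le_pow_left₀ h3 h1 2
      rw [div_pow, div_pow, sq_abs] at h4
      have h5 : ((n : ℝ) ^ ((1 + δ) / 2)) ^ 2 = (n : ℝ) ^ (1 + δ) := by
        rw [← Real.rpow_natCast, ← Real.rpow_mul hn0.le]; norm_num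
      rw [h5] at h4
      rw [div_pow]
      norm_num at h4 ⊢
      linarith [h4]
    have hnpos : 0 < (n : ℝ) ^ (1 + δ) := Real.rpow_pos_of_pos hn0 _
    simp only [hfdef, hpn]
    calc 1 / (1 + ((x - r n * (p.2 + 1 / 2)) / r n) ^ 2) ≤ 1 / ((n : ℝ) ^ (1 + δ) / 16) :=
          one_div_le_one_div_of_le (by positivity) (by linarith)
      _ = 16 * (n : ℝ) ^ (-(1 + δ)) := by
          rw [Real.rpow_neg hn0.le]; field_simp
  have hfib_far : ∀ n ∈ Ns, n ∉ W → ∑ p ∈ T.filter (fun p => p.1 = n), f p ≤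
      192 * C_R ^ 2 * (n : ℝ) ^ (-((1 + δ) * (2 - δ) / 2)) := by
    intro n hn hnW
    have hn1 := hNs1 n hn
    have hn0 : (0 : ℝ) < n := by exact_mod_cast hn1
    have hcard := card_fibre_le hY hC hδ0.le hδ1.le T hT n
    have hnn : 0 ≤ 16 * (n : ℝ) ^ (-(1 + δ)) := by positivity
    calc ∑ p ∈ T.filter (fun p => p.1 = n), f p
        ≤ ∑ _p ∈ T.filter (fun p => p.1 = n), 16 * (n : ℝ) ^ (-(1 + δ)) :=
          Finset.sum_le_sum (hfar_term n hn hnW)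
      _ = ((T.filter fun p => p.1 = n).card : ℝ) * (16 * (n : ℝ) ^ (-(1 + δ))) := by
          rw [Finset.sum_const, nsmul_eq_mul]
      _ ≤ (12 * C_R ^ 2 * (n : ℝ) ^ (δ * (1 + δ) / 2)) * (16 * (n : ℝ) ^ (-(1 + δ))) :=
          mul_le_mul_of_nonneg_right hcard hnn
      _ = 192 * C_R ^ 2 * ((n : ℝ) ^ (δ * (1 + δ) / 2) * (n : ℝ) ^ (-(1 + δ))) := by ring
      _ = 192 * C_R ^ 2 * (n : ℝ) ^ (-((1 + δ) * (2 - δ) / 2)) := by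
          rw [← Real.rpow_add hn0]; congr 1; congr 1; ring
  -- (c) combine
  have hsplit : ∑ n ∈ Ns, ∑ p ∈ T.filter (fun p => p.1 = n), f p =
      (∑ n ∈ W, ∑ p ∈ T.filter (fun p => p.1 = n), f p) +
        ∑ n ∈ Ns.filter (fun n => n ∉ W), ∑ p ∈ T.filter (fun p => p.1 = n), f p := by
    rw [← Finset.sum_filter_add_sum_filter_not Ns (fun n => n ∈ W)]
    congr 1
    · congr 1
      ext n
      simp only [Finset.mem_filter, hW, and_self_left]
  rw [hsplit]
  have hA : ∑ n ∈ W, ∑ p ∈ T.filter (fun p => p.1 = n), f p ≤ 5 * (2 * π) := by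
    calc ∑ n ∈ W, ∑ p ∈ T.filter (fun p => p.1 = n), f p ≤ ∑ _n ∈ W, 2 * π :=
          Finset.sum_le_sum fun n hn => hfib_sep n (Finset.mem_filter.1 hn).1
      _ = W.card * (2 * π) := by rw [Finset.sum_const, nsmul_eq_mul]
      _ ≤ 5 * (2 * π) := by
          have : (W.card : ℝ) ≤ 5 := by exact_mod_cast hWcard
          nlinarith [Real.pi_pos]
  have hB : ∑ n ∈ Ns.filter (fun n => n ∉ W), ∑ p ∈ T.filter (fun p => p.1 = n), f p ≤
      192 * C_R ^ 2 * S := by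
    calc ∑ n ∈ Ns.filter (fun n => n ∉ W), ∑ p ∈ T.filter (fun p => p.1 = n), f p
        ≤ ∑ n ∈ Ns.filter (fun n => n ∉ W), 192 * C_R ^ 2 * (n : ℝ) ^ (-((1 + δ) * (2 - δ) / 2)) :=
          Finset.sum_le_sum fun n hn =>
            hfib_far n (Finset.mem_filter.1 hn).1 (Finset.mem_filter.1 hn).2
      _ = 192 * C_R ^ 2 * ∑ n ∈ Ns.filter (fun n => n ∉ W), (n : ℝ) ^ (-((1 + δ) * (2 - δ) / 2)) := by
          rw [Finset.mul_sum]
      _ ≤ 192 * C_R ^ 2 * S := by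
          gcongr
          exact hS _ fun n hn => hNs1 n (Finset.mem_filter.1 hn).1
  linarith

end HilbertSum

section Weight

variable {δ C_R : ℝ}

/-- The integral of `u ↦ χ'((u - c)/r)` vanishes for a `C¹` compactly supported `χ`. [folklore] -/
theorem integral_deriv_scaledCutoff_eq_zero {χ : ℝ → ℝ} (hχ : ContDiff ℝ 1 χ)
    (hsupp : HasCompactSupport χ) {r : ℝ} (hr : r ≠ 0) (c : ℝ) :
    ∫ u, deriv χ ((u - c) / r) = 0 := by
  have hχd : Differentiable ℝ χ := hχ.differentiable one_ne_zero
  have hχc : Continuous χ := hχ.continuous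
  have hχ'c : Continuous (deriv χ) := hχ.continuous_deriv le_rfl
  -- `u ↦ r χ((u-c)/r)` and its derivative are compactly supported, hence integrable
  have haff : Continuous fun u : ℝ => (u - c) / r := by fun_prop
  have hK : IsCompact ((fun y : ℝ => r * y + c) '' tsupport χ) :=
    hsupp.isCompact.image (by fun_prop)
  have hK' : IsCompact ((fun y : ℝ => r * y + c) '' tsupport (deriv χ)) :=
    hsupp.deriv.isCompact.image (by fun_prop)
  have hf : HasCompactSupport fun u : ℝ => r * χ ((u - c) / r) := by
    refine HasCompactSupport.intro hK fun u hu => ?_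
    have : (u - c) / r ∉ tsupport χ := by
      intro hmem
      exact hu ⟨(u - c) / r, hmem, by field_simp; ring⟩
    rw [image_eq_zero_of_notMem_tsupport this, mul_zero]
  have hf' : HasCompactSupport fun u : ℝ => deriv χ ((u - c) / r) := by
    refine HasCompactSupport.intro hK' fun u hu => ?_
    have : (u - c) / r ∉ tsupport (deriv χ) := by
      intro hmem
      exact hu ⟨(u - c) / r, hmem, by field_simp; ring⟩
    exact image_eq_zero_of_notMem_tsupport this
  refine integral_eq_zero_of_hasDerivAt_of_integrable (f := fun u : ℝ => r * χ ((u - c) / r))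
    (fun u => hasDerivAt_scaledCutoff hχd hr c u) ?_ ?_
  · exact (hχ'c.comp haff).integrable_of_hasCompactSupport hf'
  · exact (continuous_const.mul (hχc.comp haff)).integrable_of_hasCompactSupport hf

set_option maxHeartbeats 1600000 in
/-- **The adapted weight with Lipschitz Hilbert transform** (Jin–Zhang, Lemma 13, for the pure
cover weight `Ω = Σ_n Σ_{J ∈ 𝒥_n} χ_J`). Let `0 < δ < 1`, `C_R ≥ 1`. There is `K₀ = K₀(δ, C_R)`
such that for every `α₁` and every `Y ⊂ [-α₁, α₁]` `δ`-regular with constant `C_R` on scales `2`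
to `α₁` there is `Ω ∈ C²(ℝ)` with compact support, `0 ≤ Ω`, `Ω ≤ K₀` on `[-2, 2]`,
`|π⁻¹ (∫_{(-1,1)} (Ω'(x-u)-Ω'(x))/u du + ∫_{|u|≥1} Ω'(x-u)/u du)| ≤ K₀` for all `x` (i.e.
`sup |(ℋΩ)'| ≤ K₀`), and `θ(ξ)|ξ| ≤ 10 Ω(ξ) + 2` on `Y`, `θ(ξ) = log(10+|ξ|)^{-(1+δ)/2}`.
[cite: JinZhang2017, Lemma 13] -/
theorem exists_adaptedWeight_hilbert (hδ0 : 0 < δ) (hδ1 : δ < 1) (hC : 1 ≤ C_R) :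
    ∃ K₀ : ℝ, 0 < K₀ ∧ ∀ (α₁ : ℝ) (Y : Set ℝ), Y ⊆ Icc (-α₁) α₁ → IsRegularSet Y δ C_R 2 α₁ →
      ∃ Ω : ℝ → ℝ, ContDiff ℝ 2 Ω ∧ HasCompactSupport Ω ∧ (∀ ξ, 0 ≤ Ω ξ) ∧
        (∀ ξ, |ξ| ≤ 2 → Ω ξ ≤ K₀) ∧
        (∀ x, |π⁻¹ * ((∫ u in Ioo (-1 : ℝ) 1, (deriv Ω (x - u) - deriv Ω x) / u) +
            ∫ u in {u : ℝ | 1 ≤ |u|}, deriv Ω (x - u) / u)| ≤ K₀) ∧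
        (∀ ξ ∈ Y, Real.log (10 + |ξ|) ^ (-(1 + δ) / 2) * |ξ| ≤ 10 * Ω ξ + 2) := by
  classical
  -- the fixed smooth cutoff `χ`: `= 1` on `[-1/2, 1/2]`, `= 0` off `(-1, 1)`
  let χb : ContDiffBump (0 : ℝ) := ⟨1 / 2, 1, by norm_num, by norm_num⟩
  set χ : ℝ → ℝ := fun y => χb y with hχdef
  have hχC : ContDiff ℝ 2 χ := χb.contDiff
  have hχC1 : ContDiff ℝ 1 χ := χb.contDiff
  have hχd : Differentiable ℝ χ := hχC1.differentiable one_ne_zero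
  have hχc : Continuous χ := hχC.continuous
  have hχsupp : HasCompactSupport χ := χb.hasCompactSupport
  have hχ0 : ∀ y, 0 ≤ χ y := fun y => χb.nonneg
  have hχ1 : ∀ y, χ y ≤ 1 := fun y => χb.le_one
  have hχone : ∀ y, |y| ≤ 1 / 2 → χ y = 1 := fun y hy =>
    χb.one_of_mem_closedBall (Metric.mem_closedBall.2 (by
      show dist y 0 ≤ 1 / 2
      simpa [Real.dist_eq] using hy))
  have hχzero : ∀ y, 1 ≤ |y| → χ y = 0 := fun y hy =>
    χb.zero_of_le_dist (by
      show (1 : ℝ) ≤ dist y 0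
      simpa [Real.dist_eq] using hy)
  -- bounds for `χ'` and `χ''`
  obtain ⟨_, B₁, B₂, _, -, hB₁0, hB₂0, -, -, hB₁, -, hLip₂, -, -⟩ :=
    exists_bounds_of_contDiff_two hχC hχsupp
  -- constants
  set s : ℝ := (1 + δ) * (2 - δ) / 2 with hs
  have hs1 : 1 < s := by simp only [hs]; nlinarith
  have hsum : Summable fun n : ℕ => (n : ℝ) ^ (-s) := Real.summable_nat_rpow.2 (by linarith)
  set S : ℝ := ∑' n : ℕ, (n : ℝ) ^ (-s) with hSdef
  have hS0 : 0 ≤ S := tsum_nonneg fun n => Real.rpow_nonneg (Nat.cast_nonneg n) _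
  have hSF : ∀ F : Finset ℕ, (∀ n ∈ F, 1 ≤ n) → ∑ n ∈ F, (n : ℝ) ^ (-((1 + δ) * (2 - δ) / 2)) ≤ S :=
    fun F _ => hsum.sum_le_tsum F fun n _ => Real.rpow_nonneg (Nat.cast_nonneg n) _
  set Ksum : ℝ := 5 * (2 * π) + 192 * C_R ^ 2 * S with hKsum
  have hKsum0 : 0 ≤ Ksum := by positivity
  set Khil : ℝ := π⁻¹ * (10 * (B₁ + B₂) * Ksum) with hKhil
  have hKhil0 : 0 ≤ Khil := by positivity
  set Knear : ℝ := 51 * 2 ^ 15 with hKnear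
  refine ⟨Khil + Knear + 1, by positivity, fun α₁ Y hYsub hY => ?_⟩
  -- the family of cells (as in `exists_adaptedLogWeight`)
  obtain ⟨K, hK⟩ : ∃ K : ℕ, α₁ ≤ K := ⟨⌈α₁⌉₊, Nat.le_ceil α₁⟩
  set M : ℕ := 2 ^ K + 1 with hMdef
  set r : ℕ → ℝ := fun n => (n : ℝ) ^ (-(1 + δ) / 2) * 2 ^ n with hrdef
  set T : Finset (ℕ × ℤ) := ((Finset.Icc 1 K) ×ˢ (Finset.Icc (-(M : ℤ)) (M : ℤ))).filter
    (fun p => (2 : ℝ) ^ p.1 ≤ α₁ ∧ (Y ∩ {x | (2 : ℝ) ^ p.1 ≤ |x| ∧ |x| ≤ 2 ^ (p.1 + 1)} ∩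
      Icc (r p.1 * p.2) (r p.1 * (p.2 + 1))).Nonempty) with hTdef
  have hTmem : ∀ p : ℕ × ℤ, p ∈ T ↔ (p.1 ∈ Finset.Icc 1 K ∧ p.2 ∈ Finset.Icc (-(M : ℤ)) (M : ℤ)) ∧
      (2 : ℝ) ^ p.1 ≤ α₁ ∧ (Y ∩ {x | (2 : ℝ) ^ p.1 ≤ |x| ∧ |x| ≤ 2 ^ (p.1 + 1)} ∩
        Icc (r p.1 * p.2) (r p.1 * (p.2 + 1))).Nonempty := by
    intro p; simp only [hTdef, Finset.mem_filter, Finset.mem_product]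
  have hT1 : ∀ p ∈ T, 1 ≤ p.1 := fun p hp => (Finset.mem_Icc.1 ((hTmem p).1 hp).1.1).1
  have hT : ∀ p ∈ T, 1 ≤ p.1 ∧ (2 : ℝ) ^ p.1 ≤ α₁ ∧
      (Y ∩ {x | (2 : ℝ) ^ p.1 ≤ |x| ∧ |x| ≤ 2 ^ (p.1 + 1)} ∩
        Icc ((p.1 : ℝ) ^ (-(1 + δ) / 2) * 2 ^ p.1 * p.2)
          ((p.1 : ℝ) ^ (-(1 + δ) / 2) * 2 ^ p.1 * (p.2 + 1))).Nonempty := fun p hp =>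
    ⟨hT1 p hp, ((hTmem p).1 hp).2.1, ((hTmem p).1 hp).2.2⟩
  have hTmeet : ∀ p ∈ T, ∃ x : ℝ, ((2 : ℝ) ^ p.1 ≤ |x| ∧ |x| ≤ 2 ^ (p.1 + 1)) ∧
      (r p.1 * p.2 ≤ x ∧ x ≤ r p.1 * (p.2 + 1)) := by
    intro p hp
    obtain ⟨x, ⟨-, hxA⟩, hxc⟩ := ((hTmem p).1 hp).2.2
    exact ⟨x, hxA, hxc⟩
  have hrpos : ∀ p ∈ T, 0 < r p.1 := fun p hp => scale_pos hδ1.le (hT1 p hp)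
  have hrne : ∀ p ∈ T, r p.1 ≠ 0 := fun p hp => (hrpos p hp).ne'
  have hr16 : ∀ n : ℕ, 16 ≤ n → r n ≤ 2 ^ n / 4 := fun n hn => scale_le_two_pow_div_four hδ0.le hn
  have hrle : ∀ p ∈ T, r p.1 ≤ 2 ^ p.1 := fun p hp => scale_le_two_pow hδ0.le (hT1 p hp)
  have hTcomplete : ∀ (n : ℕ) (j : ℤ), 1 ≤ n → (2 : ℝ) ^ n ≤ α₁ → ∀ x ∈ Y,
      (2 : ℝ) ^ n ≤ |x| ∧ |x| ≤ 2 ^ (n + 1) → r n * j ≤ x ∧ x ≤ r n * (j + 1) → (n, j) ∈ T := by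
    intro n j hn hnα x hxY hxA hxc
    rw [hTmem]
    exact ⟨index_bounds hδ1.le hK hn hnα hxA hxc, hnα, x, ⟨hxY, hxA⟩, hxc⟩
  -- the weight
  set c : ℕ × ℤ → ℝ := fun p => r p.1 * (p.2 + 1 / 2) with hcdef
  set Ω : ℝ → ℝ := fun ξ => ∑ p ∈ T, r p.1 * χ ((ξ - c p) / r p.1) with hΩdef
  have hΩ0 : ∀ ξ, 0 ≤ Ω ξ := fun ξ =>
    Finset.sum_nonneg fun p hp => scaledCutoff_nonneg hχ0 (hrpos p hp) _ _
  -- smoothness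
  have hΩC : ContDiff ℝ 2 Ω := by
    simp only [hΩdef]
    refine ContDiff.sum fun p hp => ?_
    exact contDiff_const.mul (hχC.comp ((contDiff_id.sub contDiff_const).div_const _))
  -- compact support
  set R₀ : ℝ := ∑ p ∈ T, (|c p| + r p.1) with hR₀
  have hR₀ge : ∀ p ∈ T, |c p| + r p.1 ≤ R₀ := fun p hp =>
    Finset.single_le_sum (f := fun p => |c p| + r p.1) (fun q hq => by
      have := hrpos q hq; positivity) hp
  have hΩzero : ∀ ξ, R₀ < |ξ| → Ω ξ = 0 := by
    intro ξ hξ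
    simp only [hΩdef]
    refine Finset.sum_eq_zero fun p hp => ?_
    rw [scaledCutoff_eq_zero hχzero (hrpos p hp), mul_zero]
    have h1 := hR₀ge p hp
    have h2 : |ξ| - |c p| ≤ |ξ - c p| := abs_sub_abs_le_abs_sub ξ (c p)
    linarith
  have hΩsupp : HasCompactSupport Ω := by
    refine HasCompactSupport.intro (isCompact_closedBall (0 : ℝ) R₀) fun ξ hξ => hΩzero ξ ?_
    rw [mem_closedBall, dist_zero_right, Real.norm_eq_abs, not_le] at hξ
    exact hξ
  -- bound on `[-2, 2]`
  have hΩnear : ∀ ξ, |ξ| ≤ 2 → Ω ξ ≤ Knear := by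
    intro ξ hξ
    have hvan : ∀ p ∈ T, ¬(|ξ - c p| ≤ r p.1) → r p.1 * χ ((ξ - c p) / r p.1) = 0 := by
      intro p hp h
      rw [scaledCutoff_eq_zero hχzero (hrpos p hp) (lt_of_not_ge h), mul_zero]
    simp only [hΩdef]
    rw [← Finset.sum_filter_of_ne (p := fun p => |ξ - c p| ≤ r p.1)
      (fun p hp hne => by by_contra h; exact hne (hvan p hp h))]
    -- every near cell has `n ≤ 15`, hence `r ≤ 2^15`
    have hsmall : ∀ p ∈ T.filter (fun p => |ξ - c p| ≤ r p.1), r p.1 * χ ((ξ - c p) / r p.1) ≤ 2 ^ 15 := by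
      intro p hp
      obtain ⟨hpT, hnear⟩ := Finset.mem_filter.1 hp
      obtain ⟨x₀, hxA, hxc⟩ := hTmeet p hpT
      have hrp := hrpos p hpT
      have hc1 : |x₀ - c p| ≤ r p.1 / 2 := by
        simp only [hcdef]; rw [abs_le]; constructor <;> nlinarith [hxc.1, hxc.2]
      have hn15 : p.1 ≤ 15 := by
        by_contra h
        push Not at h
        have h16 : 16 ≤ p.1 := h
        have hr4 := hr16 p.1 h16
        -- `|x₀| ≤ |ξ| + |ξ - c| + |c - x₀| ≤ 2 + (3/2) r ≤ 2 + (3/8) 2^n < 2^n`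
        have h1 : |x₀| ≤ |ξ| + |ξ - c p| + |x₀ - c p| := by
          have := abs_sub_abs_le_abs_sub x₀ ξ
          have := abs_sub_le x₀ (c p) ξ
          rw [abs_sub_comm (c p) ξ] at this
          linarith
        have h2 : (2 : ℝ) ^ 16 ≤ 2 ^ p.1 := pow_le_pow_right₀ (by norm_num) h16
        nlinarith [hxA.1]
      calc r p.1 * χ ((ξ - c p) / r p.1) ≤ r p.1 := scaledCutoff_le hχ1 hrp _ _
        _ ≤ 2 ^ p.1 := hrle p hpT
        _ ≤ 2 ^ 15 := pow_le_pow_right₀ (by norm_num) hn15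
    have hcard : ((T.filter fun p => |ξ - c p| ≤ r p.1).card : ℝ) ≤ 51 := by
      exact_mod_cast card_near_le hr16 hrpos hT1 hTmeet ξ
    calc ∑ p ∈ T.filter (fun p => |ξ - c p| ≤ r p.1), r p.1 * χ ((ξ - c p) / r p.1)
        ≤ ∑ _p ∈ T.filter (fun p => |ξ - c p| ≤ r p.1), (2 : ℝ) ^ 15 := Finset.sum_le_sum hsmall
      _ = ((T.filter fun p => |ξ - c p| ≤ r p.1).card : ℝ) * 2 ^ 15 := by
          rw [Finset.sum_const, nsmul_eq_mul]
      _ ≤ 51 * 2 ^ 15 := by nlinarith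
  -- the derivative
  set g : ℕ × ℤ → ℝ → ℝ := fun p ξ => deriv χ ((ξ - c p) / r p.1) with hgdef
  have hderivΩ : ∀ ξ, HasDerivAt Ω (∑ p ∈ T, g p ξ) ξ := fun ξ =>
    hasDerivAt_sum_scaledCutoff hχd T c (fun p => r p.1) hrne ξ
  have hD : deriv Ω = fun ξ => ∑ p ∈ T, g p ξ := funext fun ξ => (hderivΩ ξ).deriv
  -- properties of the pieces `g p`
  have hχ'c : Continuous (deriv χ) := hχC1.continuous_deriv le_rfl
  have hg_cont : ∀ p ∈ T, Continuous (g p) := fun p hp => hχ'c.comp (by fun_prop)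
  have hg_bd : ∀ p u, |g p u| ≤ B₁ := fun p u => hB₁ _
  have hg_lip : ∀ p ∈ T, ∀ u v, |g p u - g p v| ≤ B₂ / r p.1 * |u - v| := by
    intro p hp u v
    have hrp := hrpos p hp
    calc |g p u - g p v| = |deriv χ ((u - c p) / r p.1) - deriv χ ((v - c p) / r p.1)| := rfl
      _ ≤ B₂ * |(u - c p) / r p.1 - (v - c p) / r p.1| := hLip₂ _ _
      _ = B₂ / r p.1 * |u - v| := by
          rw [← sub_div, abs_div, abs_of_pos hrp, show u - c p - (v - c p) = u - v by ring]
          field_simp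
  have hg_supp : ∀ p ∈ T, ∀ u, r p.1 < |u - c p| → g p u = 0 := by
    intro p hp u hu
    have hrp := hrpos p hp
    refine deriv_eq_zero_of_one_lt_abs hχzero ?_
    rw [abs_div, abs_of_pos hrp, lt_div_iff₀ hrp, one_mul]
    exact hu
  have hg_mean : ∀ p ∈ T, ∫ u, g p u = 0 := fun p hp =>
    integral_deriv_scaledCutoff_eq_zero hχC1 hχsupp (hrne p hp) (c p)
  -- the Hilbert bound
  have hHil : ∀ x, |π⁻¹ * ((∫ u in Ioo (-1 : ℝ) 1, (deriv Ω (x - u) - deriv Ω x) / u) +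
      ∫ u in {u : ℝ | 1 ≤ |u|}, deriv Ω (x - u) / u)| ≤ Khil := by
    intro x
    rw [hD]
    simp only
    rw [hilbertPV_finset_sum T g hg_cont
      (fun p hp => ⟨B₂ / r p.1, div_nonneg hB₂0 (hrpos p hp).le, hg_lip p hp⟩)
      (fun p hp => ⟨|c p| + r p.1, B₁, fun u hu => hg_supp p hp u (by
        have := abs_sub_abs_le_abs_sub u (c p); linarith), hg_bd p⟩) x]
    rw [abs_mul, abs_of_pos (inv_pos.2 Real.pi_pos), hKhil]
    refine mul_le_mul_of_nonneg_left ?_ (by positivity)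
    calc |∑ p ∈ T, ((∫ u in Ioo (-1 : ℝ) 1, (g p (x - u) - g p x) / u) +
            ∫ u in {u : ℝ | 1 ≤ |u|}, g p (x - u) / u)|
        ≤ ∑ p ∈ T, |(∫ u in Ioo (-1 : ℝ) 1, (g p (x - u) - g p x) / u) +
            ∫ u in {u : ℝ | 1 ≤ |u|}, g p (x - u) / u| := Finset.abs_sum_le_sum_abs _ _
      _ ≤ ∑ p ∈ T, 10 * (B₁ + B₂) / (1 + ((x - c p) / r p.1) ^ 2) :=
          Finset.sum_le_sum fun p hp => abs_hilbertPV_le_of_localized (hg_cont p hp) (hg_lip p hp)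
            (hrpos p hp) hB₂0 (hg_supp p hp) (hg_bd p) (hg_mean p hp) x
      _ = 10 * (B₁ + B₂) * ∑ p ∈ T, 1 / (1 + ((x - c p) / r p.1) ^ 2) := by
          rw [Finset.mul_sum]
          refine Finset.sum_congr rfl fun p _ => ?_
          rw [mul_one_div]
      _ ≤ 10 * (B₁ + B₂) * Ksum := by
          refine mul_le_mul_of_nonneg_left ?_ (by positivity)
          exact sum_inv_one_add_sq_cover_le hY hC hδ0 hδ1 T hT hSF x
  -- decay on `Y`
  have hY_bound : ∀ ξ ∈ Y, Real.log (10 + |ξ|) ^ (-(1 + δ) / 2) * |ξ| ≤ 10 * Ω ξ + 2 := by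
    intro ξ hξY
    by_cases h2 : |ξ| ≤ 2
    · have := theta_mul_abs_le_two (δ := δ) (by linarith) h2
      have := hΩ0 ξ
      linarith
    · have h2' : 2 < |ξ| := lt_of_not_ge h2
      obtain ⟨n, hn1, hn2⟩ := exists_nat_pow_near (x := |ξ|) (y := (2 : ℝ)) (by linarith) one_lt_two
      have hn : 1 ≤ n := by
        rcases Nat.eq_zero_or_pos n with h | h
        · rw [h] at hn2; norm_num at hn2; linarith
        · exact h
      have hξα : |ξ| ≤ α₁ := abs_le.2 (hYsub hξY)
      have hnα : (2 : ℝ) ^ n ≤ α₁ := hn1.trans hξα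
      have hrn : 0 < r n := scale_pos hδ1.le hn
      obtain ⟨j, hj1, hj2⟩ : ∃ j : ℤ, (j : ℝ) ≤ ξ / r n ∧ ξ / r n < j + 1 :=
        ⟨⌊ξ / r n⌋, Int.floor_le _, Int.lt_floor_add_one _⟩
      have hxc : r n * j ≤ ξ ∧ ξ ≤ r n * (j + 1) := by
        rw [le_div_iff₀ hrn] at hj1
        rw [div_lt_iff₀ hrn] at hj2
        constructor <;> nlinarith
      have hxA : (2 : ℝ) ^ n ≤ |ξ| ∧ |ξ| ≤ 2 ^ (n + 1) := ⟨hn1, hn2.le⟩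
      have hmem : (n, j) ∈ T := hTcomplete n j hn hnα ξ hξY hxA hxc
      have hnear : |ξ - c (n, j)| ≤ r n / 2 := by
        simp only [hcdef]
        rw [abs_le]; constructor <;> nlinarith [hxc.1, hxc.2]
      have hone : r n * χ ((ξ - c (n, j)) / r n) = r n := scaledCutoff_eq_self hχone hrn hnear
      have hsingle : r n ≤ ∑ p ∈ T, r p.1 * χ ((ξ - c p) / r p.1) := by
        have := Finset.single_le_sum (f := fun p : ℕ × ℤ => r p.1 * χ ((ξ - c p) / r p.1))
          (fun p hp => scaledCutoff_nonneg hχ0 (hrpos p hp) _ _) hmem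
        simpa only [hone] using this
      have hθ := theta_mul_abs_le_scale hδ0.le hδ1.le hn hn1 hn2.le
      simp only [hΩdef, hrdef] at hsingle ⊢
      linarith
  refine ⟨Ω, hΩC, hΩsupp, hΩ0, fun ξ hξ => (hΩnear ξ hξ).trans (by linarith),
    fun x => (hHil x).trans (by linarith), hY_bound⟩

end Weight

end Literature.Analysis.Fourier

/-!
## Part 4. Bourgain–Dyatlov Lemma 3.1 (the adapted multiplier), unconditionally

Topic `Literature/Analysis/Fourier`. J. Bourgain, S. Dyatlov, *Spectral gaps without the pressure
condition*, Ann. of Math. 187 (2018), Lemma 3.1: for `0 < δ < 1`, `C_R ≥ 1`, `c₁ > 0` there is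
`c₂ > 0` such that for every `α₁` and every `Y ⊂ [-α₁, α₁]` `δ`-regular with constant `C_R` on
scales `2` to `α₁` there is `ψ ∈ L²`, `supp ψ ⊂ [-c₁/10, c₁/10]`, with `‖ψ̂‖_{L²(-1,1)} ≥ c₂`,
`|ψ̂(ξ)| ≤ exp(-c₂⟨ξ⟩^{1/2})` on `ℝ` and `|ψ̂(ξ)| ≤ exp(-c₂ θ(ξ)|ξ|)` on `Y`,
`θ(ξ) = log(10+|ξ|)^{-(1+δ)/2}`. The paper derives this from the Beurling–Malliavin multiplier
theorem (its Theorem 5 / Lemma 2.11); here it is PROVED without that input, by combining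

* `exists_adaptedWeight_hilbert` (`AdaptedWeightHilbert.lean`, after Jin–Zhang Lemma 13): the
  cover weight `Ω` adapted to `Y` has a Lipschitz modified Hilbert transform, uniformly in `α₁`;
* `effective_multiplier` (`EffectiveMultiplier.lean`, after Jin–Zhang Theorem 12): such weights
  are majorised by `|ψ̂|` for a compactly supported `ψ`, explicitly.

The statement `bd18_lemma_3_1` has exactly the shape of the conclusion of the conditional
`bd18_lemma_3_1_of_multiplierTheorem` (`AdaptedMultiplierOfBM.lean`), without its hypothesis `hBM`.
[cite: BourgainDyatlov2018, Lemma 3.1] [cite: JinZhang2017, Lemma 13 and Theorem 12]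
No definitions are introduced.
-/

namespace Literature.Analysis.Fourier

open _root_.MeasureTheory Set Filter
open scoped FourierTransform Real Topology

section Lemma31

/-- Scaling a function scales its Fourier integral. [folklore] -/
theorem fourier_const_mul (ψ : ℝ → ℂ) (r : ℂ) (ξ : ℝ) :
    𝓕 (fun x : ℝ => r * ψ x) ξ = r * 𝓕 ψ ξ := by
  have h := VectorFourier.fourierIntegral_const_smul Real.fourierChar (volume : Measure ℝ) (innerₗ ℝ) ψ r
  have h1 : (fun x : ℝ => r * ψ x) = r • ψ := by funext x; simp [smul_eq_mul]
  rw [h1]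
  change VectorFourier.fourierIntegral Real.fourierChar volume (innerₗ ℝ) (r • ψ) ξ =
    r * VectorFourier.fourierIntegral Real.fourierChar volume (innerₗ ℝ) ψ ξ
  rw [h]
  rfl

/-- The polynomial-times-exponential prefactor is bounded: for `b > 0`,
`(3|ξ|+3)² exp(-b (1+ξ²)^{1/4}) ≤ 432/b⁴`. [folklore] -/
theorem poly_mul_exp_quarter_le {b : ℝ} (hb : 0 < b) (ξ : ℝ) :
    (3 * |ξ| + 3) ^ 2 * Real.exp (-(b * (1 + ξ ^ 2) ^ (1 / 4 : ℝ))) ≤ 432 / b ^ 4 := by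
  have hw : 0 < (1 + ξ ^ 2) ^ (1 / 4 : ℝ) := Real.rpow_pos_of_pos (by positivity) _
  have h1 : Real.exp (-(b * (1 + ξ ^ 2) ^ (1 / 4 : ℝ))) ≤
      ((4 : ℕ).factorial : ℝ) / (b * (1 + ξ ^ 2) ^ (1 / 4 : ℝ)) ^ 4 := by
    set u : ℝ := b * (1 + ξ ^ 2) ^ (1 / 4 : ℝ) with hu
    have hu0 : 0 < u := by positivity
    have h := Real.pow_div_factorial_le_exp u hu0.le 4
    rw [Real.exp_neg, inv_eq_one_div, div_le_div_iff₀ (Real.exp_pos u) (by positivity), one_mul]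
    rw [div_le_iff₀ (by positivity)] at h
    linarith
  have hw4 : ((1 + ξ ^ 2) ^ (1 / 4 : ℝ)) ^ 4 = 1 + ξ ^ 2 := by
    rw [← Real.rpow_natCast ((1 + ξ ^ 2) ^ (1 / 4 : ℝ)) 4, ← Real.rpow_mul (by positivity)]
    norm_num
  have h2 : Real.exp (-(b * (1 + ξ ^ 2) ^ (1 / 4 : ℝ))) ≤ 24 / (b ^ 4 * (1 + ξ ^ 2)) := by
    refine h1.trans (le_of_eq ?_)
    rw [mul_pow, hw4]
    norm_num [Nat.factorial]
  have h3 : (3 * |ξ| + 3) ^ 2 ≤ 18 * (1 + ξ ^ 2) := by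
    have : ξ ^ 2 = |ξ| ^ 2 := (sq_abs ξ).symm
    nlinarith [abs_nonneg ξ, sq_nonneg (|ξ| - 1)]
  have hx2 : 0 < 1 + ξ ^ 2 := by positivity
  calc (3 * |ξ| + 3) ^ 2 * Real.exp (-(b * (1 + ξ ^ 2) ^ (1 / 4 : ℝ)))
      ≤ 18 * (1 + ξ ^ 2) * (24 / (b ^ 4 * (1 + ξ ^ 2))) :=
        mul_le_mul h3 h2 (Real.exp_pos _).le (by positivity)
    _ = 432 / b ^ 4 := by field_simp; ring

set_option maxHeartbeats 800000 in
/-- **BD18 Lemma 3.1, proved** (no Beurling–Malliavin): for `0 < δ < 1`, `C_R ≥ 1`, `c₁ > 0` there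
is `0 < c₂ ≤ 1` such that every `Y ⊂ [-α₁, α₁]` which is `δ`-regular with constant `C_R` on scales `2`
to `α₁` carries `ψ ∈ L¹ ∩ L²` with `ψ = 0` off `[-c₁/10, c₁/10]`, `‖ψ̂‖²_{L²([-1,1])} ≥ c₂²`,
`|ψ̂(ξ)| ≤ exp(-c₂⟨ξ⟩^{1/2})` and `|ψ̂(ξ)| ≤ exp(-c₂ θ(ξ)|ξ|)` on `Y`.
[cite: BourgainDyatlov2018, Lemma 3.1] -/
theorem bd18_lemma_3_1 {δ C_R c₁ : ℝ} (hδ0 : 0 < δ) (hδ1 : δ < 1) (hC : 1 ≤ C_R) (hc₁ : 0 < c₁) :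
    ∃ c₂ : ℝ, 0 < c₂ ∧ c₂ ≤ 1 ∧ ∀ (α₁ : ℝ) (Y : Set ℝ), Y ⊆ Icc (-α₁) α₁ → IsRegularSet Y δ C_R 2 α₁ →
      ∃ ψ : ℝ → ℂ, Integrable ψ ∧ MemLp ψ 2 volume ∧ (∀ x, c₁ / 10 < |x| → ψ x = 0) ∧
        c₂ ^ 2 ≤ ∫ ξ in Icc (-1 : ℝ) 1, ‖(𝓕 ψ : ℝ → ℂ) ξ‖ ^ 2 ∧
        (∀ ξ, ‖(𝓕 ψ : ℝ → ℂ) ξ‖ ≤ Real.exp (-(c₂ * (1 + ξ ^ 2) ^ (1 / 4 : ℝ)))) ∧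
        ∀ ξ ∈ Y, ‖(𝓕 ψ : ℝ → ℂ) ξ‖ ≤
          Real.exp (-(c₂ * (Real.log (10 + |ξ|) ^ (-(1 + δ) / 2) * |ξ|))) := by
  have hπ := Real.pi_pos
  -- the weight constant and the multiplier constants
  obtain ⟨K₀, hK₀, hweight⟩ := exists_adaptedWeight_hilbert hδ0 hδ1 hC
  set σ : ℝ := min (c₁ / 10) (1 / 40) with hσ
  have hσ0 : 0 < σ := lt_min (by positivity) (by norm_num)
  have hσ1 : σ ≤ 1 / 40 := min_le_right _ _
  have hσc₁ : σ ≤ c₁ / 10 := min_le_left _ _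
  obtain ⟨c, Cup, clow, hc0, hCup, hclow, hmult⟩ := effective_multiplier σ K₀ K₀ hσ0 hσ1 hK₀.le
  -- constants
  set c' : ℝ := min c (π * σ) with hc'
  have hc'0 : 0 < c' := lt_min hc0 (by positivity)
  have hc'c : c' ≤ c := min_le_left _ _
  have hc'σ : c' ≤ π * σ := min_le_right _ _
  set b : ℝ := π * σ / 4 with hb
  have hb0 : 0 < b := by positivity
  set D₀ : ℝ := 432 / b ^ 4 with hD₀
  have hD₀0 : 0 < D₀ := by positivity
  set lam : ℝ := 1 / (Cup * D₀) with hlam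
  have hlam0 : 0 < lam := by positivity
  have hlamD : lam * Cup * D₀ = 1 := by rw [hlam]; field_simp
  set c₂ : ℝ := min (min b (c' / 10)) (lam * Real.sqrt clow) with hc₂
  have hc₂0 : 0 < c₂ := lt_min (lt_min hb0 (by positivity)) (by positivity)
  have hc₂b : c₂ ≤ b := (min_le_left _ _).trans (min_le_left _ _)
  have hc₂c : c₂ ≤ c' / 10 := (min_le_left _ _).trans (min_le_right _ _)
  have hc₂l : c₂ ≤ lam * Real.sqrt clow := min_le_right _ _
  have hc₂1 : c₂ ≤ 1 := by
    refine hc₂b.trans ?_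
    rw [hb]; nlinarith [Real.pi_le_four, hσ1, hσ0]
  refine ⟨c₂, hc₂0, hc₂1, fun α₁ Y hYsub hY => ?_⟩
  -- the weight and the raw multiplier
  obtain ⟨Ω, hΩC, hΩs, hΩ0, hΩK, hΩH, hΩY⟩ := hweight α₁ Y hYsub hY
  obtain ⟨ψ, hψi, hψ2, hψsupp, hψup, hψlow⟩ := hmult Ω hΩC hΩs hΩ0 hΩK hΩH
  -- the rescaled multiplier
  set ψ' : ℝ → ℂ := fun x => (lam : ℂ) * ψ x with hψ'
  have hF : ∀ ξ, 𝓕 ψ' ξ = (lam : ℂ) * 𝓕 ψ ξ := fun ξ => fourier_const_mul ψ lam ξ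
  have hFn : ∀ ξ, ‖𝓕 ψ' ξ‖ = lam * ‖𝓕 ψ ξ‖ := fun ξ => by
    rw [hF, norm_mul, Complex.norm_real, Real.norm_eq_abs, abs_of_pos hlam0]
  -- the common bound `λ ‖ψ̂(ξ)‖ ≤ exp(-b w) exp(-c Ω)`, `w = (1+ξ²)^{1/4}`
  have hcommon : ∀ ξ, lam * ‖𝓕 ψ ξ‖ ≤
      Real.exp (-(b * (1 + ξ ^ 2) ^ (1 / 4 : ℝ))) * Real.exp (-(c * Ω ξ)) := by
    intro ξ
    have h1 := hψup ξ
    have hpoly := poly_mul_exp_quarter_le hb0 ξ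
    have hsplit : Real.exp (-(π * σ / 2) * (1 + ξ ^ 2) ^ (1 / 4 : ℝ)) =
        Real.exp (-(b * (1 + ξ ^ 2) ^ (1 / 4 : ℝ))) * Real.exp (-(b * (1 + ξ ^ 2) ^ (1 / 4 : ℝ))) := by
      rw [← Real.exp_add]; congr 1; rw [hb]; ring
    have hE0 : 0 < Real.exp (-(b * (1 + ξ ^ 2) ^ (1 / 4 : ℝ))) := Real.exp_pos _
    have hΩe : 0 < Real.exp (-(c * Ω ξ)) := Real.exp_pos _
    calc lam * ‖𝓕 ψ ξ‖ ≤ lam * (Cup * (3 * |ξ| + 3) ^ 2 * Real.exp (-(π * σ / 2) * (1 + ξ ^ 2) ^ (1 / 4 : ℝ)) *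
          Real.exp (-(c * Ω ξ))) := mul_le_mul_of_nonneg_left h1 hlam0.le
      _ = (lam * Cup * ((3 * |ξ| + 3) ^ 2 * Real.exp (-(b * (1 + ξ ^ 2) ^ (1 / 4 : ℝ))))) *
          (Real.exp (-(b * (1 + ξ ^ 2) ^ (1 / 4 : ℝ))) * Real.exp (-(c * Ω ξ))) := by rw [hsplit]; ring
      _ ≤ (lam * Cup * D₀) * (Real.exp (-(b * (1 + ξ ^ 2) ^ (1 / 4 : ℝ))) * Real.exp (-(c * Ω ξ))) := by
          refine mul_le_mul_of_nonneg_right ?_ (by positivity)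
          exact mul_le_mul_of_nonneg_left hpoly (by positivity)
      _ = Real.exp (-(b * (1 + ξ ^ 2) ^ (1 / 4 : ℝ))) * Real.exp (-(c * Ω ξ)) := by rw [hlamD, one_mul]
  refine ⟨ψ', hψi.const_mul _, hψ2.const_mul _, ?_, ?_, ?_, ?_⟩
  · -- support
    intro x hx
    rw [hψ']; simp only
    rw [hψsupp x (lt_of_le_of_lt hσc₁ hx), mul_zero]
  · -- lower bound
    have h1 : ∫ ξ in Icc (-1 : ℝ) 1, ‖𝓕 ψ' ξ‖ ^ 2 = lam ^ 2 * ∫ ξ in Icc (-1 : ℝ) 1, ‖𝓕 ψ ξ‖ ^ 2 := by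
      rw [← integral_const_mul]
      refine integral_congr_ae (ae_of_all _ fun ξ => ?_)
      show ‖𝓕 ψ' ξ‖ ^ 2 = lam ^ 2 * ‖𝓕 ψ ξ‖ ^ 2
      rw [hFn]; ring
    rw [h1]
    have h2 : c₂ ^ 2 ≤ (lam * Real.sqrt clow) ^ 2 := pow_le_pow_left₀ hc₂0.le hc₂l 2
    rw [mul_pow, Real.sq_sqrt hclow.le] at h2
    have h3 := mul_le_mul_of_nonneg_left hψlow (sq_nonneg lam)
    linarith
  · -- global decay
    intro ξ
    rw [hFn]
    refine (hcommon ξ).trans ?_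
    have h1 : Real.exp (-(c * Ω ξ)) ≤ 1 := by
      rw [Real.exp_le_one_iff, neg_nonpos]; exact mul_nonneg hc0.le (hΩ0 ξ)
    have hw0 : 0 ≤ (1 + ξ ^ 2) ^ (1 / 4 : ℝ) := Real.rpow_nonneg (by positivity) _
    have hbw := mul_le_mul_of_nonneg_right hc₂b hw0
    calc Real.exp (-(b * (1 + ξ ^ 2) ^ (1 / 4 : ℝ))) * Real.exp (-(c * Ω ξ))
        ≤ Real.exp (-(b * (1 + ξ ^ 2) ^ (1 / 4 : ℝ))) * 1 := mul_le_mul_of_nonneg_left h1 (Real.exp_pos _).le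
      _ ≤ Real.exp (-(c₂ * (1 + ξ ^ 2) ^ (1 / 4 : ℝ))) := by
          rw [mul_one, Real.exp_le_exp]; linarith
  · -- decay on `Y`
    intro ξ hξY
    rw [hFn]
    refine (hcommon ξ).trans ?_
    set θ : ℝ := Real.log (10 + |ξ|) ^ (-(1 + δ) / 2) * |ξ| with hθ
    have hθ0 : 0 ≤ θ := by
      rw [hθ]; exact mul_nonneg (Real.rpow_nonneg (Real.log_nonneg (by linarith [abs_nonneg ξ])) _) (abs_nonneg _)
    have hY1 : θ ≤ 10 * Ω ξ + 2 := hΩY ξ hξY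
    -- `exp(-cΩ) ≤ exp(-c'Ω) ≤ exp(c'/5) exp(-(c'/10) θ)`
    have h1 : Real.exp (-(c * Ω ξ)) ≤ Real.exp (c' / 5) * Real.exp (-(c' / 10 * θ)) := by
      rw [← Real.exp_add, Real.exp_le_exp]
      have h4 := mul_le_mul_of_nonneg_left hY1 (show (0 : ℝ) ≤ c' / 10 by positivity)
      have h5 := mul_le_mul_of_nonneg_right hc'c (hΩ0 ξ)
      linarith
    -- `exp(-b w) ≤ exp(-b)` since `w ≥ 1`
    have hw1 : 1 ≤ (1 + ξ ^ 2) ^ (1 / 4 : ℝ) :=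
      Real.one_le_rpow (by nlinarith [sq_nonneg ξ]) (by norm_num)
    have h2 : Real.exp (-(b * (1 + ξ ^ 2) ^ (1 / 4 : ℝ))) ≤ Real.exp (-b) := by
      rw [Real.exp_le_exp]
      have h6 := mul_le_mul_of_nonneg_left hw1 hb0.le
      linarith
    have h3 : c' / 5 ≤ b := by rw [hb]; linarith
    calc Real.exp (-(b * (1 + ξ ^ 2) ^ (1 / 4 : ℝ))) * Real.exp (-(c * Ω ξ))
        ≤ Real.exp (-b) * (Real.exp (c' / 5) * Real.exp (-(c' / 10 * θ))) :=
          mul_le_mul h2 h1 (Real.exp_pos _).le (Real.exp_pos _).le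
      _ = Real.exp (-b + c' / 5) * Real.exp (-(c' / 10 * θ)) := by rw [Real.exp_add]; ring
      _ ≤ 1 * Real.exp (-(c₂ * θ)) := by
          refine mul_le_mul ?_ ?_ (Real.exp_pos _).le zero_le_one
          · rw [Real.exp_le_one_iff]; linarith
          · rw [Real.exp_le_exp]
            have h7 := mul_le_mul_of_nonneg_right hc₂c hθ0
            linarith
      _ = Real.exp (-(c₂ * (Real.log (10 + |ξ|) ^ (-(1 + δ) / 2) * |ξ|))) := by rw [one_mul]

end Lemma31

end Literature.Analysis.Fourier

/-!
## Part 5. BD18 Proposition 3.1 ("the iterative step") from Lemmas 3.1, 3.2 and 3.3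

Topic `Literature/Analysis/Fourier`. J. Bourgain, S. Dyatlov, *Spectral gaps without the pressure
condition*, Ann. of Math. 187 (2018), §3.3, proof of Proposition 3.1 (see also Jin–Zhang,
arXiv:1710.00250, Theorem 16). We derive the statement of Proposition 3.1 in the `g`-language of
`FractalUncertaintyReduction.lean` (the hypothesis `H` of `bourgainDyatlov2018_thm4_of_prop31`:
`c₃ ‖h‖² ≤ ∫_{U'} |𝓕⁻h|²` for `h ∈ L¹ ∩ L²` vanishing off a `δ`-regular `Y ⊂ [-α₁, α₁]`) from

* the conclusion of Lemma 3.1 (the adapted multiplier), taken as the hypothesis `hL31`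
  (it is proved, without Beurling–Malliavin, in `AdaptedMultiplier.lean`);
* Lemma 3.2 (`bourgainDyatlov2018_lemma_3_2`, `FractalUncertaintyHarmonicBound.lean`);
* the weighted form of Lemma 3.3 (`weighted_step`, `FractalUncertaintyWeightedStep.lean`).

The proof is the paper's: for each frequency shift `ℓ ∈ ℤ`, `|ℓ| ≤ ⌈α₁⌉ + 1`, the set
`Z_ℓ(2) = (Y + ℓ) + [-2, 2]` is `δ`-regular with constant `160 C_R` on scales `2` to `4α₁`
(`affine_image`, `neighbourhood`, `mono_upper_scale`), Lemma 3.1 gives a multiplier `ψ_ℓ`, and the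
weighted smaller step bounds `∫ |ψ̂_ℓ(ξ) h(ξ - ℓ - η)|² dξ` for every `η ∈ [-2, 2]`. Averaging in
`η` and summing in `ℓ` (the lower bound uses `‖ψ̂_ℓ‖_{L²(-1,1)} ≥ c₂` and Tonelli; the upper bound
uses the finite-family `L²` bound `sum_setLIntegral_sq_convolution_le` for the window terms and
the lattice sums `∑_ℓ e^{-c₂⟨ζ+ℓ⟩^{1/2}} ≤ B` for the weighted norms, which replace the `H^{-10}`
norms of the paper), the Young splitting `rpow_mul_rpow_le` and the choice of `K`
(`exists_threshold`) give `c₃ ‖h‖² ≤ ‖𝓕⁻h‖²_{L²(U')}`.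

* `bd18_prop31_of_lemma31` — Proposition 3.1 (hypothesis `H` of
  `bourgainDyatlov2018_thm4_of_prop31`) from the conclusion of Lemma 3.1.

No definitions are introduced.
-/

namespace Literature.Analysis.Fourier

open _root_.MeasureTheory Set Filter
open scoped FourierTransform Real Topology ENNReal Convolution Pointwise

section Prop31Assembly

/-! ### Elementary measure-theoretic lemmas -/

/-- Shifted windows: for `|ξ| ≤ 1`, `∫_{[-a-1,-a+1]} g ≤ ∫_{η ∈ [-2,2]} g(ξ - (a + η)) dη`
(change of variables `ζ = ξ - a - η`). [folklore] -/
theorem lintegral_Icc_le_lintegral_shift (g : ℝ → ℝ≥0∞) {ξ : ℝ} (hξ : ξ ∈ Icc (-1 : ℝ) 1)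
    (a : ℝ) :
    ∫⁻ ζ in Icc (-a - 1) (-a + 1), g ζ ≤ ∫⁻ η in Icc (-2 : ℝ) 2, g (ξ - (a + η)) := by
  have h1 : ∫⁻ η in Icc (-2 : ℝ) 2, g (ξ - (a + η)) =
      ∫⁻ η, (Icc (ξ - a - 2) (ξ - a + 2)).indicator g ((ξ - a) - η) := by
    rw [← lintegral_indicator measurableSet_Icc]
    congr 1
    funext η
    by_cases hη : η ∈ Icc (-2 : ℝ) 2
    · rw [indicator_of_mem hη, indicator_of_mem, show ξ - (a + η) = ξ - a - η by ring]
      simp only [mem_Icc] at hη ⊢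
      constructor <;> linarith [hη.1, hη.2]
    · rw [indicator_of_notMem hη, indicator_of_notMem]
      intro hmem
      apply hη
      simp only [mem_Icc] at hmem ⊢
      constructor <;> linarith [hmem.1, hmem.2]
  rw [h1, lintegral_sub_left_eq_self (fun ζ => (Icc (ξ - a - 2) (ξ - a + 2)).indicator g ζ) (ξ - a),
    lintegral_indicator measurableSet_Icc]
  refine lintegral_mono_set fun ζ hζ => ?_
  simp only [mem_Icc] at hζ hξ ⊢
  constructor <;> linarith [hζ.1, hζ.2, hξ.1, hξ.2]

/-- The windows `[-ℓ-1, -ℓ+1]`, `|ℓ| ≤ ⌈α₁⌉ + 1`, cover `[-α₁, α₁]` (with multiplicity), in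
integrated form. [folklore] -/
theorem lintegral_Icc_le_sum_windows (α₁ : ℝ) (g : ℝ → ℝ≥0∞) :
    ∫⁻ ζ in Icc (-α₁) α₁, g ζ ≤
      ∑ ℓ ∈ Finset.Icc (-(⌈α₁⌉₊ : ℤ) - 1) (⌈α₁⌉₊ + 1),
        ∫⁻ ζ in Icc (-(ℓ : ℝ) - 1) (-(ℓ : ℝ) + 1), g ζ := by
  set Λ : Finset ℤ := Finset.Icc (-(⌈α₁⌉₊ : ℤ) - 1) (⌈α₁⌉₊ + 1) with hΛ
  have hN : α₁ ≤ (⌈α₁⌉₊ : ℝ) := Nat.le_ceil α₁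
  have hcov : Icc (-α₁) α₁ ⊆ ⋃ ℓ : Λ, Icc (-((ℓ : ℤ) : ℝ) - 1) (-((ℓ : ℤ) : ℝ) + 1) := by
    intro ζ hζ
    simp only [mem_Icc] at hζ
    have hfl : (⌊ζ⌋ : ℝ) ≤ ζ := Int.floor_le ζ
    have hfl' : ζ < ⌊ζ⌋ + 1 := Int.lt_floor_add_one ζ
    have hmem : -⌊ζ⌋ ∈ Λ := by
      rw [hΛ, Finset.mem_Icc]
      have h1 : (⌊ζ⌋ : ℝ) ≤ ⌈α₁⌉₊ := by linarith
      have h2 : (-(⌈α₁⌉₊ : ℝ) - 1) ≤ ⌊ζ⌋ := by linarith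
      have h1' : ⌊ζ⌋ ≤ (⌈α₁⌉₊ : ℤ) := by exact_mod_cast h1
      have h2' : -(⌈α₁⌉₊ : ℤ) - 1 ≤ ⌊ζ⌋ := by exact_mod_cast h2
      constructor <;> omega
    refine mem_iUnion.2 ⟨⟨-⌊ζ⌋, hmem⟩, ?_⟩
    simp only [Int.cast_neg, neg_neg, mem_Icc]
    constructor <;> linarith
  calc ∫⁻ ζ in Icc (-α₁) α₁, g ζ
      ≤ ∫⁻ ζ in ⋃ ℓ : Λ, Icc (-((ℓ : ℤ) : ℝ) - 1) (-((ℓ : ℤ) : ℝ) + 1), g ζ :=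
        lintegral_mono_set hcov
    _ ≤ ∑' ℓ : Λ, ∫⁻ ζ in Icc (-((ℓ : ℤ) : ℝ) - 1) (-((ℓ : ℤ) : ℝ) + 1), g ζ :=
        lintegral_iUnion_le _ _
    _ = ∑ ℓ ∈ Λ, ∫⁻ ζ in Icc (-(ℓ : ℝ) - 1) (-(ℓ : ℝ) + 1), g ζ := by
        rw [tsum_fintype, Finset.sum_coe_sort Λ
          (fun ℓ : ℤ => ∫⁻ ζ in Icc (-(ℓ : ℝ) - 1) (-(ℓ : ℝ) + 1), g ζ)]

/-- `∫⁻ ‖z‖ₑ² = ofReal (∫ ‖z‖²)` for a square-integrable function. [folklore] -/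
theorem lintegral_enorm_sq_eq_ofReal {g : ℝ → ℂ} {μ : Measure ℝ}
    (hg : Integrable (fun ξ => ‖g ξ‖ ^ 2) μ) :
    ∫⁻ ξ, ‖g ξ‖ₑ ^ 2 ∂μ = ENNReal.ofReal (∫ ξ, ‖g ξ‖ ^ 2 ∂μ) := by
  rw [ofReal_integral_eq_lintegral_ofReal hg (ae_of_all _ fun ξ => by positivity)]
  congr 1
  funext ξ
  exact Prop31.enorm_sq_eq_ofReal (g ξ)

/-- A real set integral of a nonnegative function is bounded by the `toReal` of the whole-line
lower Lebesgue integral, when the latter is finite. [folklore] -/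
theorem setIntegral_norm_sq_le_toReal_lintegral {G : ℝ → ℂ} (hG : AEStronglyMeasurable G volume)
    (U : Set ℝ) (hfin : ∫⁻ x, ‖G x‖ₑ ^ 2 ≠ ∞) :
    ∫ x in U, ‖G x‖ ^ 2 ≤ (∫⁻ x, ‖G x‖ₑ ^ 2).toReal := by
  have hm : AEStronglyMeasurable (fun x => ‖G x‖ ^ 2) (volume.restrict U) :=
    (hG.norm.pow 2).restrict
  rw [integral_eq_lintegral_of_nonneg_ae (ae_of_all _ fun x => by positivity) hm]
  refine ENNReal.toReal_mono hfin ?_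
  calc ∫⁻ x in U, ENNReal.ofReal (‖G x‖ ^ 2) = ∫⁻ x in U, ‖G x‖ₑ ^ 2 := by
        congr 1; funext x; exact (Prop31.enorm_sq_eq_ofReal (G x)).symm
    _ ≤ ∫⁻ x, ‖G x‖ₑ ^ 2 := setLIntegral_le_lintegral _ _

/-! ### The finite-family bound on the whole line -/

/-- The convolution of an integrable function with an a.e. strongly measurable one is
a.e. strongly measurable. [folklore] -/
theorem aestronglyMeasurable_convolution {u F : ℝ → ℂ} (hu : Integrable u)
    (hF : AEStronglyMeasurable F volume) :
    AEStronglyMeasurable (u ⋆[ContinuousLinearMap.mul ℂ ℂ, volume] F) volume :=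
  (hu.aestronglyMeasurable.convolution_integrand (ContinuousLinearMap.mul ℂ ℂ) hF).integral_prod_right'

/-- **The finite-family `L²` bound on the whole line.** Under the hypotheses of
`Prop31.sum_setLIntegral_sq_convolution_le` (`u_i ∈ L¹` vanishing off `[-1,1]`, `∑ |û_i|² ≤ B`,
`F ∈ L²` bounded): `∑_i ∫ |u_i ⋆ F|² ≤ B ∫ |F|²` (monotone convergence over the windows `[-n, n]`).
[folklore] -/
theorem sum_lintegral_sq_convolution_le {ι : Type*} (s : Finset ι) {u : ι → ℝ → ℂ}
    {F : ℝ → ℂ} {B C : ℝ} (hu : ∀ i ∈ s, Integrable (u i))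
    (hu0 : ∀ i ∈ s, ∀ t, t ∉ Icc (-1 : ℝ) 1 → u i t = 0)
    (hB : ∀ ξ, ∑ i ∈ s, ‖𝓕 (u i) ξ‖ ^ 2 ≤ B) (hF2 : MemLp F 2 volume) (hC : ∀ y, ‖F y‖ ≤ C) :
    ∑ i ∈ s, ∫⁻ x, ‖(u i ⋆[ContinuousLinearMap.mul ℂ ℂ, volume] F) x‖ₑ ^ 2 ≤
      ENNReal.ofReal B * ∫⁻ y, ‖F y‖ₑ ^ 2 := by
  set G : ι → ℝ → ℝ≥0∞ := fun i x => ‖(u i ⋆[ContinuousLinearMap.mul ℂ ℂ, volume] F) x‖ₑ ^ 2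
    with hGdef
  have hGm : ∀ i ∈ s, AEMeasurable (G i) volume := fun i hi =>
    ((aestronglyMeasurable_convolution (hu i hi) hF2.1).aemeasurable.enorm.pow_const 2)
  have hkey : ∀ i ∈ s, ∫⁻ x, G i x = ⨆ n : ℕ, ∫⁻ x in Icc (-(n : ℝ)) n, G i x := by
    intro i hi
    have hmono : ∀ x, Monotone fun n : ℕ => (Icc (-(n : ℝ)) n).indicator (G i) x := by
      intro x m n hmn
      refine indicator_le_indicator_of_subset (fun y hy => ?_) (fun _ => zero_le) x
      simp only [mem_Icc] at hy ⊢
      have : (m : ℝ) ≤ n := by exact_mod_cast hmn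
      constructor <;> linarith
    have hsup : ∀ x, (⨆ n : ℕ, (Icc (-(n : ℝ)) n).indicator (G i) x) = G i x := by
      intro x
      apply le_antisymm (iSup_le fun n => indicator_le_self _ _ x)
      obtain ⟨n, hn⟩ := exists_nat_ge |x|
      refine le_iSup_of_le n (le_of_eq ?_)
      rw [indicator_of_mem]
      exact ⟨by linarith [neg_abs_le x], (le_abs_self x).trans hn⟩
    calc ∫⁻ x, G i x = ∫⁻ x, ⨆ n : ℕ, (Icc (-(n : ℝ)) n).indicator (G i) x := by
          congr 1; funext x; exact (hsup x).symm
      _ = ⨆ n : ℕ, ∫⁻ x, (Icc (-(n : ℝ)) n).indicator (G i) x :=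
          lintegral_iSup' (fun n => (hGm i hi).indicator measurableSet_Icc)
            (ae_of_all _ fun x => hmono x)
      _ = ⨆ n : ℕ, ∫⁻ x in Icc (-(n : ℝ)) n, G i x := by
          congr 1; funext n; rw [lintegral_indicator measurableSet_Icc]
  have hmono' : ∀ i, Monotone fun n : ℕ => ∫⁻ x in Icc (-(n : ℝ)) n, G i x := by
    intro i m n hmn
    refine lintegral_mono_set fun y hy => ?_
    simp only [mem_Icc] at hy ⊢
    have : (m : ℝ) ≤ n := by exact_mod_cast hmn
    constructor <;> linarith
  calc ∑ i ∈ s, ∫⁻ x, G i x = ∑ i ∈ s, ⨆ n : ℕ, ∫⁻ x in Icc (-(n : ℝ)) n, G i x :=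
        Finset.sum_congr rfl hkey
    _ = ⨆ n : ℕ, ∑ i ∈ s, ∫⁻ x in Icc (-(n : ℝ)) n, G i x :=
        ENNReal.finsetSum_iSup_of_monotone hmono'
    _ ≤ ENNReal.ofReal B * ∫⁻ y, ‖F y‖ₑ ^ 2 :=
        iSup_le fun n => Prop31.sum_setLIntegral_sq_convolution_le s hu hu0 hB hF2 hC n

/-! ### Fourier-side identities for the shifted functions -/

/-- On the window side, shifting `h` by `a` modulates `𝓕⁻h`, and the modulation passes through the
cut-off and (in norm) through the convolution:
`|ψ ⋆ (1_{U'} 𝓕⁻(h(· - a)))| = |(e_{-a}ψ) ⋆ (1_{U'} 𝓕⁻h)|`. [folklore] -/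
theorem norm_convolution_indicator_fourierInv_shift (ψ h : ℝ → ℂ) (U : Set ℝ) (a x : ℝ) :
    ‖(ψ ⋆[ContinuousLinearMap.mul ℂ ℂ, volume]
        (U.indicator (𝓕⁻ (fun v => h (v - a)) : ℝ → ℂ))) x‖ =
      ‖((fun t => ((𝐞 (-(a * t)) : Circle) : ℂ) * ψ t) ⋆[ContinuousLinearMap.mul ℂ ℂ, volume]
        (U.indicator (𝓕⁻ h : ℝ → ℂ))) x‖ := by
  have hfun : U.indicator (𝓕⁻ (fun v => h (v - a)) : ℝ → ℂ) =
      fun y => ((𝐞 (a * y) : Circle) : ℂ) * U.indicator (𝓕⁻ h : ℝ → ℂ) y := by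
    funext y
    by_cases hy : y ∈ U
    · rw [indicator_of_mem hy, indicator_of_mem hy]
      exact Prop31.fourierInv_comp_sub_right h a y
    · rw [indicator_of_notMem hy, indicator_of_notMem hy, mul_zero]
  rw [hfun]
  exact Prop31.norm_convolution_fourierChar_mul ψ _ a x

/-- Lattice sums of the weight `e^{-c₂⟨·⟩^{1/2}}`: `∑_{ℓ ∈ Λ} e^{-c₂⟨ζ + ℓ + η⟩^{1/2}} ≤ 30 (c₂/2)⁻⁴`
uniformly (`exp_neg_japanese_le` and `sum_inv_one_add_sq_le`). [folklore] -/
theorem sum_exp_neg_japanese_shift_le {c₂ : ℝ} (hc₂ : 0 < c₂) (Λ : Finset ℤ) (ζ η : ℝ) :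
    ∑ ℓ ∈ Λ, Real.exp (-(c₂ * (1 + (ζ + ((ℓ : ℝ) + η)) ^ 2) ^ (1 / 4 : ℝ))) ≤
      3 / 2 * (c₂ / 2)⁻¹ ^ 4 * 20 := by
  have hterm : ∀ ℓ : ℤ, Real.exp (-(c₂ * (1 + (ζ + ((ℓ : ℝ) + η)) ^ 2) ^ (1 / 4 : ℝ))) ≤
      3 / 2 * (c₂ / 2)⁻¹ ^ 4 * (1 + ((ζ + η) + (ℓ : ℝ)) ^ 2)⁻¹ := by
    intro ℓ
    have h := Prop31.exp_neg_japanese_le (half_pos hc₂) (ζ + ((ℓ : ℝ) + η))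
    rw [show 2 * (c₂ / 2) = c₂ by ring] at h
    rw [show (ζ + η) + (ℓ : ℝ) = ζ + ((ℓ : ℝ) + η) by ring]
    exact h
  calc ∑ ℓ ∈ Λ, Real.exp (-(c₂ * (1 + (ζ + ((ℓ : ℝ) + η)) ^ 2) ^ (1 / 4 : ℝ)))
      ≤ ∑ ℓ ∈ Λ, 3 / 2 * (c₂ / 2)⁻¹ ^ 4 * (1 + ((ζ + η) + (ℓ : ℝ)) ^ 2)⁻¹ :=
        Finset.sum_le_sum fun ℓ _ => hterm ℓ
    _ = 3 / 2 * (c₂ / 2)⁻¹ ^ 4 * ∑ ℓ ∈ Λ, (1 + ((ζ + η) + (ℓ : ℝ)) ^ 2)⁻¹ := by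
        rw [Finset.mul_sum]
    _ ≤ 3 / 2 * (c₂ / 2)⁻¹ ^ 4 * 20 :=
        mul_le_mul_of_nonneg_left (Prop31.sum_inv_one_add_sq_le Λ (ζ + η)) (by positivity)

/-! ### Proposition 3.1 -/

set_option maxHeartbeats 4000000 in
/-- **BD18 Proposition 3.1 from Lemma 3.1, for measurable `h`** (the core of the proof of
Proposition 3.1, BD18 §3.3): given the conclusion of Lemma 3.1 (hypothesis `hL31`, for all
admissible constants), for `0 < δ < 1`, `C ≥ 1`, `0 < c₁ ≤ 1` there is `c₃ > 0` such that for
`α₁ ≥ 2`, `Y ⊂ [-α₁, α₁]` `δ`-regular with constant `C` on scales `1` to `α₁`, windows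
`[t_j - c₁/2, t_j + c₁/2] ⊂ [j, j+1]` and every MEASURABLE `h ∈ L¹ ∩ L²` vanishing off `Y`:
`c₃ ∫ |h|² ≤ ∫_{⋃_j [t_j - c₁/2, t_j + c₁/2]} |𝓕⁻h|²`.
[cite: BourgainDyatlov2018, Proposition 3.1 (proof, §3.3)] -/
theorem bd18_prop31_core
    (hL31 : ∀ (δ C_R c₁ : ℝ), 0 < δ → δ < 1 → 1 ≤ C_R → 0 < c₁ →
      ∃ c₂ : ℝ, 0 < c₂ ∧ c₂ ≤ 1 ∧ ∀ (α₁ : ℝ) (Y : Set ℝ), Y ⊆ Icc (-α₁) α₁ →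
        IsRegularSet Y δ C_R 2 α₁ →
        ∃ ψ : ℝ → ℂ, Integrable ψ ∧ MemLp ψ 2 volume ∧ (∀ x, c₁ / 10 < |x| → ψ x = 0) ∧
          c₂ ^ 2 ≤ ∫ ξ in Icc (-1 : ℝ) 1, ‖(𝓕 ψ : ℝ → ℂ) ξ‖ ^ 2 ∧
          (∀ ξ, ‖(𝓕 ψ : ℝ → ℂ) ξ‖ ≤ Real.exp (-(c₂ * (1 + ξ ^ 2) ^ (1 / 4 : ℝ)))) ∧
          ∀ ξ ∈ Y, ‖(𝓕 ψ : ℝ → ℂ) ξ‖ ≤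
            Real.exp (-(c₂ * (Real.log (10 + |ξ|) ^ (-(1 + δ) / 2) * |ξ|))))
    {δ C c₁ : ℝ} (hδ0 : 0 < δ) (hδ1 : δ < 1) (hC : 1 ≤ C) (hc₁ : 0 < c₁) (hc₁1 : c₁ ≤ 1) :
    ∃ c₃ : ℝ, 0 < c₃ ∧ ∀ α₁ : ℝ, 2 ≤ α₁ → ∀ Y : Set ℝ, Y ⊆ Icc (-α₁) α₁ →
      IsRegularSet Y δ C 1 α₁ →
      ∀ t : ℤ → ℝ, (∀ j : ℤ, Icc (t j - c₁ / 2) (t j + c₁ / 2) ⊆ Icc (j : ℝ) ((j : ℝ) + 1)) →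
      ∀ h : ℝ → ℂ, Measurable h → Integrable h → MemLp h 2 volume → (∀ ξ, ξ ∉ Y → h ξ = 0) →
        c₃ * ∫ ξ, ‖h ξ‖ ^ 2 ≤
          ∫ x in ⋃ j : ℤ, Icc (t j - c₁ / 2) (t j + c₁ / 2), ‖(𝓕⁻ h : ℝ → ℂ) x‖ ^ 2 := by
  have hπ := Real.pi_pos
  -- Lemma 3.1 for the constant `160 C`
  obtain ⟨c₂, hc₂0, hc₂1, hmult⟩ := hL31 δ (160 * C) c₁ hδ0 hδ1 (by linarith) hc₁
  -- Lemma 3.2 for `c₀ = c₁/2`, with the constant enlarged to `C₀ ≥ 1`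
  obtain ⟨C₃₂, hC₃₂, hL32⟩ := bourgainDyatlov2018_lemma_3_2 (c₁ / 2) (by positivity) (by linarith)
  set C₀ : ℝ := max C₃₂ 1 with hC₀
  have hC₀1 : 1 ≤ C₀ := le_max_right _ _
  have hC₀0 : 0 < C₀ := by linarith
  have hC₃₂C₀ : C₃₂ ≤ C₀ := le_max_left _ _
  have hL32' : ∀ r : ℝ, 0 < r → r < 1 → ∀ κ : ℝ, 0 < κ → κ ≤ Real.exp (-C₀ / r) →
      ∀ b : ℤ → ℝ, (∀ j : ℤ, (j : ℝ) ≤ b j ∧ b j + c₁ / 2 ≤ j + 1) →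
      ∀ g : ℝ → ℂ, MemLp g 2 volume → (∃ R : ℝ, ∀ ξ, R < |ξ| → g ξ = 0) →
        ∫ x, ‖(𝓕⁻ g : ℝ → ℂ) x‖ ^ 2 ≤
          C₀ / r * (∫ x in ⋃ j : ℤ, Icc (b j) (b j + c₁ / 2), ‖(𝓕⁻ g : ℝ → ℂ) x‖ ^ 2) ^ κ *
            (∫ ξ, Real.exp (4 * π * r * |ξ|) * ‖g ξ‖ ^ 2) ^ (1 - κ) := by
    intro r hr0 hr1 κ hκ0 hκ b hb g hg hgs
    have hκ' : κ ≤ Real.exp (-C₃₂ / r) := hκ.trans (Real.exp_le_exp.2 (by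
      rw [neg_div, neg_div, neg_le_neg_iff]; exact div_le_div_of_nonneg_right hC₃₂C₀ hr0.le))
    refine (hL32 r hr0 hr1 κ hκ0 hκ' b hb g hg hgs).trans ?_
    set P₁ : ℝ := (∫ x in ⋃ j : ℤ, Icc (b j) (b j + c₁ / 2), ‖(𝓕⁻ g : ℝ → ℂ) x‖ ^ 2) with hP₁
    set P₂ : ℝ := (∫ ξ, Real.exp (4 * π * r * |ξ|) * ‖g ξ‖ ^ 2) with hP₂
    have hP : 0 ≤ P₁ ^ κ * P₂ ^ (1 - κ) :=
      mul_nonneg (Real.rpow_nonneg (integral_nonneg fun x => by positivity) _)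
        (Real.rpow_nonneg (integral_nonneg fun x => by positivity) _)
    have hcoef : C₃₂ / r ≤ C₀ / r := div_le_div_of_nonneg_right hC₃₂C₀ hr0.le
    calc C₃₂ / r * P₁ ^ κ * P₂ ^ (1 - κ) = C₃₂ / r * (P₁ ^ κ * P₂ ^ (1 - κ)) := by ring
      _ ≤ C₀ / r * (P₁ ^ κ * P₂ ^ (1 - κ)) := mul_le_mul_of_nonneg_right hcoef hP
      _ = C₀ / r * P₁ ^ κ * P₂ ^ (1 - κ) := by ring
  -- the constants `c`, `p`, the threshold `K`, and `θK, r, κ, E, γ, s`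
  set c : ℝ := c₂ ^ 3 / 2 with hcdef
  have hc0 : 0 < c := by positivity
  have hc₂31 : c₂ ^ 3 ≤ c₂ := by
    have : c₂ ^ 2 ≤ 1 := pow_le_one₀ hc₂0.le hc₂1
    nlinarith
  have hc1 : c ≤ 1 := by rw [hcdef]; linarith
  have hcc₂ : c ≤ c₂ / 2 := by rw [hcdef]; linarith
  set p : ℝ := (1 + δ) / 2 with hp
  have hp0 : 0 < p := by rw [hp]; linarith
  have hp1 : p < 1 := by rw [hp]; linarith
  obtain ⟨K, hK10, hthr⟩ := Prop31.exists_threshold hc0 hc1 hC₀1 hp0 hp1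
  set θK : ℝ := Real.log (10 + K) ^ (-(1 + δ) / 2) with hθK
  have hθKp : θK = Real.log (10 + K) ^ (-p) := by rw [hθK, hp, neg_div]
  set r : ℝ := c * θK / 10 with hr
  set κ : ℝ := Real.exp (-(C₀ / r)) with hκ
  set E : ℝ := Real.exp (-(c * θK * K / 2)) with hE
  set γ : ℝ := 14400 * C₀ * (1 + K ^ 2) / (c ^ 3 * θK) with hγ
  set s : ℝ := (4 * γ) ^ ((1 - κ) / κ) with hs
  obtain ⟨-, hineq⟩ := hthr θK r κ E γ s hθKp rfl rfl rfl rfl rfl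
  have hK0 : 0 ≤ K := by linarith
  have hθK0 : 0 < θK := by rw [hθKp]; exact Prop31.theta_pos p hK0
  have hr0 : 0 < r := by positivity
  have hκ0 : 0 < κ := Real.exp_pos _
  have hκ1 : κ < 1 := by
    rw [hκ, Real.exp_lt_one_iff]; exact neg_neg_of_pos (div_pos hC₀0 hr0)
  have hE0 : 0 < E := Real.exp_pos _
  have hγ0 : 0 < γ := by positivity
  have h4γ : 0 < 4 * γ := by positivity
  have hs0 : 0 < s := Real.rpow_pos_of_pos h4γ _
  have hs' : s ^ (-(κ / (1 - κ))) = (4 * γ)⁻¹ := by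
    rw [hs, ← Real.rpow_mul h4γ.le]
    have h1κ : (1 - κ) ≠ 0 := by linarith
    rw [show (1 - κ) / κ * -(κ / (1 - κ)) = -1 by field_simp]
    exact Real.rpow_neg_one (4 * γ)
  -- the weight constant `B` and the coefficients `αA, αN`
  set B : ℝ := 3 / 2 * (c₂ / 2)⁻¹ ^ 4 * 20 with hB
  have hB0 : 0 < B := by positivity
  set αA : ℝ := C₀ / r * (2 * s) with hαA
  set αN : ℝ := C₀ / r * (2 * s * E + (4 * γ)⁻¹) + E with hαN
  have hαA0 : 0 < αA := by positivity
  have hαN0 : 0 ≤ αN := by positivity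
  -- `4 αN B ≤ c₂²/4`: this is where the choice of `K` enters
  have hαNB : 4 * αN * B ≤ c₂ ^ 2 / 4 := by
    have h1 : C₀ / r * 360 * E * s + 180 * E ≤ c ^ 2 / 32 := by
      have h := hineq
      rw [div_mul_eq_mul_div, div_le_iff₀ (by positivity)] at h
      have hc2 : 0 < c ^ 2 := by positivity
      rw [le_div_iff₀ (by norm_num : (0 : ℝ) < 32)]
      linarith
    have h2 : 0 ≤ C₀ / r * 360 * E * s := by positivity
    have h3 : 0 ≤ 180 * E := by positivity
    have h4 : C₀ / r * (4 * γ)⁻¹ = c ^ 2 / (5760 * (1 + K ^ 2)) := by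
      rw [hγ, hr]
      field_simp
      ring
    have h5 : c ^ 2 / (5760 * (1 + K ^ 2)) ≤ c ^ 2 / 5760 :=
      div_le_div_of_nonneg_left (sq_nonneg _) (by norm_num) (by nlinarith [sq_nonneg K])
    have h6 : αN ≤ c ^ 2 / 1920 := by
      have h7 : αN = (C₀ / r * 360 * E * s) / 180 + C₀ / r * (4 * γ)⁻¹ + E := by
        rw [hαN]; ring
      rw [h7, h4]
      linarith
    have hBc : B * c ^ 2 = 120 * c₂ ^ 2 := by
      rw [hB, hcdef]; field_simp; ring
    calc 4 * αN * B ≤ 4 * (c ^ 2 / 1920) * B :=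
          mul_le_mul_of_nonneg_right (mul_le_mul_of_nonneg_left h6 (by norm_num)) hB0.le
      _ = B * c ^ 2 / 480 := by ring
      _ = c₂ ^ 2 / 4 := by rw [hBc]; ring
  -- the constant `c₃`
  refine ⟨3 * c₂ ^ 2 / (16 * αA * B), by positivity, ?_⟩
  intro α₁ hα₁ Y hY hYreg t ht h hhm hhi hh2 hhY
  -- notation: `U'`, `W = ‖h‖²`, `f = 𝓕⁻ h`, `X = ‖f‖²_{L²(U')}`
  set U' : Set ℝ := ⋃ j : ℤ, Icc (t j - c₁ / 2) (t j + c₁ / 2) with hU'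
  have hU'm : MeasurableSet U' := MeasurableSet.iUnion fun j => measurableSet_Icc
  set W : ℝ := ∫ ξ, ‖h ξ‖ ^ 2 with hW
  set X : ℝ := ∫ x in U', ‖(𝓕⁻ h : ℝ → ℂ) x‖ ^ 2 with hX
  have hW0 : 0 ≤ W := integral_nonneg fun ξ => by positivity
  have hX0 : 0 ≤ X := integral_nonneg fun x => by positivity
  have hw_sq : Integrable (fun ξ => ‖h ξ‖ ^ 2) := (memLp_two_iff_integrable_sq_norm hh2.1).1 hh2
  -- `f = 𝓕⁻ h`: continuous, bounded by `‖h‖₁`, square integrable; `F = 1_{U'} f`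
  have hfc : Continuous (𝓕⁻ h : ℝ → ℂ) := by
    rw [Real.fourierInv_eq_fourier_comp_neg]
    exact Literature.Analysis.FunctionSpaces.continuous_fourierIntegral hhi.comp_neg
  have hf_sq : Integrable (fun x => ‖(𝓕⁻ h : ℝ → ℂ) x‖ ^ 2) := integrable_norm_sq_fourierInv hhi hh2
  have hf2 : MemLp (𝓕⁻ h : ℝ → ℂ) 2 volume :=
    (memLp_two_iff_integrable_sq_norm hfc.aestronglyMeasurable).2 hf_sq
  set F : ℝ → ℂ := U'.indicator (𝓕⁻ h : ℝ → ℂ) with hF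
  have hF2 : MemLp F 2 volume := hf2.indicator hU'm
  have hFb : ∀ y, ‖F y‖ ≤ ∫ v, ‖h v‖ := by
    intro y
    rw [hF]
    refine (norm_indicator_le_norm_self _ y).trans (norm_fourierInv_le_integral_norm h y)
  have hFX : ∫ y, ‖F y‖ ^ 2 = X := by
    rw [hX, ← integral_indicator hU'm]
    congr 1
    funext y
    rw [hF]
    by_cases hy : y ∈ U'
    · rw [indicator_of_mem hy, indicator_of_mem hy]
    · rw [indicator_of_notMem hy, indicator_of_notMem hy, norm_zero, zero_pow two_ne_zero]
  have hF_sq : Integrable (fun y => ‖F y‖ ^ 2) := (memLp_two_iff_integrable_sq_norm hF2.1).1 hF2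
  have hFX' : ∫⁻ y, ‖F y‖ₑ ^ 2 = ENNReal.ofReal X := by
    rw [lintegral_enorm_sq_eq_ofReal hF_sq, hFX]
  -- the shifts `ℓ ∈ Λ` and the fattened shifted sets `Z_ℓ(2)`
  set N₀ : ℕ := ⌈α₁⌉₊ with hN₀
  have hN₀ge : α₁ ≤ N₀ := Nat.le_ceil α₁
  have hN₀lt : (N₀ : ℝ) < α₁ + 1 := Nat.ceil_lt_add_one (by linarith)
  set Λ : Finset ℤ := Finset.Icc (-(N₀ : ℤ) - 1) (N₀ + 1) with hΛ
  have hΛabs : ∀ ℓ ∈ Λ, |(ℓ : ℝ)| ≤ α₁ + 2 := by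
    intro ℓ hℓ
    rw [hΛ, Finset.mem_Icc] at hℓ
    have h1 : (-(N₀ : ℝ) - 1) ≤ ℓ := by exact_mod_cast hℓ.1
    have h2 : (ℓ : ℝ) ≤ N₀ + 1 := by exact_mod_cast hℓ.2
    rw [abs_le]; constructor <;> linarith
  set Zs : ℤ → Set ℝ := fun ℓ =>
    ((fun x : ℝ => (ℓ : ℝ) + 1 * x) '' Y) + Icc (-(((2 : ℕ) : ℝ) * 1)) (((2 : ℕ) : ℝ) * 1) with hZs
  have hZreg : ∀ ℓ : ℤ, IsRegularSet (Zs ℓ) δ (160 * C) 2 (4 * α₁) := by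
    intro ℓ
    have hYℓ := hYreg.affine_image one_pos (ℓ : ℝ)
    rw [one_mul, one_mul] at hYℓ
    have hZ1 := hYℓ.neighbourhood hδ1.le (by linarith) one_pos (by linarith) (T := 2) (by norm_num)
    have hZ2 := hZ1.mono_upper_scale hδ0.le hδ1.le (by positivity) (by norm_num) (by linarith)
      (T := 4) (by norm_num)
    have e1 : (2 : ℝ) * 4 * (10 * ((2 : ℕ) : ℝ) * C) = 160 * C := by push_cast; ring
    have e2 : (2 : ℝ) * 1 = 2 := by norm_num
    rw [e1, e2] at hZ2
    exact hZ2
  have hZsub : ∀ ℓ ∈ Λ, Zs ℓ ⊆ Icc (-(4 * α₁)) (4 * α₁) := by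
    intro ℓ hℓ z hz
    rw [hZs] at hz
    obtain ⟨y', hy', e, he, rfl⟩ := Set.mem_add.1 hz
    obtain ⟨y, hy, rfl⟩ := hy'
    have hyb := hY hy
    have hℓb := hΛabs ℓ hℓ
    simp only [mem_Icc, Nat.cast_ofNat] at hyb he ⊢
    rw [abs_le] at hℓb
    constructor <;> linarith [hyb.1, hyb.2, he.1, he.2, hℓb.1, hℓb.2]
  have hmemZ : ∀ ℓ : ℤ, ∀ η ∈ Icc (-2 : ℝ) 2, ∀ ξ, h (ξ - ((ℓ : ℝ) + η)) ≠ 0 → ξ ∈ Zs ℓ := by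
    intro ℓ η hη ξ hξ
    have hyY : ξ - ((ℓ : ℝ) + η) ∈ Y := by
      by_contra hcon
      exact hξ (hhY _ hcon)
    rw [hZs]
    refine Set.mem_add.2 ⟨(ℓ : ℝ) + 1 * (ξ - ((ℓ : ℝ) + η)), mem_image_of_mem _ hyY, η, ?_, by ring⟩
    simp only [mem_Icc, Nat.cast_ofNat] at hη ⊢
    constructor <;> linarith [hη.1, hη.2]
  -- the multipliers `ψ_ℓ`
  have hψex : ∀ ℓ : ℤ, ℓ ∈ Λ → ∃ ψ : ℝ → ℂ, Integrable ψ ∧ MemLp ψ 2 volume ∧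
      (∀ x, c₁ / 10 < |x| → ψ x = 0) ∧
      c₂ ^ 2 ≤ ∫ ξ in Icc (-1 : ℝ) 1, ‖(𝓕 ψ : ℝ → ℂ) ξ‖ ^ 2 ∧
      (∀ ξ, ‖(𝓕 ψ : ℝ → ℂ) ξ‖ ≤ Real.exp (-(c₂ * (1 + ξ ^ 2) ^ (1 / 4 : ℝ)))) ∧
      ∀ ξ ∈ Zs ℓ, ‖(𝓕 ψ : ℝ → ℂ) ξ‖ ≤
        Real.exp (-(c₂ * (Real.log (10 + |ξ|) ^ (-(1 + δ) / 2) * |ξ|))) :=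
    fun ℓ hℓ => hmult (4 * α₁) (Zs ℓ) (hZsub ℓ hℓ) (hZreg ℓ)
  choose! ψ hψi hψ2 hψsupp hψlow hψdec hψZ using hψex
  have hψc : ∀ ℓ ∈ Λ, Continuous (𝓕 (ψ ℓ)) := fun ℓ hℓ =>
    Literature.Analysis.FunctionSpaces.continuous_fourierIntegral (hψi ℓ hℓ)
  have hψ1 : ∀ ℓ ∈ Λ, ∀ ξ, ‖𝓕 (ψ ℓ) ξ‖ ≤ 1 := fun ℓ hℓ ξ =>
    (hψdec ℓ hℓ ξ).trans (Real.exp_le_one_iff.2 (by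
      have : 0 ≤ (1 + ξ ^ 2) ^ (1 / 4 : ℝ) := Real.rpow_nonneg (by positivity) _
      nlinarith))
  have hψsupp1 : ∀ ℓ ∈ Λ, ∀ x, x ∉ Icc (-1 : ℝ) 1 → ψ ℓ x = 0 := by
    intro ℓ hℓ x hx
    refine hψsupp ℓ hℓ x ?_
    rw [mem_Icc, not_and_or, not_le, not_le] at hx
    have : c₁ / 10 < 1 := by linarith
    rcases hx with hx | hx
    · rw [abs_of_neg (by linarith)]; linarith
    · rw [abs_of_pos (by linarith)]; linarith
  -- the weight `ρ` and its lattice sums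
  set ρ : ℝ → ℝ := fun ξ => Real.exp (-(c₂ * (1 + ξ ^ 2) ^ (1 / 4 : ℝ))) with hρ
  have hρ0 : ∀ ξ, 0 < ρ ξ := fun ξ => Real.exp_pos _
  have hρ1 : ∀ ξ, ρ ξ ≤ 1 := fun ξ => by
    rw [hρ]; simp only
    rw [Real.exp_le_one_iff, neg_nonpos]
    exact mul_nonneg hc₂0.le (Real.rpow_nonneg (by positivity) _)
  have hρc : Continuous ρ := by
    rw [hρ]
    refine Real.continuous_exp.comp (Continuous.neg (continuous_const.mul ?_))
    exact (continuous_const.add (continuous_pow 2)).rpow_const fun _ => Or.inr (by norm_num)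
  have hρsum : ∀ ζ η : ℝ, ∑ ℓ ∈ Λ, ρ (ζ + ((ℓ : ℝ) + η)) ≤ B := fun ζ η =>
    sum_exp_neg_japanese_shift_le hc₂0 Λ ζ η
  -- the per-shift quantities
  set w : ℤ → ℝ → ℝ → ℂ := fun ℓ η ξ => h (ξ - ((ℓ : ℝ) + η)) with hw
  have hwi : ∀ ℓ η, Integrable (w ℓ η) := fun ℓ η => hhi.comp_sub_right _
  have hwm : ∀ ℓ η, Measurable (w ℓ η) := fun ℓ η => hhm.comp (measurable_id.sub_const _)
  have hw_sq' : ∀ ℓ η, Integrable (fun ξ => ‖w ℓ η ξ‖ ^ 2) := fun ℓ η =>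
    hw_sq.comp_sub_right ((ℓ : ℝ) + η)
  have hw2 : ∀ ℓ η, MemLp (w ℓ η) 2 volume := fun ℓ η =>
    (memLp_two_iff_integrable_sq_norm (hwm ℓ η).aestronglyMeasurable).2 (hw_sq' ℓ η)
  have hwZ : ∀ ℓ : ℤ, ∀ η ∈ Icc (-2 : ℝ) 2, ∀ ξ, ξ ∉ Zs ℓ → w ℓ η ξ = 0 := by
    intro ℓ η hη ξ hξ
    by_contra hne
    exact hξ (hmemZ ℓ η hη ξ hne)
  set A : ℤ → ℝ → ℝ := fun ℓ η => ∫ x in ⋃ j : ℤ, Icc (t j - c₁ / 4) (t j + c₁ / 4),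
    ‖(ψ ℓ ⋆[ContinuousLinearMap.mul ℂ ℂ, volume] (U'.indicator (𝓕⁻ (w ℓ η) : ℝ → ℂ))) x‖ ^ 2
    with hA
  set Nw : ℤ → ℝ → ℝ := fun ℓ η => ∫ ξ, ρ ξ * ‖w ℓ η ξ‖ ^ 2 with hNw
  set P : ℤ → ℝ → ℝ := fun ℓ η => ∫ ξ, ‖𝓕 (ψ ℓ) ξ * w ℓ η ξ‖ ^ 2 with hP
  have hA0 : ∀ ℓ η, 0 ≤ A ℓ η := fun ℓ η => integral_nonneg fun x => by positivity
  have hNw0 : ∀ ℓ η, 0 ≤ Nw ℓ η := fun ℓ η =>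
    integral_nonneg fun ξ => mul_nonneg (hρ0 ξ).le (by positivity)
  -- (1) the weighted smaller step, for `ℓ ∈ Λ` and `η ∈ [-2, 2]`, followed by the Young splitting
  have hstep : ∀ ℓ ∈ Λ, ∀ η ∈ Icc (-2 : ℝ) 2, P ℓ η ≤ αA * A ℓ η + αN * Nw ℓ η := by
    intro ℓ hℓ η hη
    have h1 := weighted_step hc₁ hc₂0 hc₂1 hc0 hcc₂ hδ0 hδ1 hC₀0 hL32' t ht (ψ ℓ) (hψi ℓ hℓ)
      (hψsupp ℓ hℓ) (hψdec ℓ hℓ) (Zs ℓ) (hψZ ℓ hℓ) (w ℓ η) (hwi ℓ η) (hw2 ℓ η) (hwZ ℓ η hη)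
      hK10 θK r κ E (A ℓ η) (Nw ℓ η) hθK hr hκ hE rfl rfl
    have hPQ : 0 ≤ 2 * A ℓ η + 2 * E * Nw ℓ η := by
      have := hA0 ℓ η; have := hNw0 ℓ η; positivity
    have h2 := Prop31.rpow_mul_rpow_le hκ0 hκ1 hPQ (hNw0 ℓ η) hs0
    rw [hs'] at h2
    have h3 : C₀ / r * (2 * A ℓ η + 2 * E * Nw ℓ η) ^ κ * Nw ℓ η ^ (1 - κ) ≤
        C₀ / r * (s * (2 * A ℓ η + 2 * E * Nw ℓ η) + (4 * γ)⁻¹ * Nw ℓ η) := by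
      rw [mul_assoc]
      exact mul_le_mul_of_nonneg_left h2 (by positivity)
    calc P ℓ η ≤ C₀ / r * (2 * A ℓ η + 2 * E * Nw ℓ η) ^ κ * Nw ℓ η ^ (1 - κ) + E * Nw ℓ η := h1
      _ ≤ C₀ / r * (s * (2 * A ℓ η + 2 * E * Nw ℓ η) + (4 * γ)⁻¹ * Nw ℓ η) + E * Nw ℓ η := by
          linarith
      _ = αA * A ℓ η + αN * Nw ℓ η := by rw [hαA, hαN]; ring
  -- (2) the family bound: `∑_ℓ A ℓ η ≤ B X`
  have hsumA : ∀ η : ℝ, ∑ ℓ ∈ Λ, A ℓ η ≤ B * X := by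
    intro η
    set u : ℤ → ℝ → ℂ := fun ℓ x => ((𝐞 (-((((ℓ : ℝ) + η)) * x)) : Circle) : ℂ) * ψ ℓ x with hu
    have hu_int : ∀ ℓ ∈ Λ, Integrable (u ℓ) := by
      intro ℓ hℓ
      refine (hψi ℓ hℓ).bdd_mul (c := 1) (Continuous.aestronglyMeasurable (by fun_prop))
        (ae_of_all _ fun x => ?_)
      rw [Prop31.norm_fourierChar]
    have hu0 : ∀ ℓ ∈ Λ, ∀ x, x ∉ Icc (-1 : ℝ) 1 → u ℓ x = 0 := by
      intro ℓ hℓ x hx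
      rw [hu]; simp only
      rw [hψsupp1 ℓ hℓ x hx, mul_zero]
    have huB : ∀ ξ, ∑ ℓ ∈ Λ, ‖𝓕 (u ℓ) ξ‖ ^ 2 ≤ B := by
      intro ξ
      refine le_trans (Finset.sum_le_sum fun ℓ hℓ => ?_) (hρsum ξ η)
      rw [hu]
      rw [Prop31.fourier_fourierChar_mul (ψ ℓ) ((ℓ : ℝ) + η) ξ]
      have h1 := hψdec ℓ hℓ (ξ + ((ℓ : ℝ) + η))
      have h2 := hψ1 ℓ hℓ (ξ + ((ℓ : ℝ) + η))
      calc ‖𝓕 (ψ ℓ) (ξ + ((ℓ : ℝ) + η))‖ ^ 2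
          = ‖𝓕 (ψ ℓ) (ξ + ((ℓ : ℝ) + η))‖ * ‖𝓕 (ψ ℓ) (ξ + ((ℓ : ℝ) + η))‖ := sq _
        _ ≤ 1 * Real.exp (-(c₂ * (1 + (ξ + ((ℓ : ℝ) + η)) ^ 2) ^ (1 / 4 : ℝ))) :=
            mul_le_mul h2 h1 (norm_nonneg _) zero_le_one
        _ = ρ (ξ + ((ℓ : ℝ) + η)) := by rw [one_mul]
    have hfam := sum_lintegral_sq_convolution_le Λ hu_int hu0 huB hF2 hFb
    rw [hFX'] at hfam
    have hfin : ENNReal.ofReal B * ENNReal.ofReal X ≠ ∞ :=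
      ENNReal.mul_ne_top ENNReal.ofReal_ne_top ENNReal.ofReal_ne_top
    have hJfin : ∀ ℓ ∈ Λ, ∫⁻ x, ‖(u ℓ ⋆[ContinuousLinearMap.mul ℂ ℂ, volume] F) x‖ₑ ^ 2 ≠ ∞ := by
      intro ℓ hℓ
      exact ne_top_of_le_ne_top hfin
        ((Finset.single_le_sum (f := fun ℓ => ∫⁻ x, ‖(u ℓ ⋆[ContinuousLinearMap.mul ℂ ℂ, volume] F) x‖ₑ ^ 2)
          (fun _ _ => zero_le) hℓ).trans hfam)
    have hAle : ∀ ℓ ∈ Λ, A ℓ η ≤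
        (∫⁻ x, ‖(u ℓ ⋆[ContinuousLinearMap.mul ℂ ℂ, volume] F) x‖ₑ ^ 2).toReal := by
      intro ℓ hℓ
      have hmeas : AEStronglyMeasurable (u ℓ ⋆[ContinuousLinearMap.mul ℂ ℂ, volume] F) volume :=
        aestronglyMeasurable_convolution (hu_int ℓ hℓ) hF2.1
      have hAeq : A ℓ η = ∫ x in ⋃ j : ℤ, Icc (t j - c₁ / 4) (t j + c₁ / 4),
          ‖(u ℓ ⋆[ContinuousLinearMap.mul ℂ ℂ, volume] F) x‖ ^ 2 := by
        simp only [hA, hw, hu, hF]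
        congr 1
        funext x
        exact congrArg (· ^ 2)
          (norm_convolution_indicator_fourierInv_shift (ψ ℓ) h U' ((ℓ : ℝ) + η) x)
      rw [hAeq]
      exact setIntegral_norm_sq_le_toReal_lintegral hmeas _ (hJfin ℓ hℓ)
    calc ∑ ℓ ∈ Λ, A ℓ η
        ≤ ∑ ℓ ∈ Λ, (∫⁻ x, ‖(u ℓ ⋆[ContinuousLinearMap.mul ℂ ℂ, volume] F) x‖ₑ ^ 2).toReal :=
          Finset.sum_le_sum hAle
      _ = (∑ ℓ ∈ Λ, ∫⁻ x, ‖(u ℓ ⋆[ContinuousLinearMap.mul ℂ ℂ, volume] F) x‖ₑ ^ 2).toReal :=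
          (ENNReal.toReal_sum hJfin).symm
      _ ≤ (ENNReal.ofReal B * ENNReal.ofReal X).toReal := ENNReal.toReal_mono hfin hfam
      _ = B * X := by rw [ENNReal.toReal_mul, ENNReal.toReal_ofReal hB0.le, ENNReal.toReal_ofReal hX0]
  -- (3) the weighted norms: `∑_ℓ N ℓ η ≤ B W`
  have hsumN : ∀ η : ℝ, ∑ ℓ ∈ Λ, Nw ℓ η ≤ B * W := by
    intro η
    have hshift : ∀ ℓ : ℤ, Nw ℓ η = ∫ ζ, ρ (ζ + ((ℓ : ℝ) + η)) * ‖h ζ‖ ^ 2 := by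
      intro ℓ
      rw [hNw]; simp only [hw]
      have := integral_sub_right_eq_self (μ := (volume : Measure ℝ))
        (fun ζ => ρ (ζ + ((ℓ : ℝ) + η)) * ‖h ζ‖ ^ 2) ((ℓ : ℝ) + η)
      simp only [sub_add_cancel] at this
      exact this
    have hint : ∀ ℓ : ℤ, Integrable (fun ζ => ρ (ζ + ((ℓ : ℝ) + η)) * ‖h ζ‖ ^ 2) := by
      intro ℓ
      refine hw_sq.bdd_mul (c := 1) (Continuous.aestronglyMeasurable (hρc.comp (by fun_prop)))
        (ae_of_all _ fun ζ => ?_)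
      rw [Real.norm_eq_abs, abs_of_pos (hρ0 _)]
      exact hρ1 _
    calc ∑ ℓ ∈ Λ, Nw ℓ η = ∑ ℓ ∈ Λ, ∫ ζ, ρ (ζ + ((ℓ : ℝ) + η)) * ‖h ζ‖ ^ 2 :=
          Finset.sum_congr rfl fun ℓ _ => hshift ℓ
      _ = ∫ ζ, ∑ ℓ ∈ Λ, ρ (ζ + ((ℓ : ℝ) + η)) * ‖h ζ‖ ^ 2 :=
          (integral_finsetSum Λ fun ℓ _ => hint ℓ).symm
      _ = ∫ ζ, (∑ ℓ ∈ Λ, ρ (ζ + ((ℓ : ℝ) + η))) * ‖h ζ‖ ^ 2 := by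
          congr 1; funext ζ; rw [Finset.sum_mul]
      _ ≤ ∫ ζ, B * ‖h ζ‖ ^ 2 := by
          refine integral_mono ?_ (hw_sq.const_mul B) fun ζ => ?_
          · have := integrable_finsetSum Λ fun ℓ _ => hint ℓ
            refine this.congr (ae_of_all _ fun ζ => ?_)
            simp only [Finset.sum_mul]
          · exact mul_le_mul_of_nonneg_right (hρsum ζ η) (by positivity)
      _ = B * W := by rw [integral_const_mul]
  -- (4) hence `∑_ℓ P ℓ η ≤ M₀` for `η ∈ [-2, 2]`
  set M₀ : ℝ := αA * (B * X) + αN * (B * W) with hM₀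
  have hM₀0 : 0 ≤ M₀ := by positivity
  have hsumP : ∀ η ∈ Icc (-2 : ℝ) 2, ∑ ℓ ∈ Λ, P ℓ η ≤ M₀ := by
    intro η hη
    calc ∑ ℓ ∈ Λ, P ℓ η ≤ ∑ ℓ ∈ Λ, (αA * A ℓ η + αN * Nw ℓ η) :=
          Finset.sum_le_sum fun ℓ hℓ => hstep ℓ hℓ η hη
      _ = αA * ∑ ℓ ∈ Λ, A ℓ η + αN * ∑ ℓ ∈ Λ, Nw ℓ η := by
          rw [Finset.sum_add_distrib, Finset.mul_sum, Finset.mul_sum]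
      _ ≤ M₀ := add_le_add (mul_le_mul_of_nonneg_left (hsumA η) hαA0.le)
          (mul_le_mul_of_nonneg_left (hsumN η) hαN0)
  -- (5) the `η`-average: lower bound by Tonelli and `‖ψ̂_ℓ‖_{L²(-1,1)} ≥ c₂`
  set G : ℤ → ℝ × ℝ → ℝ≥0∞ := fun ℓ q => ‖𝓕 (ψ ℓ) q.2 * h (q.2 - ((ℓ : ℝ) + q.1))‖ₑ ^ 2 with hG
  have hGm : ∀ ℓ ∈ Λ, Measurable (G ℓ) := by
    intro ℓ hℓ
    rw [hG]
    refine (Measurable.enorm ?_).pow_const 2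
    exact ((hψc ℓ hℓ).measurable.comp measurable_snd).mul
      (hhm.comp (measurable_snd.sub (measurable_const.add measurable_fst)))
  have hPeq : ∀ ℓ ∈ Λ, ∀ η, ∫⁻ ξ, G ℓ (η, ξ) = ENNReal.ofReal (P ℓ η) := by
    intro ℓ hℓ η
    have hint : Integrable (fun ξ => ‖𝓕 (ψ ℓ) ξ * w ℓ η ξ‖ ^ 2) := by
      refine (hw_sq' ℓ η).mono' (((hψc ℓ hℓ).aestronglyMeasurable.mul
        (hwm ℓ η).aestronglyMeasurable).norm.pow 2) (ae_of_all _ fun ξ => ?_)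
      rw [Real.norm_eq_abs, abs_of_nonneg (by positivity), norm_mul, mul_pow]
      exact mul_le_of_le_one_left (by positivity) (by
        have := hψ1 ℓ hℓ ξ
        have h0 := norm_nonneg (𝓕 (ψ ℓ) ξ)
        nlinarith)
    rw [hP]
    exact lintegral_enorm_sq_eq_ofReal hint
  have hlow : ∀ ℓ ∈ Λ, ENNReal.ofReal (c₂ ^ 2) * ∫⁻ ζ in Icc (-(ℓ : ℝ) - 1) (-(ℓ : ℝ) + 1), ‖h ζ‖ₑ ^ 2 ≤
      ∫⁻ η in Icc (-2 : ℝ) 2, ∫⁻ ξ, G ℓ (η, ξ) := by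
    intro ℓ hℓ
    set L : ℝ≥0∞ := ∫⁻ ζ in Icc (-(ℓ : ℝ) - 1) (-(ℓ : ℝ) + 1), ‖h ζ‖ₑ ^ 2 with hL
    have hswap : ∫⁻ η in Icc (-2 : ℝ) 2, ∫⁻ ξ, G ℓ (η, ξ) = ∫⁻ ξ, ∫⁻ η in Icc (-2 : ℝ) 2, G ℓ (η, ξ) :=
      lintegral_lintegral_swap ((hGm ℓ hℓ).aemeasurable)
    rw [hswap]
    have hinner : ∀ ξ ∈ Icc (-1 : ℝ) 1, ‖𝓕 (ψ ℓ) ξ‖ₑ ^ 2 * L ≤ ∫⁻ η in Icc (-2 : ℝ) 2, G ℓ (η, ξ) := by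
      intro ξ hξ
      have h1 : ∫⁻ η in Icc (-2 : ℝ) 2, G ℓ (η, ξ) =
          ‖𝓕 (ψ ℓ) ξ‖ₑ ^ 2 * ∫⁻ η in Icc (-2 : ℝ) 2, ‖h (ξ - ((ℓ : ℝ) + η))‖ₑ ^ 2 := by
        have hm : Measurable fun η : ℝ => ‖h (ξ - ((ℓ : ℝ) + η))‖ₑ ^ 2 :=
          (hhm.comp (measurable_const.sub (measurable_const.add measurable_id))).enorm.pow_const 2
        rw [← lintegral_const_mul _ hm]
        congr 1
        funext η
        rw [hG]; simp only
        rw [enorm_mul, mul_pow]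
      rw [h1]
      exact mul_le_mul' le_rfl (lintegral_Icc_le_lintegral_shift (fun ζ => ‖h ζ‖ₑ ^ 2) hξ _)
    have hψlow' : ENNReal.ofReal (c₂ ^ 2) ≤ ∫⁻ ξ in Icc (-1 : ℝ) 1, ‖𝓕 (ψ ℓ) ξ‖ₑ ^ 2 := by
      have hint : Integrable (fun ξ => ‖𝓕 (ψ ℓ) ξ‖ ^ 2) (volume.restrict (Icc (-1 : ℝ) 1)) :=
        ((hψc ℓ hℓ).norm.pow 2).integrableOn_Icc
      rw [lintegral_enorm_sq_eq_ofReal hint]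
      exact ENNReal.ofReal_le_ofReal (hψlow ℓ hℓ)
    calc ENNReal.ofReal (c₂ ^ 2) * L ≤ (∫⁻ ξ in Icc (-1 : ℝ) 1, ‖𝓕 (ψ ℓ) ξ‖ₑ ^ 2) * L :=
          mul_le_mul' hψlow' le_rfl
      _ = ∫⁻ ξ in Icc (-1 : ℝ) 1, ‖𝓕 (ψ ℓ) ξ‖ₑ ^ 2 * L := by
          rw [lintegral_mul_const _ (((hψc ℓ hℓ).measurable.enorm).pow_const 2)]
      _ ≤ ∫⁻ ξ in Icc (-1 : ℝ) 1, ∫⁻ η in Icc (-2 : ℝ) 2, G ℓ (η, ξ) :=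
          setLIntegral_mono' measurableSet_Icc hinner
      _ ≤ ∫⁻ ξ, ∫⁻ η in Icc (-2 : ℝ) 2, G ℓ (η, ξ) := setLIntegral_le_lintegral _ _
  -- `∫⁻ ‖h‖ₑ² = ofReal W` and it is covered by the windows
  have hWlin : ∫⁻ ζ, ‖h ζ‖ₑ ^ 2 = ENNReal.ofReal W := lintegral_enorm_sq_eq_ofReal hw_sq
  have hcover : ENNReal.ofReal W ≤ ∑ ℓ ∈ Λ, ∫⁻ ζ in Icc (-(ℓ : ℝ) - 1) (-(ℓ : ℝ) + 1), ‖h ζ‖ₑ ^ 2 := by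
    rw [← hWlin]
    have hind : (fun ζ => ‖h ζ‖ₑ ^ 2) = (Icc (-α₁) α₁).indicator fun ζ => ‖h ζ‖ₑ ^ 2 := by
      funext ζ
      by_cases hζ : ζ ∈ Icc (-α₁) α₁
      · rw [indicator_of_mem hζ]
      · rw [indicator_of_notMem hζ, hhY ζ (fun hY' => hζ (hY hY')), enorm_zero,
          zero_pow two_ne_zero]
    calc ∫⁻ ζ, ‖h ζ‖ₑ ^ 2 = ∫⁻ ζ in Icc (-α₁) α₁, ‖h ζ‖ₑ ^ 2 := by
          conv_lhs => rw [hind]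
          rw [lintegral_indicator measurableSet_Icc]
      _ ≤ _ := lintegral_Icc_le_sum_windows α₁ _
  -- (6) combine: `c₂² W ≤ 4 M₀`
  have hmain : c₂ ^ 2 * W ≤ 4 * M₀ := by
    have hup : ∫⁻ η in Icc (-2 : ℝ) 2, ∑ ℓ ∈ Λ, ∫⁻ ξ, G ℓ (η, ξ) ≤ ENNReal.ofReal M₀ * ENNReal.ofReal 4 := by
      have h1 : ∀ η ∈ Icc (-2 : ℝ) 2, ∑ ℓ ∈ Λ, ∫⁻ ξ, G ℓ (η, ξ) ≤ ENNReal.ofReal M₀ := by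
        intro η hη
        rw [Finset.sum_congr rfl fun ℓ hℓ => hPeq ℓ hℓ η, ← ENNReal.ofReal_sum_of_nonneg
          (fun ℓ _ => integral_nonneg fun ξ => by positivity)]
        exact ENNReal.ofReal_le_ofReal (hsumP η hη)
      calc ∫⁻ η in Icc (-2 : ℝ) 2, ∑ ℓ ∈ Λ, ∫⁻ ξ, G ℓ (η, ξ)
          ≤ ∫⁻ _ in Icc (-2 : ℝ) 2, ENNReal.ofReal M₀ := setLIntegral_mono' measurableSet_Icc h1
        _ = ENNReal.ofReal M₀ * ENNReal.ofReal 4 := by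
            rw [setLIntegral_const, Real.volume_Icc]; norm_num
    have hdown : ENNReal.ofReal (c₂ ^ 2) * ENNReal.ofReal W ≤
        ∫⁻ η in Icc (-2 : ℝ) 2, ∑ ℓ ∈ Λ, ∫⁻ ξ, G ℓ (η, ξ) := by
      rw [lintegral_finsetSum' Λ fun ℓ hℓ => ((hGm ℓ hℓ).lintegral_prod_right').aemeasurable]
      calc ENNReal.ofReal (c₂ ^ 2) * ENNReal.ofReal W
          ≤ ENNReal.ofReal (c₂ ^ 2) * ∑ ℓ ∈ Λ, ∫⁻ ζ in Icc (-(ℓ : ℝ) - 1) (-(ℓ : ℝ) + 1), ‖h ζ‖ₑ ^ 2 :=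
            mul_le_mul' le_rfl hcover
        _ = ∑ ℓ ∈ Λ, ENNReal.ofReal (c₂ ^ 2) * ∫⁻ ζ in Icc (-(ℓ : ℝ) - 1) (-(ℓ : ℝ) + 1), ‖h ζ‖ₑ ^ 2 :=
            Finset.mul_sum _ _ _
        _ ≤ ∑ ℓ ∈ Λ, ∫⁻ η in Icc (-2 : ℝ) 2, ∫⁻ ξ, G ℓ (η, ξ) := Finset.sum_le_sum hlow
    have h := hdown.trans hup
    rw [← ENNReal.ofReal_mul (sq_nonneg _), ← ENNReal.ofReal_mul hM₀0,
      ENNReal.ofReal_le_ofReal_iff (by positivity)] at h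
    linarith
  -- (7) conclusion
  have hfin : 3 * c₂ ^ 2 * W ≤ 16 * αA * B * X := by
    have h1 := mul_le_mul_of_nonneg_right hαNB hW0
    rw [hM₀] at hmain
    nlinarith [hmain, h1]
  rw [div_mul_eq_mul_div, div_le_iff₀ (by positivity)]
  linarith [hfin]

/-- **BD18 Proposition 3.1 from Lemma 3.1.** Given the conclusion of Lemma 3.1 (hypothesis
`hL31`), the hypothesis `H` of `bourgainDyatlov2018_thm4_of_prop31` holds: for `0 < δ < 1`,
`C ≥ 1`, `0 < c₁ ≤ 1` there is `c₃ > 0` such that for `α₁ ≥ 2`, `Y ⊂ [-α₁, α₁]` `δ`-regular with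
constant `C` on scales `1` to `α₁`, windows `[t_j - c₁/2, t_j + c₁/2] ⊂ [j, j+1]` and every
`h ∈ L¹ ∩ L²` vanishing off `Y`: `c₃ ∫ |h|² ≤ ∫_{⋃_j [t_j - c₁/2, t_j + c₁/2]} |𝓕⁻h|²` (the general
case is reduced to measurable `h` by passing to the modification `1_Y · h̃`).
[cite: BourgainDyatlov2018, Proposition 3.1] -/
theorem bd18_prop31_of_lemma31
    (hL31 : ∀ (δ C_R c₁ : ℝ), 0 < δ → δ < 1 → 1 ≤ C_R → 0 < c₁ →
      ∃ c₂ : ℝ, 0 < c₂ ∧ c₂ ≤ 1 ∧ ∀ (α₁ : ℝ) (Y : Set ℝ), Y ⊆ Icc (-α₁) α₁ →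
        IsRegularSet Y δ C_R 2 α₁ →
        ∃ ψ : ℝ → ℂ, Integrable ψ ∧ MemLp ψ 2 volume ∧ (∀ x, c₁ / 10 < |x| → ψ x = 0) ∧
          c₂ ^ 2 ≤ ∫ ξ in Icc (-1 : ℝ) 1, ‖(𝓕 ψ : ℝ → ℂ) ξ‖ ^ 2 ∧
          (∀ ξ, ‖(𝓕 ψ : ℝ → ℂ) ξ‖ ≤ Real.exp (-(c₂ * (1 + ξ ^ 2) ^ (1 / 4 : ℝ)))) ∧
          ∀ ξ ∈ Y, ‖(𝓕 ψ : ℝ → ℂ) ξ‖ ≤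
            Real.exp (-(c₂ * (Real.log (10 + |ξ|) ^ (-(1 + δ) / 2) * |ξ|))))
    {δ C c₁ : ℝ} (hδ0 : 0 < δ) (hδ1 : δ < 1) (hC : 1 ≤ C) (hc₁ : 0 < c₁) (hc₁1 : c₁ ≤ 1) :
    ∃ c₃ : ℝ, 0 < c₃ ∧ ∀ α₁ : ℝ, 2 ≤ α₁ → ∀ Y : Set ℝ, Y ⊆ Icc (-α₁) α₁ →
      IsRegularSet Y δ C 1 α₁ →
      ∀ t : ℤ → ℝ, (∀ j : ℤ, Icc (t j - c₁ / 2) (t j + c₁ / 2) ⊆ Icc (j : ℝ) ((j : ℝ) + 1)) →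
      ∀ h : ℝ → ℂ, Integrable h → MemLp h 2 volume → (∀ ξ, ξ ∉ Y → h ξ = 0) →
        c₃ * ∫ ξ, ‖h ξ‖ ^ 2 ≤
          ∫ x in ⋃ j : ℤ, Icc (t j - c₁ / 2) (t j + c₁ / 2), ‖(𝓕⁻ h : ℝ → ℂ) x‖ ^ 2 := by
  obtain ⟨c₃, hc₃, H⟩ := bd18_prop31_core hL31 hδ0 hδ1 hC hc₁ hc₁1
  refine ⟨c₃, hc₃, fun α₁ hα₁ Y hY hYreg t ht h hhi hh2 hhY => ?_⟩
  -- a measurable modification of `h` vanishing off `Y`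
  have hYm : MeasurableSet Y := hYreg.measurableSet
  set h₀ : ℝ → ℂ := Y.indicator (hhi.1.mk h) with hh₀
  have hh₀m : Measurable h₀ := hhi.1.stronglyMeasurable_mk.measurable.indicator hYm
  have hhind : Y.indicator h = h := by
    funext ξ
    by_cases hξ : ξ ∈ Y
    · rw [indicator_of_mem hξ]
    · rw [indicator_of_notMem hξ, hhY ξ hξ]
  have hh₀ae : h₀ =ᵐ[volume] h := by
    have h1 : Y.indicator (hhi.1.mk h) =ᵐ[volume] Y.indicator h :=
      (hhi.1.ae_eq_mk).symm.indicator
    rw [hhind] at h1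
    exact h1
  have hh₀Y : ∀ ξ, ξ ∉ Y → h₀ ξ = 0 := fun ξ hξ => indicator_of_notMem hξ _
  have hh₀i : Integrable h₀ := hhi.congr hh₀ae.symm
  have hh₀2 : MemLp h₀ 2 volume := hh2.ae_eq hh₀ae.symm
  have key := H α₁ hα₁ Y hY hYreg t ht h₀ hh₀m hh₀i hh₀2 hh₀Y
  have e1 : ∫ ξ, ‖h₀ ξ‖ ^ 2 = ∫ ξ, ‖h ξ‖ ^ 2 :=
    integral_congr_ae (hh₀ae.mono fun ξ hξ => by simp only [hξ])
  have e2 : (𝓕⁻ h₀ : ℝ → ℂ) = 𝓕⁻ h := by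
    funext x
    rw [fourierInv_real_eq, fourierInv_real_eq]
    exact integral_congr_ae (hh₀ae.mono fun v hv => by simp only [hv])
  rw [e1, e2] at key
  exact key

end Prop31Assembly

end Literature.Analysis.Fourier

/-!
## Part 6. BD18 Theorem 4 (fractal uncertainty principle for `δ`-regular sets): the discharge

Topic `Literature/Analysis/Fourier`. J. Bourgain, S. Dyatlov, *Spectral gaps without the pressure
condition*, Ann. of Math. 187 (2018) 825–867 (= arXiv:1612.09040), Theorem 4: for `0 ≤ δ < 1`,
`C_R ≥ 1` there are `β > 0`, `C` such that for all `N ≥ 1` and all `X ⊂ [-1,1]`, `Y ⊂ [-N,N]`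
which are `δ`-regular with constant `C_R` on scales `N⁻¹` to `1`, resp. `1` to `N`,
`‖1_X 𝓕⁻ 1_Y‖_{L² → L²} ≤ C N^{-β}` — the named fact `bourgainDyatlov2018_thm4` of
`FractalUncertaintyPrinciple.lean`.

The proof assembled here follows the paper (§§2–3) with ONE deviation: the adapted multiplier of
Lemma 3.1 is not obtained from the Beurling–Malliavin multiplier theorem but by the explicit
holomorphic construction of `EffectiveMultiplier.lean` (after Jin–Zhang, arXiv:1710.00250,
Theorem 12), see `AdaptedMultiplier.lean`. The pieces:

* §2.2 (regular sets), §3.4 (the iteration argument) and the reduction of Theorem 4 to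
  Proposition 3.1: `bourgainDyatlov2018_thm4_of_prop31` (`FractalUncertaintyReduction.lean`);
* Lemma 3.1: `bd18_lemma_3_1` (`AdaptedMultiplier.lean`);
* Lemma 3.2: `bourgainDyatlov2018_lemma_3_2` (`FractalUncertaintyHarmonicBound.lean`);
* Lemma 3.3 and Proposition 3.1: `weighted_step`, `bd18_prop31_of_lemma31`
  (`FractalUncertaintyWeightedStep.lean`, `FractalUncertaintyProp31.lean`).

* `bd18_prop31` — Proposition 3.1 of the paper (in the `g`-language), unconditionally;
* `bourgainDyatlov2018_thm4_holds` — the discharge `theorem … : bourgainDyatlov2018_thm4`.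
-/

namespace Literature.Analysis.Fourier

open _root_.MeasureTheory Set
open scoped FourierTransform Real

/-- **BD18 Proposition 3.1** (the iterative step), in the `g`-language of
`FractalUncertaintyReduction.lean`: for `0 < δ < 1`, `C ≥ 1`, `0 < c₁ ≤ 1` there is `c₃ > 0`
(depending only on `δ, C, c₁`) such that for `α₁ ≥ 2`, every `Y ⊂ [-α₁, α₁]` which is
`δ`-regular with constant `C` on scales `1` to `α₁`, windows `[t_j - c₁/2, t_j + c₁/2] ⊂ [j, j+1]`
and every `h ∈ L¹ ∩ L²` vanishing off `Y`:
`c₃ ∫ |h|² ≤ ∫_{⋃_j [t_j - c₁/2, t_j + c₁/2]} |𝓕⁻ h|²`.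
[cite: BourgainDyatlov2018, Proposition 3.1] -/
theorem bd18_prop31 : ∀ (δ C c₁ : ℝ), 0 < δ → δ < 1 → 1 ≤ C → 0 < c₁ → c₁ ≤ 1 →
    ∃ c₃ : ℝ, 0 < c₃ ∧ ∀ α₁ : ℝ, 2 ≤ α₁ → ∀ Y : Set ℝ, Y ⊆ Icc (-α₁) α₁ →
      IsRegularSet Y δ C 1 α₁ →
      ∀ t : ℤ → ℝ, (∀ j : ℤ, Icc (t j - c₁ / 2) (t j + c₁ / 2) ⊆ Icc (j : ℝ) ((j : ℝ) + 1)) →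
      ∀ h : ℝ → ℂ, Integrable h → MemLp h 2 volume → (∀ ξ, ξ ∉ Y → h ξ = 0) →
        c₃ * ∫ ξ, ‖h ξ‖ ^ 2 ≤
          ∫ x in ⋃ j : ℤ, Icc (t j - c₁ / 2) (t j + c₁ / 2), ‖(𝓕⁻ h : ℝ → ℂ) x‖ ^ 2 :=
  fun _ _ _ hδ0 hδ1 hC hc₁ hc₁1 =>
    bd18_prop31_of_lemma31 (fun _ _ _ h1 h2 h3 h4 => bd18_lemma_3_1 h1 h2 h3 h4) hδ0 hδ1 hC hc₁ hc₁1

/-- **BD18 Theorem 4 holds** (fractal uncertainty principle for `δ`-regular sets, `0 ≤ δ < 1`):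
the named fact `bourgainDyatlov2018_thm4` is a theorem. The multiplier of Lemma 3.1 is constructed
explicitly (Jin–Zhang) instead of via Beurling–Malliavin; otherwise the proof is the paper's.
[cite: BourgainDyatlov2018, Theorem 4] -/
theorem bourgainDyatlov2018_thm4_holds : bourgainDyatlov2018_thm4 :=
  bourgainDyatlov2018_thm4_of_prop31 bd18_prop31

end Literature.Analysis.Fourier

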